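import Summits.QuantumFields.YangMills.Theorems.CurvatureBoostCovariance.Negative.Unbundled
import Summits.QuantumFields.YangMills.Theorems.CurvatureBoostCovariance.Negative.OnAllTestsFalse
import Summits.QuantumFields.YangMills.Theorems.NPointIsotropy.Negative.NPointRegularJunk
import Summits.QuantumFields.YangMills.Theorems.MirrorModularBoostsCurvatureBoostCovarianceTensorDensity
import Summits.QuantumFields.YangMills.Theorems.MirrorModularBoostsCurvatureBoostCovarianceDoubledToInvariant
import Summits.QuantumFields.YangMills.Theorems.MirrorModularBoostsCurvatureBoostCovarianceRayPositivityCore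
import Summits.QuantumFields.YangMills.Theorems.MirrorModularBoostsCurvatureBoostCovarianceRayPositivity
import Summits.QuantumFields.YangMills.Theorems.MirrorModularBoostsCurvatureBoostCovarianceOrbitBandlimit
import Summits.QuantumFields.YangMills.Theorems.MirrorModularBoostsCurvatureBoostCovarianceLevelGrowthLow
import Summits.QuantumFields.YangMills.Theorems.MirrorModularBoostsCurvatureBoostCovarianceParitySieve
import Summits.QuantumFields.YangMills.Theorems.MirrorModularBoostsPlanarSpectralCone
import Summits.QuantumFields.YangMills.Theorems.PencilRigidityShellRigidity
import Literature.MathematicalPhysics.QuantumFieldTheory.OSReconstructionNoE1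
import Summits.QuantumFields.YangMills.Theorems.MirrorModularBoostsSoftKernelBoostCovarianceLaurentLayers
import Summits.QuantumFields.YangMills.Theorems.MirrorModularBoostsSoftKernelBoostCovarianceLevelGrowthHighOfBoostType
import Summits.QuantumFields.YangMills.Theorems.MirrorModularBoostsSoftKernelBoostCovarianceOrbitBandlimitLocal
import Summits.QuantumFields.YangMills.Theorems.MirrorModularBoostsSoftKernelBoostCovarianceRayPositivityLocal
import Summits.QuantumFields.YangMills.Theorems.MirrorModularBoostsSoftKernelBoostCovarianceConeFamily
import Summits.QuantumFields.YangMills.Theorems.MirrorModularBoostsSoftKernelBoostCovarianceInsertionOps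
import Summits.QuantumFields.YangMills.Theorems.MirrorModularBoostsSoftKernelBoostCovarianceHilbertVitali
import Summits.QuantumFields.YangMills.Theorems.MirrorModularBoostsSoftKernelBoostCovarianceBumpChainLink
import Summits.QuantumFields.YangMills.Theorems.MirrorModularBoostsSoftKernelBoostCovarianceLowerBlock
import Summits.QuantumFields.YangMills.Theorems.MirrorModularBoostsSoftKernelBoostCovarianceRadialRiemann
import Summits.QuantumFields.YangMills.Theorems.MirrorModularBoostsSoftKernelBoostCovarianceSlotProductExpansion
import Summits.QuantumFields.YangMills.Theorems.MirrorModularBoostsSoftKernelBoostCovarianceSlotProductExpansionJoint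
import Summits.QuantumFields.YangMills.Theorems.MirrorModularBoostsSoftKernelBoostCovarianceAsmGeometryMargins
import Summits.QuantumFields.YangMills.Theorems.MirrorModularBoostsSoftKernelBoostCovarianceAsmGeometryRot
import Summits.QuantumFields.YangMills.Theorems.MirrorModularBoostsSoftKernelBoostCovarianceAsmSuperpositionTools
import Summits.QuantumFields.YangMills.Theorems.MirrorModularBoostsSoftKernelBoostCovarianceAsmConstantsAndBumps
import Summits.QuantumFields.YangMills.Theorems.MirrorModularBoostsSoftKernelBoostCovarianceBumpChain
import Summits.QuantumFields.YangMills.Theorems.MirrorModularBoostsSoftKernelBoostCovarianceAsmHeightsVitali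
import Summits.QuantumFields.YangMills.Theorems.MirrorModularBoostsSoftKernelBoostCovarianceAsmBumpChainOps
import Summits.QuantumFields.YangMills.Theorems.MirrorModularBoostsSoftKernelBoostCovarianceAsmTermChainFree
import Summits.QuantumFields.YangMills.Theorems.MirrorModularBoostsSoftKernelBoostCovarianceAsmUniformBoost
import Summits.QuantumFields.YangMills.Theorems.MirrorModularBoostsSoftKernelBoostCovarianceAsmTypedBoost
import Summits.QuantumFields.YangMills.Theses.CertificationLength
import Summits.QuantumFields.YangMills.Theses.IsotropyFromPowerCounting
import Summits.QuantumFields.YangMills.Theorems.IsotropyFromPowerCountingEngineFromPowerCounting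
import Summits.QuantumFields.YangMills.Theorems.MirrorModularBoostsSoftKernelBoostCovarianceStepZeroOfLattice
import Summits.QuantumFields.YangMills.Theorems.MirrorModularBoostsSoftKernelBoostCovarianceBelowThresholdOfSoftKernel
import Summits.QuantumFields.YangMills.Theorems.IsotropyFromPowerCountingTemperedCurvatureMomentsBddRenormalisationOrderZero
import Summits.QuantumFields.YangMills.Theorems.IsotropyFromPowerCountingTemperedCurvatureMomentsDegreeTwoOfKernel
import Summits.QuantumFields.YangMills.Theorems.CurvatureSandwichBound.Negative.Unbundled
import Summits.QuantumFields.YangMills.Theorems.IsotropyFromPowerCountingCurvatureSandwichBoundChainEngine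
import Summits.QuantumFields.YangMills.Theorems.PencilRigidityNPointIsotropyUnorderedRP
import Summits.QuantumFields.YangMills.Theorems.MirrorModularBoostsSoftKernelBoostCovarianceDiagCorePeel
import Summits.QuantumFields.YangMills.Theorems.MirrorModularBoostsSoftKernelBoostCovarianceDiagCloudGrowth
import Summits.QuantumFields.YangMills.Theorems.MirrorModularBoostsSoftKernelBoostCovarianceDiagEngine
import Summits.QuantumFields.YangMills.Theorems.MirrorModularBoostsSoftKernelBoostCovarianceDiagOfBoxes
import Summits.QuantumFields.YangMills.Theorems.MirrorModularBoostsSoftKernelBoostCovarianceDiagGrowthT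
import Summits.QuantumFields.YangMills.Theorems.MirrorModularBoostsSoftKernelBoostCovarianceOfAxisRow

/-!
# Line `Sketch` (idea `transverse-slack-heat-sandwich`) — checked skeleton v3.12 for crux
`MirrorModularBoosts.SoftKernelBoostCovariance` (stmt-QuantumFields-14999; route-QuantumFields-MirrorModularBoosts)

Leads: prover-line-stmt-QuantumFields-14999-0 (opening, v1–v2.3, 2026-08-16) → prover-line-stmt-QuantumFields-14999-c1-0
(continuation c1, v3–v3.4) → prover-line-stmt-QuantumFields-14999-c2-0 (continuation c2, v3.5, 2026-08-17) →
prover-line-stmt-QuantumFields-14999-c3-0 (continuation c3, v3.6, 2026-08-17) → prover-line-stmt-QuantumFields-14999-c4-0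
(continuation c4, v3.7, 2026-08-17) → …-c5-0 (c5, v3.8 kept; T-side support p140303 p140611 p140708 p140940) → …-c6-0 (c6, v3.9,
2026-08-17).  PICKED.md / Lines/Sketch.md in the crux dir.

v3.13 (lead c14, prover-line-stmt-QuantumFields-14999-c14-0, 2026-08-17T14:2xZ): THE CLOSING COMPOSITION IS LANDED — registered stub
`stub_cruxOfAxisRow : (stub_regularHigh text) → (stub_sandwichAxis text) → SoftKernelBoostCovariance` proved in
`Theorems/MirrorModularBoostsSoftKernelBoostCovarianceOfAxisRow.lean` (p164803; with the v3.12 glue `sandwichBound_mono`, `diag_of_axis`,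
`sandwichRows_planeRot_of_axis` and the by-name adapters `softKernelBoostCovariance_of_items'` (items T + Σ), `…_of_regularHigh_of_item'` (Σ's axis
row only), `axisRows_of_chainGrowthAxis` / `…_of_regularHigh_of_chainGrowthAxis` (the Σ-lead's leaf `stub_chainGrowthAxis` verbatim),
`nPointIsotropyBelowThreshold_of_axisRow` (stmt-16180)).  `SoftKernelBoostCovariance_of''` / `NPointIsotropyBelowThreshold_of''` below are the one-line
closures through it; the in-file composition `SoftKernelBoostCovariance_of` is kept as the documented chain.  Sorry-backed stubs unchanged:
`stub_regularHigh` (YM; = item stmt-17721 / 17723), `stub_sandwichAxis` (YM, THE BET; = the axis row of item stmt-18372 = its leaf `stub_chainGrowthAxis`).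

v3.12 (lead c13, prover-line-stmt-QuantumFields-14999-c13-0, 2026-08-17T12:xxZ): THE 45° ROW IS FREE GIVEN REGULARITY — the Σ sorry
shrinks to the AXIS row `stub_sandwichAxis : … → SandwichRows S₁` (= the first row of item stmt-18372 / its lead's `stub_chainGrowthAxis`);
the `45°` row of `stub_sandwichPair` (v3.11 text, now a THEOREM) is derived model-blindly from it and `NPointRegular S₁` (Step 0) by reading
the diagonal multiple-reflection chains in the `e₀` frame: registered model-blind stubs `stub_diagCorePeel` (C), `stub_diagCloudGrowth` (D),
`stub_diagGrowthT` (G, lead), `stub_diagEngine` (E), `stub_diagOfBoxes` (F) + glue `nPointRegular_pullBack`, `sandwichBound_mono`,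
`diag_of_axis` (see the section docstring `## v3.12`).  After v3.12 the crux no longer consumes the diagonal leaf `stub_chainGrowthDiag` of
stmt-18372.  Registered sorry-backed stubs: `stub_regularHigh` (YM), `stub_sandwichAxis` (YM, THE BET), (C), (D), (G), (E), (F).

v3.11 (c6, 2026-08-17T06:4xZ): THE Σ SORRY IS NOW WHAT THE LINE CONSUMES — `stub_sandwichPair`: Σ in the `e₀` frame with `μ < 4`
AND Σ in the `45°` frame with an ARBITRARY exponent (the chain uses the pull-back only through its uniform boost vectors; the item's
`μ < 4` there was discarded by the composition since v2).  The item Σ (stmt-18372) closes it in one line (`sandwichPair_of_item`); the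
landed twins are `stub_planarInvariantOfInputsWeak` / `cruxOfInputsKWeak` / `sandwichPair_of_curvatureSandwichBound`
(`Theorems/…PlanarInvariantOfInputsWeak.lean`, p143258) and `stub_stepZeroByDegrees` / `softKernelBoostCovariance_of_regularHigh(_of_sandwich)`
(`Theorems/…StepZeroByDegrees.lean`, p142709; this copy keeps the skeleton-local glue until the farm has built that module).  Registered
sorry-backed stubs: `stub_regularHigh` (Step-0 residual), `stub_sandwichPair` (Σ residual, THE BET); the crux is kernel-checked modulo exactly
these two properties of the Wilson limit `S₁` (closing term: `cruxOfInputsKWeak (stub_stepZeroByDegrees h3) hPair`).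

v3.10 (c6, 2026-08-17T05:3xZ): THE STEP-0 SORRY IS NOW WHAT THE LINE CONSUMES — `stub_regularHigh`: for `n ≥ 3`, `𝔖ₙ|⁰𝒮` is
integration against a function (a property of the Wilson limit `S₁` alone; no lattice densities).  Degree 0 = E0, degree 1 = the
degree-one layer of T along every tied scheme (p140708) through the per-degree glue `regular_of_temperedApproximants` (= the body of the
landed `stub_stepZeroOfLattice`), degree 2 = the kernel triple; each of the items T (stmt-17721, `regularHigh_of_item`) and
`CurvatureDensities` (stmt-17723, `regularHigh_of_curvatureDensities`), and the v3.9 residual (`regularHigh_of_temperedHigh`), closes the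
stub in one line.  Registered sorry-backed stubs: `stub_regularHigh`, `stub_sandwichBound` (= item stmt-18372, THE BET).

v3.9 (c6, 2026-08-17T04:5xZ): THE STEP-0 SORRY SHRINKS TO THE GENUINE RESIDUAL OF T — degrees `n ≥ 3` under the crux's own kernel
triple (`stub_temperedHigh`).  Degree 1 of T is LANDED on every tied scheme (`DegreeOne.temperedCurvatureMoments_one`, p140708) and
degree 2 is the kernel triple (`DegreeTwo.temperedCurvatureMoments_two_of_kernel`, p140940, no tie); `temperedWithKernel_text` (all
degrees, kernel-fed) is proved from them and the stub, and feeds `stub_tieRegularity` → `SoftKernelBoostCovariance_of` unchanged.  The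
item `TemperedCurvatureMoments` (stmt-17721) closes the stub in one line (`temperedHigh_of_item`); the by-name closure recipe from the two
items is `SoftKernelBoostCovariance_of_items` (= the proved engine stmt-17722).  Registered sorry-backed stubs: `stub_temperedHigh`,
`stub_sandwichBound` (= item stmt-18372, THE BET).

v3.8 (c4, 2026-08-17T02:4xZ): THE TWO YANG–MILLS INPUTS ARE NOW ROUTE ITEMS, REFERENCED BY NAME — the planner of route
`IsotropyFromPowerCounting` (lens 3.4) filed `TemperedCurvatureMoments` (stmt-17721 = the v3.7 text of `stub_temperedLatticeApproximants`)
and `CurvatureSandwichBound` (stmt-18372 = the v3.7 text of `stub_sandwichBound`, `45°` frame named by coordinates); the two sorry-backed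
stubs are now exactly those decls; the typed split `EngineFromPowerCounting : T → Σ → B′` (stmt-17722) is proved from this line's landed
pieces (`Theorems/IsotropyFromPowerCountingEngineFromPowerCounting.lean`, p138806), so `SoftKernelBoostCovariance_of'` below is a one-liner.

v3.7 (c4, 2026-08-17): Step 0 ALIGNED WITH THE SHARED LATTICE RESIDUAL of the sibling cruxes 9663 / 11686 — the sorry-backed
Yang–Mills input of Step 0 is now `stub_temperedLatticeApproximants` (BYTE-IDENTICAL with the registered text on stmt-9663,
reshape 8: tempered renormalised lattice moment densities tied to `S₁ n` on off-diagonal real tensors, so that ONE item closes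
Step 0 on all three cruxes), and `stub_tieRegularity` (v3.6 text) is PROVED from it through the new registered model-blind stub
`stub_stepZeroOfLattice` (pointwise: normalisation + tempered tied approximants ⇒ `NPointRegular`; provable now from the LANDED
analysis halves `BoostsInheritMirrors.stub_dominatedTieLimit` p108509 / `stub_regular_of_dominated` p109000).  New registered
stub `stub_belowThresholdOfSoftKernel` (`SoftKernelBoostCovariance → CertificationLength.NPointIsotropyBelowThreshold`, via the
closed `PlanarSpectralCone_of`; provable now) and the by-name corollary `NPointIsotropyBelowThreshold_of`: the skeleton now
closes the sibling route's crux stmt-QuantumFields-16180 modulo the SAME two Yang–Mills inputs.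

v3.6 (c3, 2026-08-17): `stub_tieRegularity` RESHAPED — weakened by the crux's own kernel-triple hypothesis (the composition feeds
`hK`; degree 2 becomes free; the hand-back item `CurvatureRegularity` is exactly this weaker statement); the POINTWISE model-blind
composition `stub_planarInvariantOfInputs` (ONE family: OS package + translations + hypercubic + eight frames + cone + kernel triple +
`NPointRegular` + the two sandwich bounds ⇒ `PlanarInvariant`) and `cruxOfInputsK` / `crux_of_pointwiseInputs` landing as
`Theorems/MirrorModularBoostsSoftKernelBoostCovariancePlanarInvariantOfInputs.lean` (p136406).  Still TERMINAL: the sorry-backed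
stubs are EXACTLY the two Yang–Mills inputs.

v3.5 STATUS (c2, 2026-08-17) — TERMINAL FOR THE LINE.  Sorry-backed stubs in THIS file: EXACTLY the two Yang–Mills inputs
`stub_tieRegularity` (Step 0) and `stub_sandwichBound` (Σ, THE BET); promote-stub hand-back (evidence HANDBACK.md, Lines/Sketch.md).
EVERYTHING MODEL-BLIND IS LANDED and referenced BY NAME: (N) p100538, (T1) p107219, (T6) p107687, (T3a) p113974, (T3b) p134904,
(T5) p116767, (T4b) p117390, (T4a per-slot) p117686, (T4a-joint) p134442, (3ℓ) p102333, (4ℓ) p102747, (L3) p96941, (5b') p97905,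
assembly packages p119102 p119103 p119105 p133380, (A1) p134806 heights + Vitali, (G) p135335 bump chains with insertion
operators, (A3) p135441 term chain with free lower block, (Ui) p135459 uniform boost vectors, (Uii) p135579 typed boost vectors.
(T*) `stub_chainBoostVectors = ⟨Ui, Uii⟩` (re-registered with `0 ≤ μ`); the composition runs the chain with `max μ 0 < 4`
(`sandwich_mono_exponent`).  `SoftKernelBoostCovariance_of` concludes the crux BY NAME (rc 0, 2 sorries).  Reshape history v3.5: the
assembly consumes the JOINT localisation (one support point of `F` per term for all slots); c1's unpublished lab assembly (v3.4) was
re-derived as the registered pieces G/A1/A3/Ui/Uii.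

THE CRUX (`softKernelBoostCovariance_iff` below, definitional): for every compact simple `G` (Borel σ-algebra),
`W1 r sch S₁ → EightFrameRP S₁ → PlanarCone S₁ → (kernel triple of S₁ 2 : K real, continuous off 0,
|K x| ≤ C (1 + ‖x‖^(η-10)), η > 0, S₁ 2|⁰𝒮 = ∫ K(x₀ - x₁)·) → PlanarInvariant S₁`.

THE LINE.  Spine = the parent crux's registered skeleton `Cruxes/CurvatureBoostCovariance/Lines/boosts_inherit_mirrors.lean`
(`SoftKernelBoostCovariance_of` by name; eleven stub files landed by the 9663 lead; `stub_planarCone` = landed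
`PlanarSpectralCone_of`, `stub_shellRigidity` = landed `ShellRigidity_proof`), whose two XL analytic inputs (universal OS-II boost
vectors; level-`≥ 2` growth) are BOTH replaced by ONE operator chain fed by ONE Yang–Mills input (idea card
`transverse-slack-heat-sandwich`; pointwise twin: the Ising programme's `OSBoostChains` / `PointwiseOSBoost*`):

* `stub_sandwichBound` (Σ) — THE YM INPUT (the bet): the transversely filtered heat-sandwich bound with exponent `μ < 4`, in
  per-degree VECTOR form over the `e₀`-reconstruction's field vectors, for `S₁` AND for its `45°` pull-back.  v3: the former
  `def PlanarSandwichBound` is INLINED in every signature (Theorems files cannot import this Cruxes file).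
* `stub_coneFamily` (N) — LANDED p100538.  `stub_insertionOps` (T1) — LANDED p107219.  `stub_hilbertVitali` (T6) — LANDED p107687.
  (T1/T6 are kept `sorry`-backed in THIS copy only until the farm has built their modules; the tree theorems are
  `Summit.QuantumFields.YangMills.Theorems.SoftKernelBoostCovariance.Sketch.stub_insertionOps / stub_hilbertVitali`.)
* v3 RESHAPE of the model-blind analysis `stub_chainBoostVectors` (T*): its analytic ingredients are registered stubs taken as
  hypotheses — `stub_bumpChain` (T3: one link of the chain + the chain of a RADIAL-bump tensor; radial planar profiles make
  translation-only chains reproduce rotated tensors), `stub_lowerBlock` (T5: the reserve-aware lower block does not grow when the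
  doubled degree is planar-invariant — pencil identity with a cone-family matrix element), `stub_slotProductExpansion` (T4a:
  bump-tensor approximation of compactly supported test functions with coefficient mass independent of the radius, from the
  tree's nuclear expansion) and `stub_radialRiemann` (T4b: radial Riemann approximation in `𝓢(ℝ²)`), plus the landed T1, T6.
  T* itself (the assembly: geometry margins, reserves `≍ e^{-R}` per height, identity theorem across reserves, Vitali) is the
  LEAD's stub.
* `stub_orbitBandlimitLocal`, `stub_rayPositivityLocal` — LANDED p102333 / p102747.  `stub_laurentLayers` (L3) — LANDED p96941.
  `stub_levelGrowthHigh_of_boostType` (5b') — LANDED p97905.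
* `stub_tieRegularity` — Step 0, USES THE TIE, kept verbatim (property of the Wilson limit; promote-stub on record).

REGISTERED STUBS v3: OPEN `stub_tieRegularity` (YM), `stub_sandwichBound` (YM, THE BET), `stub_chainBoostVectors` (T*, lead),
`stub_bumpChain` (T3), `stub_lowerBlock` (T5), `stub_slotProductExpansion` (T4a), `stub_radialRiemann` (T4b) — provable now,
wave 4.  Composition: `levelGrowthLow_of_kernel` (sorry-free), `sieve_of_stubs`, `SoftKernelBoostCovariance_of` (the crux BY NAME).
Disproof honoured: parent `Cruxes/CurvatureBoostCovariance/Disproof.lean` §1b (tie load-bearing: Step 0 and (Σ)), §4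
(`IsOffDiagonal` kept), §6 (β ≡ 0 collapse: (Σ) holds there with μ = 0, C = |κ|; (T*) gives constant `V`); this crux's
Disproof §5 (junk: every model-blind stub's conclusion holds with `V ≡ 0`; the tie enters only via Step 0 and (Σ)).
-/

noncomputable section

-- tree-known file-local workaround (as in the landed `Negative/*.lean` files and the parent skeleton)
attribute [-instance] SimplexCategory.instFintypeToTypeOrderHomFinHAddNatLenOfNat

namespace Summit.QuantumFields.YangMills.Cruxes.SoftKernelBoostCovariance.Sketch

open scoped BigOperators SchwartzMap InnerProductSpace
open MeasureTheory Filter Topology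
open Literature.MathematicalPhysics.QuantumLattice Literature.MathematicalPhysics.AQFT
  Literature.MathematicalPhysics.QuantumFieldTheory
open Summit.QuantumFields.YangMills.Theorems.NPointIsotropy.Negative (E4 NPointRegular)
open Summit.QuantumFields.YangMills.Theorems.CurvatureBoostCovariance.Negative
  (OSPackage Translations Hypercubic EightFrameRP PlanarCone PlanarInvariant Tie Gaps W1)
open Summit.QuantumFields.YangMills.Theorems.CurvatureBoostCovariance.BoostsInheritMirrors
  (stub_orbitBandlimit stub_rayPositivity stub_doubledToInvariant stub_tensorDensity stub_paritySieve
    trigPoly_coeff_eq_zero_of_const)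
open Summit.QuantumFields.YangMills.Theorems.SoftKernelBoostCovariance.Sketch
  (stub_stepZeroOfLattice stub_belowThresholdOfSoftKernel engineFromPowerCounting_proof
    sandwichBound_planeRot_of_curvatureSandwichBound)
open Summit.QuantumFields.YangMills.Theorems.NPointIsotropy.ComplexRotationBandlimit (residual_zero)
open Summit.QuantumFields.YangMills.Theorems.CurvatureBoostCovariance.BoostsInheritMirrors
  (stub_dominatedTieLimit stub_regular_of_dominated)
open Literature.Probability.LatticeModels (box Site)
open Summit.QuantumFields.YangMills.Theorems.CurvatureBoostCovariance.BoostsInheritMirrors.RayPositivity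
  (pencil_eq_inner orbit_eq_inner osReconstruction_of exists_isTimeOrdered_planeRot translations_pullBack
    isSymmetric_pullBack hasLinearGrowth_pullBack isReflectionPositive_pullBack eightFrameRP_pullBack planarCone_pullBack)
open Summit.QuantumFields.YangMills.Theorems.CurvatureSandwichBound.Negative (SandwichBound SandwichRows)

/-! ## Step 0 — v3.10: the Yang–Mills residual of Step 0 is `𝔖ₙ|⁰𝒮 ∈ L¹_loc` for the degrees `n ≥ 3` (under the kernel triple)

What the line CONSUMES of Step 0 is `NPointRegular S₁` (every `𝔖ₙ|⁰𝒮` is integration against a function); the tempered lattice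
densities of T are one SUFFICIENT condition for it (landed glue `stub_stepZeroOfLattice`, p137944 = `stub_dominatedTieLimit` p108509 +
`stub_regular_of_dominated` p109000).  Degree `0` is E0 (`residual_zero`), degree `2` IS the kernel triple of the crux (the representing
function `y ↦ K(y₀ − y₁)`), and degree `1` follows from the degree-one layer of T, which holds along EVERY tied scheme (LANDED p140708,
`DegreeOne.temperedCurvatureMoments_one`: the true density is the renormalised mean `κ_k`, bounded by the degree-one tie).  So the
sorry-backed Step-0 stub is now `stub_regularHigh` = `𝔖ₙ|⁰𝒮` is a function for `n ≥ 3` — a statement about the Wilson limit `S₁` ALONE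
(no lattice densities, no Riemann sums), strictly weaker than the v3.9 residual `stub_temperedHigh` (degrees `≥ 3` of T,
`regularHigh_of_temperedHigh`), than the item T = `TemperedCurvatureMoments` (stmt-17721, `regularHigh_of_item`) and than the item
`CurvatureDensities` (stmt-17723, `regularHigh_of_curvatureDensities`): each closes it in one line.  History: v3.6 kernel antecedent →
v3.7 shared lattice residual → v3.8 items by name → v3.9 degrees `≥ 3` of T → v3.10 regularity of degrees `≥ 3`. -/

/-- **Stub 1a-reg — THE YANG–MILLS RESIDUAL OF STEP 0 (v3.10): for `n ≥ 3`, `𝔖ₙ|⁰𝒮` of the curvature channel is integration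
against a function (USES THE TIE; difficulty XL = a UV regularity property of the Wilson limit of `tr F²`: no singular part of the
renormalised `n`-point functions off the coincidence locus — in particular none on the exceptional set `𝔈ₙ ⊋` coincidence locus of the
sixteen frames, `NPointIsotropy.Negative.four_points_not_frame_separated`, where every typed OS clause is blind).**  For every compact
simple `G`, `r`, `sch`, `S₁` with `W1 r sch S₁`, the eight planar frames, the planar cone AND the kernel triple of `S₁ 2|⁰𝒮`, and every
degree `n ≥ 3`: a function `W : (ℝ⁴)ⁿ → ℂ` with `W · F ∈ L¹` and `S₁ n F = ∫ W · F` for every off-diagonal `F`.  Sufficient: the item T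
(tempered tied lattice densities ⇒ domination `‖𝔖ₙ F‖ ≤ ∫ ‖F‖ w` ⇒ function, landed), the item `CurvatureDensities`; certified
inhabitants: `c ≡ 0` (`W = 0`), `β ≡ 0` / bounded `c_k` (`W = κⁿ`), the vacuum; junk violates it (`not_nPointRegular_junk`), so the tie
is load-bearing here (Disproof §1). -/
theorem stub_regularHigh :
    open Literature.MathematicalPhysics.QuantumLattice Literature.MathematicalPhysics.AQFT
      Literature.MathematicalPhysics.QuantumFieldTheory
      Summit.QuantumFields.YangMills.Theorems.CurvatureBoostCovariance.Negative
      Summit.QuantumFields.YangMills.Theorems.NPointIsotropy.Negative in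
    ∀ (G : Type) [Group G] [TopologicalSpace G] [IsTopologicalGroup G] [CompactSpace G]
      [MeasurableSpace G] [BorelSpace G], IsCompactSimpleLieGroup G →
      ∀ (r : LatticeRep G) (sch : SpeciesScheme (YMSpecies G)) (S₁ : SchwingerFamily E4),
        W1 r sch S₁ → EightFrameRP S₁ → PlanarCone S₁ →
        (∃ (K : E4 → ℝ) (C η : ℝ), 0 < η ∧ ContinuousOn K {x : E4 | x ≠ 0} ∧
          (∀ x : E4, x ≠ 0 → |K x| ≤ C * (1 + ‖x‖ ^ (η - 10))) ∧
          ∀ F : SchwartzMap (Fin 2 → E4) ℂ, IsOffDiagonal F →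
            MeasureTheory.Integrable (fun x : Fin 2 → E4 => (K (x 0 - x 1) : ℂ) * F x) ∧
              S₁ 2 F = ∫ x : Fin 2 → E4, (K (x 0 - x 1) : ℂ) * F x) →
        ∀ n : ℕ, 3 ≤ n → ∃ W : (Fin n → E4) → ℂ, ∀ F : SchwartzMap (Fin n → E4) ℂ, IsOffDiagonal F →
          MeasureTheory.Integrable (fun y : Fin n → E4 => W y * F y) ∧ S₁ n F = ∫ y : Fin n → E4, W y * F y := by
  sorry

/-- **Per-degree glue: tempered tied lattice approximants in degree `n` ⇒ `𝔖ₙ|⁰𝒮` is a function** (the body of the landed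
`stub_stepZeroOfLattice`, p137944, read in one degree: the tempered weight is measurable, nonnegative and continuous off the coincidence
locus; `stub_dominatedTieLimit` gives the domination `‖𝔖ₙ F‖ ≤ ∫ ‖F‖ w` on `⁰𝒮`, `stub_regular_of_dominated` the representing function). -/
theorem regular_of_temperedApproximants
    (a : ℕ → ℝ) (L : ℕ → ℕ) (S₁ : SchwingerFamily E4) (ha_pos : ∀ k, 0 < a k)
    (ha_tendsto : Filter.Tendsto a Filter.atTop (nhds 0))
    (haL : Filter.Tendsto (fun k => a k * L k) Filter.atTop Filter.atTop) (n : ℕ) (hn : 0 < n)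
    (happrox : ∃ (D : ℕ → (Fin n → Site 4) → ℝ) (C : ℝ) (N k₀ : ℕ), 0 < C ∧
          (∀ k : ℕ, k₀ ≤ k → ∀ x : Fin n → Site 4, (∀ i, x i ∈ box 4 (L k)) → Function.Injective x →
            |D k x| ≤ C * (1 + ‖fun i => a k • siteToE (x i)‖) ^ N *
              (1 + ∑ i, ∑ j ∈ Finset.univ.erase i, ‖a k • siteToE (x i) - a k • siteToE (x j)‖⁻¹) ^ N) ∧
          ∀ (f : Fin n → SchwartzMap E4 ℝ) (F : SchwartzMap (Fin n → E4) ℂ),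
            IsTensorOf F (fun i => ofRealTest (f i)) → IsOffDiagonal F →
            Filter.Tendsto (fun k => (((a k ^ 4) ^ n *
              ∑ x ∈ Fintype.piFinset (fun _ : Fin n => box 4 (L k)),
                (∏ i, f i (a k • siteToE (x i))) * D k x : ℝ) : ℂ)) Filter.atTop (nhds (S₁ n F))) :
    ∃ W : (Fin n → E4) → ℂ, ∀ F : SchwartzMap (Fin n → E4) ℂ, IsOffDiagonal F →
      MeasureTheory.Integrable (fun y : Fin n → E4 => W y * F y) ∧ S₁ n F = ∫ y : Fin n → E4, W y * F y := by
  obtain ⟨D, C, N, k₀, hCpos, hbound, htie⟩ := happrox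
  -- the tempered weight, read on continuum configurations
  have hcont : ContinuousOn (fun y : Fin n → E4 => C * (1 + ‖y‖) ^ N *
      (1 + ∑ i, ∑ j ∈ Finset.univ.erase i, ‖y i - y j‖⁻¹) ^ N) (coincidenceLocus n E4)ᶜ := by
    refine (continuousOn_const.mul ((continuousOn_const.add continuous_norm.continuousOn).pow N)).mul
      ((continuousOn_const.add (continuousOn_finsetSum _ fun i _ =>
        continuousOn_finsetSum _ fun j hj => ?_)).pow N)
    have hne : ∀ y ∈ (coincidenceLocus n E4)ᶜ, ‖y i - y j‖ ≠ 0 := fun y hy h =>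
      hy ⟨i, j, (Finset.ne_of_mem_erase hj).symm, sub_eq_zero.1 (norm_eq_zero.1 h)⟩
    exact ContinuousOn.inv₀ (by fun_prop) hne
  have hmeas : Measurable (fun y : Fin n → E4 => C * (1 + ‖y‖) ^ N *
      (1 + ∑ i, ∑ j ∈ Finset.univ.erase i, ‖y i - y j‖⁻¹) ^ N) := by
    fun_prop
  have hnn : ∀ y : Fin n → E4, 0 ≤ C * (1 + ‖y‖) ^ N *
      (1 + ∑ i, ∑ j ∈ Finset.univ.erase i, ‖y i - y j‖⁻¹) ^ N := fun y =>
    mul_nonneg (mul_nonneg hCpos.le (by positivity)) (by positivity)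
  exact stub_regular_of_dominated n (S₁ n) _ C N hmeas hnn (fun y _ => le_rfl)
    (stub_dominatedTieLimit n hn (S₁ n) a L D _ C N k₀ ha_pos ha_tendsto haL
      hmeas hcont hnn (fun y _ => le_rfl) hbound htie)

/-- **The v3.9 residual implies the v3.10 residual** (monotonicity of the reshape): degrees `≥ 3` of T under the kernel antecedent
(tempered tied lattice densities) give the representing functions, degree by degree (`regular_of_temperedApproximants`). -/
theorem regularHigh_of_temperedHigh
    (hT3 : open Literature.MathematicalPhysics.QuantumLattice Literature.MathematicalPhysics.AQFT
      Literature.MathematicalPhysics.QuantumFieldTheory Literature.Probability.LatticeModels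
      Summit.QuantumFields.YangMills.Theorems.CurvatureBoostCovariance.Negative
      Summit.QuantumFields.YangMills.Theorems.NPointIsotropy.Negative in
    ∀ (G : Type) [Group G] [TopologicalSpace G] [IsTopologicalGroup G] [CompactSpace G]
      [MeasurableSpace G] [BorelSpace G], IsCompactSimpleLieGroup G →
      ∀ (r : LatticeRep G) (sch : SpeciesScheme (YMSpecies G)) (S₁ : SchwingerFamily E4),
        W1 r sch S₁ → EightFrameRP S₁ → PlanarCone S₁ →
        (∃ (K : E4 → ℝ) (C η : ℝ), 0 < η ∧ ContinuousOn K {x : E4 | x ≠ 0} ∧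
          (∀ x : E4, x ≠ 0 → |K x| ≤ C * (1 + ‖x‖ ^ (η - 10))) ∧
          ∀ F : SchwartzMap (Fin 2 → E4) ℂ, IsOffDiagonal F →
            MeasureTheory.Integrable (fun x : Fin 2 → E4 => (K (x 0 - x 1) : ℂ) * F x) ∧
              S₁ 2 F = ∫ x : Fin 2 → E4, (K (x 0 - x 1) : ℂ) * F x) →
        ∀ n : ℕ, 3 ≤ n → ∃ (D : ℕ → (Fin n → Site 4) → ℝ) (C : ℝ) (N k₀ : ℕ), 0 < C ∧
          (∀ k : ℕ, k₀ ≤ k → ∀ x : Fin n → Site 4, (∀ i, x i ∈ box 4 (sch.L k)) → Function.Injective x →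
            |D k x| ≤ C * (1 + ‖fun i => sch.a k • siteToE (x i)‖) ^ N *
              (1 + ∑ i, ∑ j ∈ Finset.univ.erase i,
                ‖sch.a k • siteToE (x i) - sch.a k • siteToE (x j)‖⁻¹) ^ N) ∧
          ∀ (f : Fin n → SchwartzMap E4 ℝ) (F : SchwartzMap (Fin n → E4) ℂ),
            IsTensorOf F (fun i => ofRealTest (f i)) → IsOffDiagonal F →
            Filter.Tendsto (fun k => (((sch.a k ^ 4) ^ n *
              ∑ x ∈ Fintype.piFinset (fun _ : Fin n => box 4 (sch.L k)),
                (∏ i, f i (sch.a k • siteToE (x i))) * D k x : ℝ) : ℂ)) Filter.atTop (nhds (S₁ n F))) :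
    open Literature.MathematicalPhysics.QuantumLattice Literature.MathematicalPhysics.AQFT
      Literature.MathematicalPhysics.QuantumFieldTheory
      Summit.QuantumFields.YangMills.Theorems.CurvatureBoostCovariance.Negative
      Summit.QuantumFields.YangMills.Theorems.NPointIsotropy.Negative in
    ∀ (G : Type) [Group G] [TopologicalSpace G] [IsTopologicalGroup G] [CompactSpace G]
      [MeasurableSpace G] [BorelSpace G], IsCompactSimpleLieGroup G →
      ∀ (r : LatticeRep G) (sch : SpeciesScheme (YMSpecies G)) (S₁ : SchwingerFamily E4),
        W1 r sch S₁ → EightFrameRP S₁ → PlanarCone S₁ →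
        (∃ (K : E4 → ℝ) (C η : ℝ), 0 < η ∧ ContinuousOn K {x : E4 | x ≠ 0} ∧
          (∀ x : E4, x ≠ 0 → |K x| ≤ C * (1 + ‖x‖ ^ (η - 10))) ∧
          ∀ F : SchwartzMap (Fin 2 → E4) ℂ, IsOffDiagonal F →
            MeasureTheory.Integrable (fun x : Fin 2 → E4 => (K (x 0 - x 1) : ℂ) * F x) ∧
              S₁ 2 F = ∫ x : Fin 2 → E4, (K (x 0 - x 1) : ℂ) * F x) →
        ∀ n : ℕ, 3 ≤ n → ∃ W : (Fin n → E4) → ℂ, ∀ F : SchwartzMap (Fin n → E4) ℂ, IsOffDiagonal F →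
          MeasureTheory.Integrable (fun y : Fin n → E4 => W y * F y) ∧ S₁ n F = ∫ y : Fin n → E4, W y * F y := by
  intro G _ _ _ _ _ _ hG r sch S₁ hW h8 hC hK n hn
  exact regular_of_temperedApproximants sch.a sch.L S₁ sch.a_pos sch.tendsto_a sch.tendsto_L n (by omega)
    (hT3 G hG r sch S₁ hW h8 hC hK n hn)

/-- **The item T closes the residual stub in one line**: `TemperedCurvatureMoments` (stmt-QuantumFields-17721, all degrees, no kernel
antecedent) implies `stub_regularHigh`.  By-name closure path: when `…TemperedCurvatureMoments_holds` lands,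
`stub_regularHigh := regularHigh_of_item TemperedCurvatureMoments_holds`. -/
theorem regularHigh_of_item
    (hT : Summit.QuantumFields.YangMills.Theses.IsotropyFromPowerCounting.TemperedCurvatureMoments) :
    open Literature.MathematicalPhysics.QuantumLattice Literature.MathematicalPhysics.AQFT
      Literature.MathematicalPhysics.QuantumFieldTheory
      Summit.QuantumFields.YangMills.Theorems.CurvatureBoostCovariance.Negative
      Summit.QuantumFields.YangMills.Theorems.NPointIsotropy.Negative in
    ∀ (G : Type) [Group G] [TopologicalSpace G] [IsTopologicalGroup G] [CompactSpace G]
      [MeasurableSpace G] [BorelSpace G], IsCompactSimpleLieGroup G →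
      ∀ (r : LatticeRep G) (sch : SpeciesScheme (YMSpecies G)) (S₁ : SchwingerFamily E4),
        W1 r sch S₁ → EightFrameRP S₁ → PlanarCone S₁ →
        (∃ (K : E4 → ℝ) (C η : ℝ), 0 < η ∧ ContinuousOn K {x : E4 | x ≠ 0} ∧
          (∀ x : E4, x ≠ 0 → |K x| ≤ C * (1 + ‖x‖ ^ (η - 10))) ∧
          ∀ F : SchwartzMap (Fin 2 → E4) ℂ, IsOffDiagonal F →
            MeasureTheory.Integrable (fun x : Fin 2 → E4 => (K (x 0 - x 1) : ℂ) * F x) ∧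
              S₁ 2 F = ∫ x : Fin 2 → E4, (K (x 0 - x 1) : ℂ) * F x) →
        ∀ n : ℕ, 3 ≤ n → ∃ W : (Fin n → E4) → ℂ, ∀ F : SchwartzMap (Fin n → E4) ℂ, IsOffDiagonal F →
          MeasureTheory.Integrable (fun y : Fin n → E4 => W y * F y) ∧ S₁ n F = ∫ y : Fin n → E4, W y * F y := by
  intro G _ _ _ _ _ _ hG r sch S₁ hW h8 hC _ n hn
  exact regular_of_temperedApproximants sch.a sch.L S₁ sch.a_pos sch.tendsto_a sch.tendsto_L n (by omega)
    (hT G hG r sch S₁ hW h8 hC n (by omega))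

/-- **The item `CurvatureDensities` closes the residual stub in one line**: `CurvatureDensities` (stmt-QuantumFields-17723:
`W1 → EightFrameRP → PlanarCone → NPointRegular`, all degrees, no kernel antecedent) implies `stub_regularHigh`. -/
theorem regularHigh_of_curvatureDensities
    (hD : Summit.QuantumFields.YangMills.Theses.IsotropyFromPowerCounting.CurvatureDensities) :
    open Literature.MathematicalPhysics.QuantumLattice Literature.MathematicalPhysics.AQFT
      Literature.MathematicalPhysics.QuantumFieldTheory
      Summit.QuantumFields.YangMills.Theorems.CurvatureBoostCovariance.Negative
      Summit.QuantumFields.YangMills.Theorems.NPointIsotropy.Negative in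
    ∀ (G : Type) [Group G] [TopologicalSpace G] [IsTopologicalGroup G] [CompactSpace G]
      [MeasurableSpace G] [BorelSpace G], IsCompactSimpleLieGroup G →
      ∀ (r : LatticeRep G) (sch : SpeciesScheme (YMSpecies G)) (S₁ : SchwingerFamily E4),
        W1 r sch S₁ → EightFrameRP S₁ → PlanarCone S₁ →
        (∃ (K : E4 → ℝ) (C η : ℝ), 0 < η ∧ ContinuousOn K {x : E4 | x ≠ 0} ∧
          (∀ x : E4, x ≠ 0 → |K x| ≤ C * (1 + ‖x‖ ^ (η - 10))) ∧
          ∀ F : SchwartzMap (Fin 2 → E4) ℂ, IsOffDiagonal F →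
            MeasureTheory.Integrable (fun x : Fin 2 → E4 => (K (x 0 - x 1) : ℂ) * F x) ∧
              S₁ 2 F = ∫ x : Fin 2 → E4, (K (x 0 - x 1) : ℂ) * F x) →
        ∀ n : ℕ, 3 ≤ n → ∃ W : (Fin n → E4) → ℂ, ∀ F : SchwartzMap (Fin n → E4) ℂ, IsOffDiagonal F →
          MeasureTheory.Integrable (fun y : Fin n → E4 => W y * F y) ∧ S₁ n F = ∫ y : Fin n → E4, W y * F y := by
  intro G _ _ _ _ _ _ hG r sch S₁ hW h8 hC _ n _
  exact hD G hG r sch S₁ hW h8 hC n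


-- Stub 1g `stub_stepZeroOfLattice` (Step 0 from tempered tied lattice approximants, all degrees): LANDED p137944
-- (`Theorems/MirrorModularBoostsSoftKernelBoostCovarianceStepZeroOfLattice.lean`, imported; wave 1 of lead c4); v3.10 uses its
-- per-degree reading `regular_of_temperedApproximants`.

/-- **Stub 1 — Step 0 (v3.6 text: `W1 → EightFrameRP → PlanarCone → kernel triple → NPointRegular`), v3.10: PROVED modulo
`stub_regularHigh` by degrees.**  Degree `0`: E0 (`residual_zero`, landed with crux 11686); degree `1`: the degree-one layer of T along
every tied scheme (`DegreeOne.temperedCurvatureMoments_one`, LANDED p140708) read through `regular_of_temperedApproximants`; degree `2`: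
the kernel triple itself (`W y = K(y₀ − y₁)`); degrees `≥ 3`: `stub_regularHigh`.  Junk families violate it (`not_nPointRegular_junk`),
so the tie is load-bearing here; every constructible inhabitant of `W1` (`c ≡ 0` / `β ≡ 0` / bounded-`c_k` schemes: c-number fields on
`⁰𝒮`) satisfies it. -/
theorem stub_tieRegularity :
    open Literature.MathematicalPhysics.QuantumLattice Literature.MathematicalPhysics.AQFT
      Literature.MathematicalPhysics.QuantumFieldTheory
      Summit.QuantumFields.YangMills.Theorems.CurvatureBoostCovariance.Negative
      Summit.QuantumFields.YangMills.Theorems.NPointIsotropy.Negative in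
    ∀ (G : Type) [Group G] [TopologicalSpace G] [IsTopologicalGroup G] [CompactSpace G]
      [MeasurableSpace G] [BorelSpace G], IsCompactSimpleLieGroup G →
      ∀ (r : LatticeRep G) (sch : SpeciesScheme (YMSpecies G)) (S₁ : SchwingerFamily E4),
        W1 r sch S₁ → EightFrameRP S₁ → PlanarCone S₁ →
        (∃ (K : E4 → ℝ) (C η : ℝ), 0 < η ∧ ContinuousOn K {x : E4 | x ≠ 0} ∧
          (∀ x : E4, x ≠ 0 → |K x| ≤ C * (1 + ‖x‖ ^ (η - 10))) ∧
          ∀ F : SchwartzMap (Fin 2 → E4) ℂ, IsOffDiagonal F →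
            MeasureTheory.Integrable (fun x : Fin 2 → E4 => (K (x 0 - x 1) : ℂ) * F x) ∧
              S₁ 2 F = ∫ x : Fin 2 → E4, (K (x 0 - x 1) : ℂ) * F x) →
        NPointRegular S₁ := by
  intro G _ _ _ _ _ _ hG r sch S₁ hW h8 hC hK n
  obtain rfl | rfl | rfl | h3 : n = 0 ∨ n = 1 ∨ n = 2 ∨ 3 ≤ n := by omega
  · exact residual_zero S₁ hW.2.1.1
  · exact regular_of_temperedApproximants sch.a sch.L S₁ sch.a_pos sch.tendsto_a sch.tendsto_L 1 one_pos
      (Summit.QuantumFields.YangMills.Theorems.SoftKernelBoostCovariance.Sketch.DegreeOne.temperedCurvatureMoments_one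
        G hG r sch S₁ hW h8 hC)
  · obtain ⟨K, C, η, -, -, -, hKrep⟩ := hK
    exact ⟨fun y => (K (y 0 - y 1) : ℂ), hKrep⟩
  · exact stub_regularHigh G hG r sch S₁ hW h8 hC hK n h3

/-- **The sandwich bound is monotone in the exponent for reserves `≤ 1`**: the bound with exponent `μ` implies the bound
with exponent `max μ 0` (same constant), because `u ^ (-μ) ≤ u ^ (-max μ 0)` for `0 < u ≤ 1` (and a negative right-hand side
is absurd against a norm). Used to run the chain with a nonnegative type. -/
theorem sandwich_mono_exponent {S : LabelledSchwingerFamily Unit E4} (h : OSReconstructionNoE1 S) {μ C : ℝ}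
    (hS : ∀ (u v : ℝ), 0 < u → 0 < v → u ≤ 1 → v ≤ 1 →
           ∀ (f₁ : SchwartzMap (Fin 1 → E4) ℂ) (g hh : ℝ × ℝ → ℂ) (Mg Mh Mh' : ℝ),
             (∀ x : Fin 1 → E4, f₁ x = g (x 0 0, x 0 1) * hh (x 0 2, x 0 3)) →
             (∀ p : ℝ × ℝ, g p ≠ 0 → u ≤ p.1 ∧ p.1 ≤ 2 * u) →
             MeasureTheory.Integrable g → (∫ p, ‖g p‖) ≤ Mg →
             MeasureTheory.Integrable hh → (∫ p, ‖hh p‖) ≤ Mh → (∀ p, ‖hh p‖ ≤ Mh') →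
           ∀ (n : ℕ) (W : SchwartzMap (Fin n → E4) ℂ) (hW : IsTimeOrdered W)
             (hFW : IsTimeOrdered
               (SchwartzMap.appendTensor f₁ (translateMulti ((2 * u + v) • EuclideanSpace.single 0 1) W))),
             ‖h.fieldVec (1 + n) (fun _ => ())
                 (SchwartzMap.appendTensor f₁ (translateMulti ((2 * u + v) • EuclideanSpace.single 0 1) W)) hFW‖
               ≤ C * Mg * (Mh + Mh') * (u ^ (-μ) + v ^ (-μ)) * ‖h.fieldVec n (fun _ => ()) W hW‖) :
    ∀ (u v : ℝ), 0 < u → 0 < v → u ≤ 1 → v ≤ 1 →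
           ∀ (f₁ : SchwartzMap (Fin 1 → E4) ℂ) (g hh : ℝ × ℝ → ℂ) (Mg Mh Mh' : ℝ),
             (∀ x : Fin 1 → E4, f₁ x = g (x 0 0, x 0 1) * hh (x 0 2, x 0 3)) →
             (∀ p : ℝ × ℝ, g p ≠ 0 → u ≤ p.1 ∧ p.1 ≤ 2 * u) →
             MeasureTheory.Integrable g → (∫ p, ‖g p‖) ≤ Mg →
             MeasureTheory.Integrable hh → (∫ p, ‖hh p‖) ≤ Mh → (∀ p, ‖hh p‖ ≤ Mh') →
           ∀ (n : ℕ) (W : SchwartzMap (Fin n → E4) ℂ) (hW : IsTimeOrdered W)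
             (hFW : IsTimeOrdered
               (SchwartzMap.appendTensor f₁ (translateMulti ((2 * u + v) • EuclideanSpace.single 0 1) W))),
             ‖h.fieldVec (1 + n) (fun _ => ())
                 (SchwartzMap.appendTensor f₁ (translateMulti ((2 * u + v) • EuclideanSpace.single 0 1) W)) hFW‖
               ≤ C * Mg * (Mh + Mh') * (u ^ (-max μ 0) + v ^ (-max μ 0)) * ‖h.fieldVec n (fun _ => ()) W hW‖ := by
  intro u v hu hv hu1 hv1 f₁ g hh Mg Mh Mh' hf hg hgi hgM hhi hhM hhM' n W hW hFW
  have h0 := hS u v hu hv hu1 hv1 f₁ g hh Mg Mh Mh' hf hg hgi hgM hhi hhM hhM' n W hW hFW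
  have hpow : u ^ (-μ) + v ^ (-μ) ≤ u ^ (-max μ 0) + v ^ (-max μ 0) :=
    add_le_add (Real.rpow_le_rpow_of_exponent_ge hu hu1 (neg_le_neg (le_max_left μ 0)))
      (Real.rpow_le_rpow_of_exponent_ge hv hv1 (neg_le_neg (le_max_left μ 0)))
  have hpos : 0 < u ^ (-μ) + v ^ (-μ) := add_pos (Real.rpow_pos_of_pos hu _) (Real.rpow_pos_of_pos hv _)
  set P := C * Mg * (Mh + Mh') with hP
  set X := ‖h.fieldVec n (fun _ => ()) W hW‖ with hX
  have hX0 : 0 ≤ X := norm_nonneg _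
  rcases le_or_gt 0 (P * X) with hPX | hPX
  · calc _ ≤ P * (u ^ (-μ) + v ^ (-μ)) * X := h0
      _ = (P * X) * (u ^ (-μ) + v ^ (-μ)) := by ring
      _ ≤ (P * X) * (u ^ (-max μ 0) + v ^ (-max μ 0)) := mul_le_mul_of_nonneg_left hpow hPX
      _ = P * (u ^ (-max μ 0) + v ^ (-max μ 0)) * X := by ring
  · exfalso
    have h1 : P * (u ^ (-μ) + v ^ (-μ)) * X < 0 := by
      have : P * (u ^ (-μ) + v ^ (-μ)) * X = (P * X) * (u ^ (-μ) + v ^ (-μ)) := by ring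
      rw [this]; exact mul_neg_of_neg_of_pos hPX hpos
    exact absurd (h0.trans_lt h1) (not_lt.2 (norm_nonneg _))


/-! ## v3.12 (lead c13, 2026-08-17): THE 45° ROW IS FREE GIVEN REGULARITY — Σ_diag from Σ_axis by reading diagonal chains in the `e₀` frame

The composition consumes the `45°` pull-back `T = 𝔖 ∘ (R_{π/4}·)` only through LOCAL boost vectors of its `e₀`-reconstruction `h'`
(`stub_rayPositivityLocal` discards every growth datum), which the landed chain machinery (`stub_chainBoostVectors` for `T`) builds from a
sandwich bound for `h'` with ANY exponent.  v3.12 PROVES that bound from the AXIS row of `S₁` (kept as the Yang–Mills stub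
`stub_sandwichAxis` = `SandwichRows S₁`, the first row of item stmt-18372 verbatim) and the function residual `NPointRegular S₁` (Step 0,
`stub_tieRegularity`), model-blindly (idea: crux-18372 card `diagonal-row-from-axis-chain`, specialised to what THIS line needs and freed of
its density step by the landed unordered reflection positivity `stub_unorderedRP`):
* the sandwich bound for `h'` is an operator bound, equivalent (landed engine `sandwich_of_chainGrowth`, GJ87 Thm 10.5.5) to geometric growth
  of the DIAGONAL chain moments `T(ΘV_N* ⊗ V_N)`, `V_N = Pᴺ W`;
* read in the `e₀` frame, `T(ΘV_N* ⊗ V_N) = ⟪A_N, U_N⟫_{S₁}` with `U_N = V_N ∘ R_{π/4}⁻¹`, `A_N = V_N ∘ R_{π/4}` (the diagonal mirror is the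
  `e₀` mirror followed by a quarter turn), two POSITIVE-TIME but UNORDERED test functions (for `N ≥ m_W`, once the chain is longer than the
  cloud `W` is wide); unordered Cauchy–Schwarz (E2 on `𝒮₊` from `NPointRegular`, landed `stub_unorderedRP`) bounds it by the two unordered
  norms `⟪U_N, U_N⟫`, `⟪A_N, A_N⟫`;
* each unordered norm is the limit of honest `h`-norms of sector-regularised chains (E3 + dominated convergence under `NPointRegular`), and an
  honest `e₀`-chain of `2N` box-localised insertions (each of `e₀`-extent `3δ/√2`, `δ = min(u,v)/32`, in front of a time-ordered cloud) is
  peeled by the AXIS sandwich bound one insertion at a time (reserves `min(d, γ/4)`, `min(γ/4, 1)`; sideways steps are free by translation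
  unitarity, backward time shifts only increase norms): growth `(2·3^μ·C·Mg·(Mh+Mh')·(u^{-μ}+v^{-μ}))^{2}` per insertion pair;
* general insertions `g ⊗ hh` are sums of boxes (smooth partition of unity in `(x₀, x₁)`, total `L¹` mass preserved, sideways boxes moved to
  `x₁ = 0` by translation unitarity; tails and non-compact clouds by dominated convergence under `NPointRegular T`).
Registered sorry-backed stubs v3.12: `stub_regularHigh` (YM), `stub_sandwichAxis` (YM, THE BET — the axis row only), and the model-blind
`stub_diagCorePeel` (C), `stub_diagCloudGrowth` (D), `stub_diagGrowthT` (G, lead), `stub_diagEngine` (E), `stub_diagOfBoxes` (F);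
`stub_sandwichPair` (v3.11 text) is now a THEOREM from them, and `SoftKernelBoostCovariance_of` is unchanged.  Dependency of the crux on
item stmt-18372 after v3.12: its AXIS row only (`stub_chainGrowthAxis`); the diagonal leaf `stub_chainGrowthDiag` is no longer consumed. -/

/-- **Stub (Σ-axis) — THE AXIS SANDWICH ROW (USES THE TIE; the Yang–Mills input of the line, v3.12; difficulty XL / research — THE BET).**
For every compact simple `G`, `r`, `sch`, `S₁` with `W1 r sch S₁`, the eight frames, the cone and the kernel triple: `SandwichRows S₁` —
for every `e₀`-reconstruction `h` some `μ < 4` and `C` with the transversely filtered heat-sandwich bound `SandwichBound S₁ h μ C`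
(`‖Ψ_{f₁ ⊗ W_{(2u+v)e₀}}‖ ≤ C·Mg·(Mh+Mh')·(u^{-μ}+v^{-μ})·‖Ψ_W‖` for insertions `f₁ = g(x₀,x₁)hh(x₂,x₃)` with times in `[u,2u]`).
VERBATIM the first row of item `IsotropyFromPowerCounting.CurvatureSandwichBound` (stmt-QuantumFields-18372, `curvatureSandwichBound_iff`),
equivalently its lead's registered `stub_chainGrowthAxis` (`chainGrowthAxis_of_crux` / `curvatureSandwichBound_of_chainGrowth`).  Vacuum row =
the kernel triple (`μ₀ = 4 − η/2`); Gaussian class `μ = Δ₂ − 1`; power counting for `tr F²`: `μ = 3`.  Certified inhabitants (`c ≡ 0`,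
`β ≡ 0`, bounded `c_k`, vacuum): `μ = 0`; junk: `C = 0`. -/
theorem stub_sandwichAxis :
    open Literature.MathematicalPhysics.QuantumLattice Literature.MathematicalPhysics.AQFT
      Literature.MathematicalPhysics.QuantumFieldTheory
      Summit.QuantumFields.YangMills.Theorems.CurvatureBoostCovariance.Negative
      Summit.QuantumFields.YangMills.Theorems.CurvatureSandwichBound.Negative
      Summit.QuantumFields.YangMills.Theorems.NPointIsotropy.Negative in
    ∀ (G : Type) [Group G] [TopologicalSpace G] [IsTopologicalGroup G] [CompactSpace G]
      [MeasurableSpace G] [BorelSpace G], IsCompactSimpleLieGroup G →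
      ∀ (r : LatticeRep G) (sch : SpeciesScheme (YMSpecies G)) (S₁ : SchwingerFamily E4),
        W1 r sch S₁ → EightFrameRP S₁ → PlanarCone S₁ →
        (∃ (K : E4 → ℝ) (C η : ℝ), 0 < η ∧ ContinuousOn K {x : E4 | x ≠ 0} ∧
          (∀ x : E4, x ≠ 0 → |K x| ≤ C * (1 + ‖x‖ ^ (η - 10))) ∧
          ∀ F : SchwartzMap (Fin 2 → E4) ℂ, IsOffDiagonal F →
            MeasureTheory.Integrable (fun x : Fin 2 → E4 => (K (x 0 - x 1) : ℂ) * F x) ∧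
              S₁ 2 F = ∫ x : Fin 2 → E4, (K (x 0 - x 1) : ℂ) * F x) →
        SandwichRows S₁ := by
  sorry

/-- **Stub (C) `stub_diagCorePeel` — PEELING AN `e₀`-CHAIN OF WINDOWED INSERTIONS IN FRONT OF A TIME-ORDERED CLOUD (model-blind OS
bookkeeping; difficulty L).**  `S₁` with an `e₀`-reconstruction `h` and the axis sandwich bound `SandwichBound S₁ h μ C` (`μ ≥ 0`, `C > 0`).
Chain step `P⟨m, G⟩ = ⟨2+m, τ_a(J₁ ⊗ (J₂ ⊗ τ_a G))⟩` with a translation `a` without transverse part (`a₂ = a₃ = 0`, time part `a₀`), one-slot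
insertions `Jᵢ = gᵢ(x₀,x₁)·hhᵢ(x₂,x₃)` (`∫|gᵢ| ≤ Mg`, `∫|hhᵢ| ≤ Mh`, `|hhᵢ| ≤ Mh'`) whose translates `τ_a Jᵢ` have times in the windows
`[α₁, α₁+ℓ]`, `[α₂, α₂+ℓ]` (`0 < α₁`, gap `γ₁`: `α₁+ℓ+γ₁ ≤ α₂`, gap `γ₂` to the next period: `α₂+ℓ+γ₂ ≤ α₁+2a₀`, short insertions
`ℓ ≤ α₁, 4ℓ ≤ γᵢ`, `γᵢ ≤ 4`, `α₂ + γ₂/2 ≤ 2a₀`).  Then for every time-ordered cloud `Z` with all times `≥ α₁` and every `N`, `Pᴺ⟨n, Z⟩` is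
time-ordered with all times `≥ α₁` and `‖Ψ_{PᴺZ}‖ ≤ (C·Mg·(Mh+Mh')·B)^{2N} ‖Ψ_Z‖` whenever `B` dominates the two reserve sums
`min(α₁,γ₁/4)^{-μ} + min(γ₁/4,1)^{-μ}` and `min(γ₁/2,γ₂/4)^{-μ} + min(γ₂/4,1)^{-μ}`.
PROOF (induction on `N`, `Pᴺ⁺¹ = P ∘ Pᴺ`): peel `τ_aJ₁` — pre-shift everything down by `α₁ − ũ₁`, `ũ₁ = min(α₁, γ₁/4)` (norms only grow:
`Ψ_X = e^{-tH}Ψ_{T_{-t}X}`, `transfer_fieldVec` + `norm_transfer_le`), so the insertion sits in `[ũ₁, ũ₁+ℓ] ⊆ [ũ₁, 2ũ₁]`; apply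
`SandwichBound` with `(ũ₁, ṽ₁ = min(γ₁/4, 1))` (the translated insertion is again `g ⊗ hh` with the same masses since `a₂ = a₃ = 0`; the rest,
shifted down by `2ũ₁+ṽ₁`, is time-ordered with bottom `≥ ℓ + γ₁/2`); cost `C·Mg·(Mh+Mh')·(ũ₁^{-μ}+ṽ₁^{-μ})`; peel `J₂` the same way from
distance `d₂ = α₂ − α₁ − ũ₁ − ṽ₁ ≥ ℓ + γ₁/2` with `ũ₂ = min(d₂, γ₂/4) ≥ min(γ₁/2, γ₂/4)`, `ṽ₂ = min(γ₂/4, 1)`; what remains is the translate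
`τ_b (PᴺZ)` with `b = 2a − (α₁+ũ₁+ṽ₁+d₂+ũ₂+ṽ₂)e₀`, `b₀ = 2a₀ − α₂ − ũ₂ − ṽ₂ ≥ 0`, whose norm is `≤ ‖Ψ_{PᴺZ}‖` (spatial part unitary
`translate_fieldVec`, time part a contraction).  Tools: `isTimeOrdered_translateMulti`, `translateMulti_appendTensor`,
`translateMulti_translateMulti`, `fieldVec_sigma_congr`/`fieldVec_congr_cast`, `Real.rpow_le_rpow_of_exponent_nonpos`-type monotonicity. -/
theorem stub_diagCorePeel :
    open Literature.MathematicalPhysics.QuantumLattice Literature.MathematicalPhysics.AQFT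
      Literature.MathematicalPhysics.QuantumFieldTheory
      Summit.QuantumFields.YangMills.Theorems.CurvatureSandwichBound.Negative
      Summit.QuantumFields.YangMills.Theorems.NPointIsotropy.Negative in
    ∀ (S₁ : SchwingerFamily E4) (h : OSReconstructionNoE1 S₁.toLabelled) (μ C : ℝ), 0 ≤ μ → 0 < C →
      SandwichBound S₁ h μ C →
    ∀ (a : E4) (J₁ J₂ : SchwartzMap (Fin 1 → E4) ℂ) (g₁ g₂ hh₁ hh₂ : ℝ × ℝ → ℂ)
      (Mg Mh Mh' α₁ α₂ ℓ γ₁ γ₂ B : ℝ),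
      a 2 = 0 → a 3 = 0 →
      (∀ x, J₁ x = g₁ (x 0 0, x 0 1) * hh₁ (x 0 2, x 0 3)) →
      (∀ x, J₂ x = g₂ (x 0 0, x 0 1) * hh₂ (x 0 2, x 0 3)) →
      MeasureTheory.Integrable g₁ → MeasureTheory.Integrable g₂ →
      (∫ p, ‖g₁ p‖) ≤ Mg → (∫ p, ‖g₂ p‖) ≤ Mg → 0 < Mg →
      MeasureTheory.Integrable hh₁ → MeasureTheory.Integrable hh₂ →
      (∫ p, ‖hh₁ p‖) ≤ Mh → (∫ p, ‖hh₂ p‖) ≤ Mh → (∀ p, ‖hh₁ p‖ ≤ Mh') → (∀ p, ‖hh₂ p‖ ≤ Mh') →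
      (∀ p, g₁ p ≠ 0 → α₁ ≤ p.1 + a 0 ∧ p.1 + a 0 ≤ α₁ + ℓ) →
      (∀ p, g₂ p ≠ 0 → α₂ ≤ p.1 + a 0 ∧ p.1 + a 0 ≤ α₂ + ℓ) →
      0 < α₁ → 0 ≤ ℓ → 0 < γ₁ → 0 < γ₂ → γ₁ ≤ 4 → γ₂ ≤ 4 → ℓ ≤ α₁ → 4 * ℓ ≤ γ₁ → 4 * ℓ ≤ γ₂ →
      α₁ + ℓ + γ₁ ≤ α₂ → α₂ + ℓ + γ₂ ≤ α₁ + 2 * a 0 → α₂ + γ₂ / 2 ≤ 2 * a 0 →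
      (min α₁ (γ₁ / 4)) ^ (-μ) + (min (γ₁ / 4) 1) ^ (-μ) ≤ B →
      (min (γ₁ / 2) (γ₂ / 4)) ^ (-μ) + (min (γ₂ / 4) 1) ^ (-μ) ≤ B →
    ∀ (P : (Σ m : ℕ, SchwartzMap (Fin m → E4) ℂ) → (Σ m : ℕ, SchwartzMap (Fin m → E4) ℂ)),
      (P = fun Gσ => ⟨1 + (1 + Gσ.1),
        translateMulti a (J₁.appendTensor (J₂.appendTensor (translateMulti a Gσ.2)))⟩) →
    ∀ (n : ℕ) (Z : SchwartzMap (Fin n → E4) ℂ) (hZ : IsTimeOrdered Z),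
      tsupport (Z : (Fin n → E4) → ℂ) ⊆ {x | ∀ i, α₁ ≤ x i 0} →
    ∀ N : ℕ, ∃ hN : IsTimeOrdered (P^[N] ⟨n, Z⟩).2,
      tsupport ((P^[N] ⟨n, Z⟩).2 : (Fin (P^[N] ⟨n, Z⟩).1 → E4) → ℂ) ⊆ {x | ∀ i, α₁ ≤ x i 0} ∧
      ‖h.fieldVec (P^[N] ⟨n, Z⟩).1 (fun _ => ()) (P^[N] ⟨n, Z⟩).2 hN‖ ≤
        (C * Mg * (Mh + Mh') * B) ^ (2 * N) * ‖h.fieldVec n (fun _ => ()) Z hZ‖ :=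
  Summit.QuantumFields.YangMills.Theorems.SoftKernelBoostCovariance.Sketch.stub_diagCorePeel

/-- **Stub (D) `stub_diagCloudGrowth` — UNORDERED CLOUDS: the squared unordered norm `Re ⟪PᴺG₀, PᴺG₀⟫_{S₁}` of the chain in front of a
positive-time but UNORDERED off-diagonal cloud `G₀` grows like `K·L^{2N}` once the chain in front of every TIME-ORDERED cloud grows like
`Lᴺ` in `h`-norm (model-blind; difficulty L).**  `S₁` with `e₀`-reconstruction `h` (E2 on `𝒮_<`), E3 (`IsSymmetric`) and the function
residual `NPointRegular S₁`; chain step `P⟨m,G⟩ = ⟨2+m, τ_a(J₁ ⊗ (J₂ ⊗ τ_a G))⟩` whose translated insertions have times in `[α₁, β₁]`,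
`(β₁, β₂]`, `β₂ < α₁ + 2a₀`, `α₁ > 0`.  PROOF: sector regularisation of the cloud (`UnorderedRP`/`…Cutoff.exists_orderedPieces`, redone
keeping the supports: `c_k·G₀ = Σ_π (T_{k,π})^π` with `T_{k,π}` time-ordered, supported in the sorted support of `G₀`, hence with all
times `≥ α₁`; `0 ≤ c_k ≤ n₀!`, `c_k → 1` off the equal-time walls); `Pᴺ` is linear and local in the cloud: `Pᴺ(c·G₀) = (c∘cloud slots)·PᴺG₀`
and `Pᴺ(G^π) = (PᴺG)^{1⊕π}` (induction on `N` from the defining equation; `appendTensor_permTest`, `translateMulti`); so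
`⟪Pᴺ(c_kG₀), Pᴺ(c_kG₀)⟫ = Σ_{π,π'} ⟪PᴺT_{k,π}, PᴺT_{k,π'}⟫` (E3, `osPairing_permTest`, `osPairing_sum_sum`) `= ‖Ψ_{PᴺZ_k}‖²`,
`Z_k = Σ_π T_{k,π}` time-ordered with times `≥ α₁` (`isTimeOrdered_finset_sum`, `fieldVec_finset_sum`, `norm_fieldVec_sq`), which the
hypothesis bounds by `L^{2N}‖Ψ_{Z_k}‖² = L^{2N}·⟪c_kG₀, c_kG₀⟫`; `k → ∞` on both sides by dominated convergence under `NPointRegular`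
(`UnorderedRP.tendsto_osPairing`) gives the claim with `K = Re ⟪G₀, G₀⟫ ≥ 0`.  Positivity / off-diagonality of `PᴺG₀`: all slots have times
`≥ α₁ > 0`; blocks with time-separated supports (`isOffDiagonal_appendTensor_of_separated` after a time translation; one-slot functions are
trivially off-diagonal; `isOffDiagonal_linActMulti`-style transport for `translateMulti`). -/
theorem stub_diagCloudGrowth :
    open Literature.MathematicalPhysics.QuantumLattice Literature.MathematicalPhysics.AQFT
      Literature.MathematicalPhysics.QuantumFieldTheory
      Summit.QuantumFields.YangMills.Theorems.CurvatureSandwichBound.Negative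
      Summit.QuantumFields.YangMills.Theorems.NPointIsotropy.Negative in
    ∀ (S₁ : SchwingerFamily E4) (h : OSReconstructionNoE1 S₁.toLabelled),
      S₁.toLabelled.IsSymmetric → NPointRegular S₁ →
    ∀ (a : E4) (J₁ J₂ : SchwartzMap (Fin 1 → E4) ℂ) (α₁ β₁ β₂ L : ℝ),
      0 < α₁ → α₁ ≤ β₁ → β₁ < β₂ → β₂ < α₁ + 2 * a 0 → 0 ≤ L →
      tsupport (translateMulti a J₁ : (Fin 1 → E4) → ℂ) ⊆ {x | α₁ ≤ x 0 0 ∧ x 0 0 ≤ β₁} →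
      tsupport (translateMulti a J₂ : (Fin 1 → E4) → ℂ) ⊆ {x | β₁ < x 0 0 ∧ x 0 0 ≤ β₂} →
    ∀ (P : (Σ m : ℕ, SchwartzMap (Fin m → E4) ℂ) → (Σ m : ℕ, SchwartzMap (Fin m → E4) ℂ)),
      (P = fun Gσ => ⟨1 + (1 + Gσ.1),
        translateMulti a (J₁.appendTensor (J₂.appendTensor (translateMulti a Gσ.2)))⟩) →
      (∀ (n : ℕ) (Z : SchwartzMap (Fin n → E4) ℂ) (hZ : IsTimeOrdered Z),
          tsupport (Z : (Fin n → E4) → ℂ) ⊆ {x | ∀ i, α₁ ≤ x i 0} →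
          ∀ N : ℕ, ∃ hN : IsTimeOrdered (P^[N] ⟨n, Z⟩).2,
            ‖h.fieldVec (P^[N] ⟨n, Z⟩).1 (fun _ => ()) (P^[N] ⟨n, Z⟩).2 hN‖ ≤
              L ^ N * ‖h.fieldVec n (fun _ => ()) Z hZ‖) →
    ∀ (n₀ : ℕ) (G₀ : SchwartzMap (Fin n₀ → E4) ℂ), IsOffDiagonal G₀ →
      tsupport (G₀ : (Fin n₀ → E4) → ℂ) ⊆ {x | ∀ i, α₁ ≤ x i 0} →
    ∃ K : ℝ, 0 ≤ K ∧ ∀ N : ℕ,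
      IsPositiveTimeMulti (P^[N] ⟨n₀, G₀⟩).2 ∧ IsOffDiagonal (P^[N] ⟨n₀, G₀⟩).2 ∧
      (S₁.osPairing (P^[N] ⟨n₀, G₀⟩).2 (P^[N] ⟨n₀, G₀⟩).2).re ≤ K * L ^ (2 * N) :=
  Summit.QuantumFields.YangMills.Theorems.SoftKernelBoostCovariance.Sketch.stub_diagCloudGrowth

/-- **Stub (G) `stub_diagGrowthT` — GROWTH OF THE UNORDERED NORMS OF A BOX-LOCALISED DIAGONAL CHAIN READ IN THE `e₀` FRAME (the lead's
stub: frame dictionary + transport + (C) + (D); difficulty L).**  `S₁`, `h`, `μ ≥ 0`, `C > 0`, E3, `NPointRegular S₁`, the axis bound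
`SandwichBound S₁ h μ C`.  A box insertion `f = g(x₀,x₁)hh(x₂,x₃)` of the `45°` frame with `g` supported in `[c, c+δ] × [−δ, δ]`,
`δ = min(u,v)/32`, `u ≤ c`, `c + δ ≤ 2u`, `∫|g| ≤ Mg` (`Mg > 0`), a compactly supported time-ordered cloud `W` admissible for `f` at `s = 2u+v`,
and the `45°`-frame chain `P⟨m,G⟩ = ⟨2+m, T_s(Θf̄ ⊗ (f ⊗ T_s G))⟩`.  Then for all `N ≥ m` (some `m = m_W`): the `e₀`-readings
`U_N = (PᴺW) ∘ R⁻¹`, `A_N = (PᴺW) ∘ R` (`R = planeRot 0 (π/4)`) are positive-time and off-diagonal, the diagonal pairing is the `e₀` pairing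
`T(Θ(PᴺW)* ⊗ PᴺW) = ⟪A_N, U_N⟫_{S₁}` (`Θ_{45°} = Θ_{e₀} ∘` quarter turn: `(ΘV*) ∘ R⁻¹ = Θ(V ∘ R)*`), and both unordered norms are
`≤ K·Λ^{4N}`, `Λ = 2·3^μ·C·Mg·(Mh+Mh')·(u^{-μ}+v^{-μ})`.  PROOF: `linActMulti R ∘ P = P_R ∘ linActMulti R` with the `e₀`-chain `P_R` of
(C)/(D): `a = s·R e₀` (`a₀ = s/√2`, `a₂ = a₃ = 0`, both for `R` and `R⁻¹`), `J₁ = (Θf̄)∘R⁻¹`, `J₂ = f∘R⁻¹`: windows `α₁ = (s−c−2δ)/√2`,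
`α₂ = (s+c−δ)/√2`, `ℓ = 3δ/√2`, `γ₁ = √2(c−δ)`, `γ₂ = √2(s−c−2δ) = 2α₁`; the reserve sums are `≤ 2·3^μ(u^{-μ}+v^{-μ})`; absorb the top
`m` periods into the cloud (`PᴺW = P^{N−m}(PᵐW)`, `m ≥ (ℓ_W + δ)/(2s)+1` so that every point of `(PᵐW)∘R⁻¹` has `e₀`-time `≥ α₁` above the
later insertions); (C) gives the time-ordered growth with `L = Λ²`, (D) the unordered one. -/
theorem stub_diagGrowthT :
    open Literature.MathematicalPhysics.QuantumLattice Literature.MathematicalPhysics.AQFT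
      Literature.MathematicalPhysics.QuantumFieldTheory
      Summit.QuantumFields.YangMills.Theorems.CurvatureSandwichBound.Negative
      Summit.QuantumFields.YangMills.Theorems.NPointIsotropy.Negative in
    ∀ (S₁ : SchwingerFamily E4) (h : OSReconstructionNoE1 S₁.toLabelled) (μ C : ℝ), 0 ≤ μ → 0 < C →
      S₁.toLabelled.IsSymmetric → NPointRegular S₁ → SandwichBound S₁ h μ C →
    ∀ (u v c : ℝ), 0 < u → 0 < v → u ≤ 1 → v ≤ 1 → u ≤ c → c + min u v / 32 ≤ 2 * u →
    ∀ (f : SchwartzMap (Fin 1 → E4) ℂ) (g hh : ℝ × ℝ → ℂ) (Mg Mh Mh' : ℝ),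
      (∀ x, f x = g (x 0 0, x 0 1) * hh (x 0 2, x 0 3)) →
      (∀ p, g p ≠ 0 → (c ≤ p.1 ∧ p.1 ≤ c + min u v / 32) ∧ |p.2| ≤ min u v / 32) →
      MeasureTheory.Integrable g → (∫ p, ‖g p‖) ≤ Mg → 0 < Mg →
      MeasureTheory.Integrable hh → (∫ p, ‖hh p‖) ≤ Mh → (∀ p, ‖hh p‖ ≤ Mh') →
    ∀ (n : ℕ) (W : SchwartzMap (Fin n → E4) ℂ), IsTimeOrdered W →
      HasCompactSupport (W : (Fin n → E4) → ℂ) →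
      IsTimeOrdered (f.appendTensor (translateMulti ((2 * u + v) • EuclideanSpace.single 0 1) W)) →
    ∀ (P : (Σ m : ℕ, SchwartzMap (Fin m → E4) ℂ) → (Σ m : ℕ, SchwartzMap (Fin m → E4) ℂ)),
      (P = fun Gσ => ⟨1 + (1 + Gσ.1), translateMulti ((2 * u + v) • EuclideanSpace.single 0 1)
        ((osAdjoint f).appendTensor
          (f.appendTensor (translateMulti ((2 * u + v) • EuclideanSpace.single 0 1) Gσ.2)))⟩) →
    ∃ K : ℝ, 0 ≤ K ∧ ∃ m : ℕ, ∀ N : ℕ, m ≤ N →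
      IsPositiveTimeMulti (linActMulti (planeRot (0 : Fin 3) (Real.pi / 4)).symm (P^[N] ⟨n, W⟩).2) ∧
      IsOffDiagonal (linActMulti (planeRot (0 : Fin 3) (Real.pi / 4)).symm (P^[N] ⟨n, W⟩).2) ∧
      IsPositiveTimeMulti (linActMulti (planeRot (0 : Fin 3) (Real.pi / 4)) (P^[N] ⟨n, W⟩).2) ∧
      IsOffDiagonal (linActMulti (planeRot (0 : Fin 3) (Real.pi / 4)) (P^[N] ⟨n, W⟩).2) ∧
      (fun n' => (S₁ n').comp (linActMulti (planeRot (0 : Fin 3) (Real.pi / 4))) : SchwingerFamily E4)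
          ((P^[N] ⟨n, W⟩).1 + (P^[N] ⟨n, W⟩).1)
          ((osAdjoint (P^[N] ⟨n, W⟩).2).appendTensor (P^[N] ⟨n, W⟩).2) =
        S₁.osPairing (linActMulti (planeRot (0 : Fin 3) (Real.pi / 4)).symm (P^[N] ⟨n, W⟩).2)
          (linActMulti (planeRot (0 : Fin 3) (Real.pi / 4)) (P^[N] ⟨n, W⟩).2) ∧
      (S₁.osPairing (linActMulti (planeRot (0 : Fin 3) (Real.pi / 4)).symm (P^[N] ⟨n, W⟩).2)
          (linActMulti (planeRot (0 : Fin 3) (Real.pi / 4)).symm (P^[N] ⟨n, W⟩).2)).re ≤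
        K * (2 * (3 : ℝ) ^ μ * C * Mg * (Mh + Mh') * (u ^ (-μ) + v ^ (-μ))) ^ (4 * N) ∧
      (S₁.osPairing (linActMulti (planeRot (0 : Fin 3) (Real.pi / 4)) (P^[N] ⟨n, W⟩).2)
          (linActMulti (planeRot (0 : Fin 3) (Real.pi / 4)) (P^[N] ⟨n, W⟩).2)).re ≤
        K * (2 * (3 : ℝ) ^ μ * C * Mg * (Mh + Mh') * (u ^ (-μ) + v ^ (-μ))) ^ (4 * N) :=
  Summit.QuantumFields.YangMills.Theorems.SoftKernelBoostCovariance.Sketch.stub_diagGrowthT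

/-- **Stub (E) `stub_diagEngine` — THE DIAGONAL SANDWICH VECTOR BOUND FROM UNORDERED `e₀`-NORM GROWTH (model-blind; difficulty M).**
For `S₁` with `e₀`-reconstruction `h` (E2), E3 and `NPointRegular S₁`, a pull-back family `T = 𝔖 ∘ (R·)` with `e₀`-reconstruction `h'`, a
windowed insertion `f` (`times ∈ [u, 2u]`), `s = 2u+v`, an admissible `W`, the chain `P` and a rate `Λ > 0`: IF for all `N ≥ m` the chain
pairing `T(Θ(PᴺW)* ⊗ PᴺW)` equals an `e₀`-pairing `⟪A, U⟫_{S₁}` of positive-time off-diagonal `A, U` whose unordered norms are `≤ K Λ^{4N}`,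
THEN `‖Ψ'_{f ⊗ T_sW}‖ ≤ Λ‖Ψ'_W‖`.  PROOF: unordered Cauchy–Schwarz `|⟪A,U⟫|² ≤ Re⟪A,A⟫·Re⟪U,U⟫` (the Gram form of `A + λU` is `≥ 0` and
real for every `λ ∈ ℂ`: `UnorderedRP.sum_osPairing_nonneg S₁ h.reflectionPositive hE3 hreg` with the one-member family `F_{deg} = A + λU`,
sesquilinearity `osPairing_sum_smul`); hence `‖p_N‖² = Re T(Θ(PᴺW)*⊗PᴺW) ≤ KΛ^{4N}` for the chain vectors `p_N = Ψ'_{PᴺW}` of `h'`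
(`re_pairing_self_eq_norm_sq`, `adm_iterate'`), `‖p_N‖ ≤ max(√K, max_{k<m} ‖p_k‖Λ^{-2k})·Λ^{2N}` for all `N`, `Re ⟪p₀,p_N⟫ ≤ ‖p₀‖‖p_N‖`,
and the landed engine `CurvatureSandwichBound.Sketch.sandwich_of_chainGrowth` (applied to the family `T`, reconstruction `h'`). -/
theorem stub_diagEngine :
    open Literature.MathematicalPhysics.QuantumLattice Literature.MathematicalPhysics.AQFT
      Literature.MathematicalPhysics.QuantumFieldTheory
      Summit.QuantumFields.YangMills.Theorems.CurvatureSandwichBound.Negative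
      Summit.QuantumFields.YangMills.Theorems.NPointIsotropy.Negative in
    ∀ (S₁ : SchwingerFamily E4) (h : OSReconstructionNoE1 S₁.toLabelled),
      S₁.toLabelled.IsSymmetric → NPointRegular S₁ →
    ∀ (R : E4 ≃ₗᵢ[ℝ] E4)
      (h' : OSReconstructionNoE1 (SchwingerFamily.toLabelled (fun n => (S₁ n).comp (linActMulti R)))),
    ∀ (u v : ℝ), 0 < u → 0 < v → ∀ (f : SchwartzMap (Fin 1 → E4) ℂ),
      tsupport (f : (Fin 1 → E4) → ℂ) ⊆ {x | u ≤ x 0 0 ∧ x 0 0 ≤ 2 * u} →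
    ∀ (Λ : ℝ), 0 < Λ → ∀ (n : ℕ) (W : SchwartzMap (Fin n → E4) ℂ) (hW : IsTimeOrdered W)
      (hFW : IsTimeOrdered (f.appendTensor (translateMulti ((2 * u + v) • EuclideanSpace.single 0 1) W))),
    ∀ (P : (Σ m : ℕ, SchwartzMap (Fin m → E4) ℂ) → (Σ m : ℕ, SchwartzMap (Fin m → E4) ℂ)),
      (P = fun Gσ => ⟨1 + (1 + Gσ.1), translateMulti ((2 * u + v) • EuclideanSpace.single 0 1)
        ((osAdjoint f).appendTensor
          (f.appendTensor (translateMulti ((2 * u + v) • EuclideanSpace.single 0 1) Gσ.2)))⟩) →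
      (∃ K : ℝ, 0 ≤ K ∧ ∃ m : ℕ, ∀ N : ℕ, m ≤ N → ∃ (A U : SchwartzMap (Fin (P^[N] ⟨n, W⟩).1 → E4) ℂ),
          IsPositiveTimeMulti A ∧ IsOffDiagonal A ∧ IsPositiveTimeMulti U ∧ IsOffDiagonal U ∧
          (fun n' => (S₁ n').comp (linActMulti R) : SchwingerFamily E4)
              ((P^[N] ⟨n, W⟩).1 + (P^[N] ⟨n, W⟩).1)
              ((osAdjoint (P^[N] ⟨n, W⟩).2).appendTensor (P^[N] ⟨n, W⟩).2) = S₁.osPairing A U ∧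
          (S₁.osPairing A A).re ≤ K * Λ ^ (4 * N) ∧ (S₁.osPairing U U).re ≤ K * Λ ^ (4 * N)) →
      ‖h'.fieldVec (1 + n) (fun _ => ())
          (f.appendTensor (translateMulti ((2 * u + v) • EuclideanSpace.single 0 1) W)) hFW‖ ≤
        Λ * ‖h'.fieldVec n (fun _ => ()) W hW‖ :=
  Summit.QuantumFields.YangMills.Theorems.SoftKernelBoostCovariance.Sketch.stub_diagEngine

/-- **Stub (F) `stub_diagOfBoxes` — A SANDWICH BOUND FOR BOX-LOCALISED INSERTIONS AND COMPACT CLOUDS IS A SANDWICH BOUND (model-blind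
analysis; difficulty L).**  For any one-species family `S` on `ℝ⁴` with `e₀`-reconstruction `hS` and `NPointRegular S`: if the vector bound
`‖Ψ_{f ⊗ T_{(2u+v)e₀}W}‖ ≤ CB·Mg·(Mh+Mh')·(u^{-μ}+v^{-μ})·‖Ψ_W‖` holds for every BOX insertion `f = g(x₀,x₁)hh(x₂,x₃)` (`g` supported in
`[c, c+δ] × [−δ, δ]`, `δ = min(u,v)/32`, `u ≤ c`, `c + δ ≤ 2u`, `∫|g| ≤ Mg` with `Mg > 0`) and every COMPACTLY SUPPORTED time-ordered admissible
`W`, then `SandwichBound S hS μ (4·CB)`.  PROOF: (1) a general insertion (`g` supported in `[u,2u] × ℝ`, merely integrable; `f` Schwartz) is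
`f = Σ_{i,j} f·χᵢ(x₀)ψⱼ(x₁)` for smooth nonnegative partitions of unity `Σχᵢ = 1` on `[u,2u]` (finitely many, mesh `δ`) and `Σⱼψⱼ = 1` on `ℝ`
(translates of one bump, mesh `δ`), each piece Schwartz (`SchwartzMap.smulLeftCLM`, `Function.HasTemperateGrowth` of bounded smooth
cut-offs) of box type after the sideways translation `x₁ ↦ x₁ − jδ`, which is free: `‖Ψ_{τ_b X}‖ = ‖Ψ_X‖` for spatial `b`
(`translate_fieldVec`, `hS.translate` is a linear isometry; `W ↦ τ_bW` stays time-ordered, compactly supported, admissible); masses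
`Mg_{ij} = ∫|gχᵢψⱼ|` add up to `∫|g| ≤ Mg` (use `Mg_{ij} + ε2^{-i-|j|}` for positivity and let `ε → 0`); (2) `‖Ψ_{F_M ⊗ T_sW}‖ ≤ Σ ≤ CB·(Mg+3ε)·…`
for the finite partial sums `F_M` (`fieldVec` is linear: `fieldVec_finset_sum`/`fieldVec_add`); (3) `M → ∞` and the passage from compactly
supported `W_k = χ_k·W → W` by dominated convergence under `NPointRegular S` applied to the pairings `𝔖(ΘX* ⊗ X)` that ARE the squared
norms (`norm_fieldVec_sq`; integrands `W_{2+2n}·r_k·(ΘX*⊗X)` with bounded multipliers `r_k → 1` pointwise), as in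
`UnorderedRP.tendsto_osPairing`. -/
theorem stub_diagOfBoxes :
    open Literature.MathematicalPhysics.QuantumLattice Literature.MathematicalPhysics.AQFT
      Literature.MathematicalPhysics.QuantumFieldTheory
      Summit.QuantumFields.YangMills.Theorems.CurvatureSandwichBound.Negative
      Summit.QuantumFields.YangMills.Theorems.NPointIsotropy.Negative in
    ∀ (S : SchwingerFamily E4) (hS : OSReconstructionNoE1 S.toLabelled), NPointRegular S →
    ∀ (μ CB : ℝ), 0 ≤ μ → 0 ≤ CB →
      (∀ (u v c : ℝ), 0 < u → 0 < v → u ≤ 1 → v ≤ 1 → u ≤ c → c + min u v / 32 ≤ 2 * u →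
        ∀ (f : SchwartzMap (Fin 1 → E4) ℂ) (g hh : ℝ × ℝ → ℂ) (Mg Mh Mh' : ℝ),
          (∀ x, f x = g (x 0 0, x 0 1) * hh (x 0 2, x 0 3)) →
          (∀ p, g p ≠ 0 → (c ≤ p.1 ∧ p.1 ≤ c + min u v / 32) ∧ |p.2| ≤ min u v / 32) →
          MeasureTheory.Integrable g → (∫ p, ‖g p‖) ≤ Mg → 0 < Mg →
          MeasureTheory.Integrable hh → (∫ p, ‖hh p‖) ≤ Mh → (∀ p, ‖hh p‖ ≤ Mh') →
        ∀ (n : ℕ) (W : SchwartzMap (Fin n → E4) ℂ) (hW : IsTimeOrdered W),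
          HasCompactSupport (W : (Fin n → E4) → ℂ) →
        ∀ (hFW : IsTimeOrdered (f.appendTensor (translateMulti ((2 * u + v) • EuclideanSpace.single 0 1) W))),
          ‖hS.fieldVec (1 + n) (fun _ => ())
              (f.appendTensor (translateMulti ((2 * u + v) • EuclideanSpace.single 0 1) W)) hFW‖ ≤
            CB * Mg * (Mh + Mh') * (u ^ (-μ) + v ^ (-μ)) * ‖hS.fieldVec n (fun _ => ()) W hW‖) →
      SandwichBound S hS μ (4 * CB) :=
  Summit.QuantumFields.YangMills.Theorems.SoftKernelBoostCovariance.Sketch.stub_diagOfBoxes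

/-! ### Glue for v3.12 (lead): pull-back regularity, monotonicity of the rows, the degenerate insertion, the 45° row -/

/-- `NPointRegular` passes to the pull-back of `S₁` by a linear isometry (change of variables by the measure-preserving diagonal action). -/
theorem nPointRegular_pullBack {S₁ : SchwingerFamily E4} (hreg : NPointRegular S₁) (R : E4 ≃ₗᵢ[ℝ] E4) :
    NPointRegular (fun n => (S₁ n).comp (linActMulti R) : SchwingerFamily E4) := by
  intro n
  obtain ⟨Wn, hWn⟩ := hreg n
  set eM : (Fin n → E4) ≃ᵐ (Fin n → E4) :=
    (ContinuousLinearEquiv.piCongrRight fun _ : Fin n => R.toContinuousLinearEquiv).toHomeomorph.toMeasurableEquiv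
    with heM
  have heM_apply : ∀ x : Fin n → E4, eM x = fun i => R (x i) := fun x => rfl
  have he : MeasurePreserving eM := by
    have h0 : MeasurePreserving (fun (x : Fin n → E4) (i : Fin n) => R (x i)) :=
      volume_preserving_pi (fun _ : Fin n => R.measurePreserving)
    exact h0
  refine ⟨fun x => Wn (fun i => R (x i)), fun F hF => ?_⟩
  have hF' : IsOffDiagonal (linActMulti R F) :=
    Summit.QuantumFields.YangMills.Theorems.CurvatureBoostCovariance.Negative.isOffDiagonal_linActMulti hF R
  obtain ⟨hint, hS⟩ := hWn (linActMulti R F) hF'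
  have hcomp : (fun x : Fin n → E4 => Wn (fun i => R (x i)) * F x) =
      (fun y : Fin n → E4 => Wn y * linActMulti R F y) ∘ eM := by
    funext x
    simp only [Function.comp_apply, heM_apply, linActMulti_apply, LinearIsometryEquiv.symm_apply_apply]
  refine ⟨?_, ?_⟩
  · rw [hcomp]
    exact (he.integrable_comp_emb eM.measurableEmbedding).2 hint
  · show S₁ n (linActMulti R F) = _
    rw [hS, hcomp]
    exact (he.integral_comp' _).symm

/-- The rows are monotone: exponent `μ ↦ max μ 0` and constant `C ↦ max C 1` (reserves `u, v ≤ 1`, nonnegative masses). -/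
theorem sandwichBound_mono {S₁ : SchwingerFamily E4} (h : OSReconstructionNoE1 S₁.toLabelled) {μ C : ℝ}
    (hSB : SandwichBound S₁ h μ C) : SandwichBound S₁ h (max μ 0) (max C 1) := by
  have h1 := sandwich_mono_exponent h hSB
  intro u v hu hv hu1 hv1 f₁ g hh Mg Mh Mh' hf hg hgi hgM hhi hhM hhM' n W hW hFW
  have h0 := h1 u v hu hv hu1 hv1 f₁ g hh Mg Mh Mh' hf hg hgi hgM hhi hhM hhM' n W hW hFW
  have hMg0 : 0 ≤ Mg := (integral_nonneg fun _ => norm_nonneg _).trans hgM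
  have hMh0 : 0 ≤ Mh := (integral_nonneg fun _ => norm_nonneg _).trans hhM
  have hMh'0 : 0 ≤ Mh' := (norm_nonneg _).trans (hhM' 0)
  have hr : 0 ≤ u ^ (-max μ 0) + v ^ (-max μ 0) := add_nonneg (Real.rpow_nonneg hu.le _) (Real.rpow_nonneg hv.le _)
  have hX : 0 ≤ Mg * (Mh + Mh') * (u ^ (-max μ 0) + v ^ (-max μ 0)) * ‖h.fieldVec n (fun _ => ()) W hW‖ := by positivity
  calc _ ≤ C * Mg * (Mh + Mh') * (u ^ (-max μ 0) + v ^ (-max μ 0)) * ‖h.fieldVec n (fun _ => ()) W hW‖ := h0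
    _ = C * (Mg * (Mh + Mh') * (u ^ (-max μ 0) + v ^ (-max μ 0)) * ‖h.fieldVec n (fun _ => ()) W hW‖) := by ring
    _ ≤ max C 1 * (Mg * (Mh + Mh') * (u ^ (-max μ 0) + v ^ (-max μ 0)) * ‖h.fieldVec n (fun _ => ()) W hW‖) :=
        mul_le_mul_of_nonneg_right (le_max_left _ _) hX
    _ = _ := by ring

/-- **THE 45° ROW FROM THE AXIS ROW (v3.12 composition of (G), (E), (F); model-blind given `NPointRegular`).**  For `S₁` with an
`e₀`-reconstruction `h`, E3, the function residual and the axis bound `SandwichBound S₁ h μ C` (`μ ≥ 0`, `C > 0`): every `e₀`-reconstruction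
`h'` of the `45°` pull-back satisfies `SandwichBound T h' μ (8·3^μ·C)`. -/
theorem diag_of_axis (S₁ : SchwingerFamily E4) (h : OSReconstructionNoE1 S₁.toLabelled) (μ C : ℝ) (hμ : 0 ≤ μ) (hC : 0 < C)
    (hE3 : S₁.toLabelled.IsSymmetric) (hreg : NPointRegular S₁) (hSB : SandwichBound S₁ h μ C)
    (h' : OSReconstructionNoE1 (SchwingerFamily.toLabelled
      (fun n => (S₁ n).comp (linActMulti (planeRot (0 : Fin 3) (Real.pi / 4)))))) :
    SandwichBound (fun n => (S₁ n).comp (linActMulti (planeRot (0 : Fin 3) (Real.pi / 4))) : SchwingerFamily E4) h' μ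
      (4 * (2 * (3 : ℝ) ^ μ * C)) := by
  have hCB : 0 ≤ 2 * (3 : ℝ) ^ μ * C := by positivity
  refine stub_diagOfBoxes _ h' (nPointRegular_pullBack hreg _) μ (2 * (3 : ℝ) ^ μ * C) hμ hCB ?_
  intro u v c hu hv hu1 hv1 huc hc2 f g hh Mg Mh Mh' hf hg hgi hgM hMg hhi hhM hhM' n W hW hWc hFW
  have hMh0 : 0 ≤ Mh := (integral_nonneg fun _ => norm_nonneg _).trans hhM
  have hMh'0 : 0 ≤ Mh' := (norm_nonneg _).trans (hhM' 0)
  have hr : 0 < u ^ (-μ) + v ^ (-μ) := add_pos (Real.rpow_pos_of_pos hu _) (Real.rpow_pos_of_pos hv _)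
  rcases (add_nonneg hMh0 hMh'0).eq_or_lt with hdeg | hpos
  · -- degenerate insertion: `hh = 0`, so `f = 0` and the sandwiched vector vanishes
    have hMh'z : Mh' = 0 := le_antisymm (by linarith) hMh'0
    have hhz : ∀ p, hh p = 0 := fun p => norm_le_zero_iff.1 (hMh'z ▸ hhM' p)
    have hf0 : f = 0 := by ext x; rw [hf x, hhz]; simp
    have hX0 : f.appendTensor (translateMulti ((2 * u + v) • EuclideanSpace.single 0 1) W) = 0 := by
      rw [hf0]; ext x; simp
    have hv0 : ‖h'.fieldVec (1 + n) (fun _ => ())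
        (f.appendTensor (translateMulti ((2 * u + v) • EuclideanSpace.single 0 1) W)) hFW‖ = 0 := by
      have hsq := Summit.QuantumFields.YangMills.Theorems.CurvatureSandwichBound.Sketch.re_pairing_self_eq_norm_sq
        (fun n => (S₁ n).comp (linActMulti (planeRot (0 : Fin 3) (Real.pi / 4)))) h' _ hFW
      have hz : ((osAdjoint (f.appendTensor (translateMulti ((2 * u + v) • EuclideanSpace.single 0 1) W))).appendTensor
          (f.appendTensor (translateMulti ((2 * u + v) • EuclideanSpace.single 0 1) W))) = 0 := by
        rw [hX0]; ext x; simp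
      rw [hz, map_zero, Complex.zero_re] at hsq
      exact pow_eq_zero_iff two_ne_zero |>.1 hsq.symm
    rw [hv0, ← hdeg]
    simp
  · have hΛpos : 0 < 2 * (3 : ℝ) ^ μ * C * Mg * (Mh + Mh') * (u ^ (-μ) + v ^ (-μ)) := by positivity
    set P : (Σ m : ℕ, 𝓢((Fin m → E4), ℂ)) → (Σ m : ℕ, 𝓢((Fin m → E4), ℂ)) := fun Gσ =>
      ⟨1 + (1 + Gσ.1), translateMulti ((2 * u + v) • EuclideanSpace.single 0 1)
        ((osAdjoint f).appendTensor
          (f.appendTensor (translateMulti ((2 * u + v) • EuclideanSpace.single 0 1) Gσ.2)))⟩ with hP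
    have hwin : tsupport (f : (Fin 1 → E4) → ℂ) ⊆ {x | u ≤ x 0 0 ∧ x 0 0 ≤ 2 * u} := by
      refine Summit.QuantumFields.YangMills.Theorems.CurvatureSandwichBound.Sketch.tsupport_subset_window hf fun p hp => ?_
      have h1 := (hg p hp).1
      have hδ : 0 ≤ min u v / 32 := by positivity
      exact ⟨huc.trans h1.1, h1.2.trans (by linarith)⟩
    obtain ⟨K, hK0, m, hm⟩ := stub_diagGrowthT S₁ h μ C hμ hC hE3 hreg hSB u v c hu hv hu1 hv1 huc hc2 f g hh Mg Mh Mh'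
      hf hg hgi hgM hMg hhi hhM hhM' n W hW hWc hFW P hP
    have key := stub_diagEngine S₁ h hE3 hreg (planeRot (0 : Fin 3) (Real.pi / 4)) h' u v hu hv f hwin _ hΛpos n W hW hFW P hP
      ⟨K, hK0, m, fun N hN => by
        obtain ⟨h1, h2, h3, h4, h5, h6, h7⟩ := hm N hN
        exact ⟨linActMulti (planeRot (0 : Fin 3) (Real.pi / 4)).symm (P^[N] ⟨n, W⟩).2,
          linActMulti (planeRot (0 : Fin 3) (Real.pi / 4)) (P^[N] ⟨n, W⟩).2, h1, h2, h3, h4, h5, h6, h7⟩⟩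
    calc _ ≤ 2 * (3 : ℝ) ^ μ * C * Mg * (Mh + Mh') * (u ^ (-μ) + v ^ (-μ)) * ‖h'.fieldVec n (fun _ => ()) W hW‖ := key
      _ = _ := by ring

/-! ## The sandwich PAIR (v3.11 registered text) — v3.12: a THEOREM from `stub_sandwichAxis` + the model-blind diagonal stubs -/

/-- **(Σ-pair) — THE SANDWICH PAIR, v3.11 registered text; v3.12: PROVED from `stub_sandwichAxis` (the axis row, YM) and the model-blind
stubs (C) (D) (G) (E) (F) via `diag_of_axis` (the `45°` row with exponent `max μ 0` and constant `8·3^{max μ 0}·max C 1`).  v3.11 description: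
the transversely filtered heat-sandwich bound for the curvature channel, (i) in the `e₀` frame WITH ONE POWER OF SLACK `μ < 4`, and (ii) in
the `45°` frame with an ARBITRARY exponent (a polynomial H-bound of the diagonal transfer matrix; v3.11: the chain consumes the `45°`
pull-back only through its UNIFORM boost vectors, whose type never enters the sieve, so the item's `μ < 4` there is idle).**  The ITEM
`IsotropyFromPowerCounting.CurvatureSandwichBound` (stmt-QuantumFields-18372: `μ < 4` in both frames, `45°` frame by coordinates) closes it in
one line (`sandwichPair_of_item`; landed twin `sandwichPair_of_curvatureSandwichBound`).  For every compact simple `G`, `r`, `sch` and `S₁`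
with `W1 r sch S₁`, the eight frames, the cone and the kernel triple: for every `e₀`-reconstruction `h` of `S₁` some `μ < 4` and `C` with
the TRANSVERSE-SLACK HEAT-SANDWICH BOUND — for all scales `0 < u, v ≤ 1`, every one-point insertion `f₁ = g ⊗ hh` (planar profile
`g(x₀, x₁)` with times in `[u, 2u]`, weighted by its `L¹` mass `Mg`; transverse profile `hh(x₂, x₃)` controlled in `L¹` (`Mh`) AND `L^∞`
(`Mh'`)) and every time-ordered `W` of any degree `n` pushed to times `> 2u + v`:
`‖Ψ_{f₁ ⊗ W_{(2u+v)e₀}}‖ ≤ C · Mg · (Mh + Mh') · (u^{-μ} + v^{-μ}) · ‖Ψ_W‖ —; and for every `e₀`-reconstruction `h'` of the `45°` pull-back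
`n ↦ 𝔖ₙ ∘ (R_{π/4} ·)` the same bound with SOME exponent `μ` and constant `C`.  Vacuum row of (i) = the kernel triple (exponent `4 − η/2`);
Gaussian class: `μ = Δ₂ − 1`; power counting for `tr F²`: `μ = 3`, margin one full power.  Certified inhabitants (`c ≡ 0` / `β ≡ 0` /
bounded-`c_k` schemes, the vacuum): `μ = 0`, `C = |κ|`; junk: `C = 0` (Disproof §5).  A counterexample to (i) must be a 16-RP coned
non-Gaussian family whose `e₀` sandwich exponent exceeds its two-point exponent `Δ₂ − 1` by a full unit; (ii) fails only for a Wilson limit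
whose diagonal transfer matrix admits NO polynomial sandwich bound at all.  Vetting notes: evidence `SandwichVetting.md`, `SandwichVetting-c5.md`. -/
theorem stub_sandwichPair :
    open Literature.MathematicalPhysics.QuantumLattice Literature.MathematicalPhysics.AQFT
      Literature.MathematicalPhysics.QuantumFieldTheory
      Summit.QuantumFields.YangMills.Theorems.CurvatureBoostCovariance.Negative
      Summit.QuantumFields.YangMills.Theorems.NPointIsotropy.Negative in
    (    ∀ (G : Type) [Group G] [TopologicalSpace G] [IsTopologicalGroup G] [CompactSpace G]
       [MeasurableSpace G] [BorelSpace G], IsCompactSimpleLieGroup G →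
       ∀ (r : LatticeRep G) (sch : SpeciesScheme (YMSpecies G)) (S₁ : SchwingerFamily E4),
         W1 r sch S₁ → EightFrameRP S₁ → PlanarCone S₁ →
         (∃ (K : E4 → ℝ) (C η : ℝ), 0 < η ∧ ContinuousOn K {x : E4 | x ≠ 0} ∧
           (∀ x : E4, x ≠ 0 → |K x| ≤ C * (1 + ‖x‖ ^ (η - 10))) ∧
           ∀ F : SchwartzMap (Fin 2 → E4) ℂ, IsOffDiagonal F →
             MeasureTheory.Integrable (fun x : Fin 2 → E4 => (K (x 0 - x 1) : ℂ) * F x) ∧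
               S₁ 2 F = ∫ x : Fin 2 → E4, (K (x 0 - x 1) : ℂ) * F x) →
         (∀ (h : OSReconstructionNoE1 S₁.toLabelled), ∃ μ C : ℝ, μ < 4 ∧
           (∀ (u v : ℝ), 0 < u → 0 < v → u ≤ 1 → v ≤ 1 →
              ∀ (f₁ : SchwartzMap (Fin 1 → E4) ℂ) (g hh : ℝ × ℝ → ℂ) (Mg Mh Mh' : ℝ),
                (∀ x : Fin 1 → E4, f₁ x = g (x 0 0, x 0 1) * hh (x 0 2, x 0 3)) →
                (∀ p : ℝ × ℝ, g p ≠ 0 → u ≤ p.1 ∧ p.1 ≤ 2 * u) →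
                MeasureTheory.Integrable g → (∫ p, ‖g p‖) ≤ Mg →
                MeasureTheory.Integrable hh → (∫ p, ‖hh p‖) ≤ Mh → (∀ p, ‖hh p‖ ≤ Mh') →
              ∀ (n : ℕ) (W : SchwartzMap (Fin n → E4) ℂ) (hW : IsTimeOrdered W)
                (hFW : IsTimeOrdered
                  (SchwartzMap.appendTensor f₁ (translateMulti ((2 * u + v) • EuclideanSpace.single 0 1) W))),
                ‖h.fieldVec (1 + n) (fun _ => ())
                    (SchwartzMap.appendTensor f₁ (translateMulti ((2 * u + v) • EuclideanSpace.single 0 1) W)) hFW‖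
                  ≤ C * Mg * (Mh + Mh') * (u ^ (-μ) + v ^ (-μ)) * ‖h.fieldVec n (fun _ => ()) W hW‖)) ∧
         (∀ (h' : OSReconstructionNoE1 (SchwingerFamily.toLabelled
             (fun n => (S₁ n).comp (linActMulti (planeRot (0 : Fin 3) (Real.pi / 4)))))),
           ∃ μ C : ℝ,
           (∀ (u v : ℝ), 0 < u → 0 < v → u ≤ 1 → v ≤ 1 →
              ∀ (f₁ : SchwartzMap (Fin 1 → E4) ℂ) (g hh : ℝ × ℝ → ℂ) (Mg Mh Mh' : ℝ),
                (∀ x : Fin 1 → E4, f₁ x = g (x 0 0, x 0 1) * hh (x 0 2, x 0 3)) →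
                (∀ p : ℝ × ℝ, g p ≠ 0 → u ≤ p.1 ∧ p.1 ≤ 2 * u) →
                MeasureTheory.Integrable g → (∫ p, ‖g p‖) ≤ Mg →
                MeasureTheory.Integrable hh → (∫ p, ‖hh p‖) ≤ Mh → (∀ p, ‖hh p‖ ≤ Mh') →
              ∀ (n : ℕ) (W : SchwartzMap (Fin n → E4) ℂ) (hW : IsTimeOrdered W)
                (hFW : IsTimeOrdered
                  (SchwartzMap.appendTensor f₁ (translateMulti ((2 * u + v) • EuclideanSpace.single 0 1) W))),
                ‖h'.fieldVec (1 + n) (fun _ => ())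
                    (SchwartzMap.appendTensor f₁ (translateMulti ((2 * u + v) • EuclideanSpace.single 0 1) W)) hFW‖
                  ≤ C * Mg * (Mh + Mh') * (u ^ (-μ) + v ^ (-μ)) * ‖h'.fieldVec n (fun _ => ()) W hW‖))) := by
  intro G _ _ _ _ _ _ hG r sch S₁ hW h8 hC hK
  have hreg : NPointRegular S₁ := stub_tieRegularity G hG r sch S₁ hW h8 hC hK
  obtain ⟨_, hOS, htr, -, -⟩ := id hW
  have hRP := hOS.2.2.2.1
  have hsym := hOS.2.2.2.2.1
  have hAxis : SandwichRows S₁ := stub_sandwichAxis G hG r sch S₁ hW h8 hC hK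
  refine ⟨hAxis, fun h' => ?_⟩
  have h : OSReconstructionNoE1 S₁.toLabelled := osReconstruction_of hRP htr
  obtain ⟨μ, C, -, hSB⟩ := hAxis h
  have hSB' : SandwichBound S₁ h (max μ 0) (max C 1) := sandwichBound_mono h hSB
  exact ⟨max μ 0, 4 * (2 * (3 : ℝ) ^ (max μ 0) * max C 1),
    diag_of_axis S₁ h _ _ (le_max_right _ _) (lt_of_lt_of_le one_pos (le_max_right _ _)) hsym hreg hSB' h'⟩

/-- **The item Σ closes the pair in one line** (`CurvatureSandwichBound`, stmt-QuantumFields-18372: drop the `μ < 4` of its `45°` row;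
`sandwichBound_planeRot_of_curvatureSandwichBound`, p138806, names the frame `planeRot (0 : Fin 3) (π/4)`).  By-name closure path of the
skeleton: when `…CurvatureSandwichBound_holds` lands, `stub_sandwichPair := sandwichPair_of_item CurvatureSandwichBound_holds`
(landed twin: `sandwichPair_of_curvatureSandwichBound`). -/
theorem sandwichPair_of_item
    (hSig : Summit.QuantumFields.YangMills.Theses.IsotropyFromPowerCounting.CurvatureSandwichBound) :
    open Literature.MathematicalPhysics.QuantumLattice Literature.MathematicalPhysics.AQFT
      Literature.MathematicalPhysics.QuantumFieldTheory
      Summit.QuantumFields.YangMills.Theorems.CurvatureBoostCovariance.Negative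
      Summit.QuantumFields.YangMills.Theorems.NPointIsotropy.Negative in
    (    ∀ (G : Type) [Group G] [TopologicalSpace G] [IsTopologicalGroup G] [CompactSpace G]
       [MeasurableSpace G] [BorelSpace G], IsCompactSimpleLieGroup G →
       ∀ (r : LatticeRep G) (sch : SpeciesScheme (YMSpecies G)) (S₁ : SchwingerFamily E4),
         W1 r sch S₁ → EightFrameRP S₁ → PlanarCone S₁ →
         (∃ (K : E4 → ℝ) (C η : ℝ), 0 < η ∧ ContinuousOn K {x : E4 | x ≠ 0} ∧
           (∀ x : E4, x ≠ 0 → |K x| ≤ C * (1 + ‖x‖ ^ (η - 10))) ∧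
           ∀ F : SchwartzMap (Fin 2 → E4) ℂ, IsOffDiagonal F →
             MeasureTheory.Integrable (fun x : Fin 2 → E4 => (K (x 0 - x 1) : ℂ) * F x) ∧
               S₁ 2 F = ∫ x : Fin 2 → E4, (K (x 0 - x 1) : ℂ) * F x) →
         (∀ (h : OSReconstructionNoE1 S₁.toLabelled), ∃ μ C : ℝ, μ < 4 ∧
           (∀ (u v : ℝ), 0 < u → 0 < v → u ≤ 1 → v ≤ 1 →
              ∀ (f₁ : SchwartzMap (Fin 1 → E4) ℂ) (g hh : ℝ × ℝ → ℂ) (Mg Mh Mh' : ℝ),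
                (∀ x : Fin 1 → E4, f₁ x = g (x 0 0, x 0 1) * hh (x 0 2, x 0 3)) →
                (∀ p : ℝ × ℝ, g p ≠ 0 → u ≤ p.1 ∧ p.1 ≤ 2 * u) →
                MeasureTheory.Integrable g → (∫ p, ‖g p‖) ≤ Mg →
                MeasureTheory.Integrable hh → (∫ p, ‖hh p‖) ≤ Mh → (∀ p, ‖hh p‖ ≤ Mh') →
              ∀ (n : ℕ) (W : SchwartzMap (Fin n → E4) ℂ) (hW : IsTimeOrdered W)
                (hFW : IsTimeOrdered
                  (SchwartzMap.appendTensor f₁ (translateMulti ((2 * u + v) • EuclideanSpace.single 0 1) W))),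
                ‖h.fieldVec (1 + n) (fun _ => ())
                    (SchwartzMap.appendTensor f₁ (translateMulti ((2 * u + v) • EuclideanSpace.single 0 1) W)) hFW‖
                  ≤ C * Mg * (Mh + Mh') * (u ^ (-μ) + v ^ (-μ)) * ‖h.fieldVec n (fun _ => ()) W hW‖)) ∧
         (∀ (h' : OSReconstructionNoE1 (SchwingerFamily.toLabelled
             (fun n => (S₁ n).comp (linActMulti (planeRot (0 : Fin 3) (Real.pi / 4)))))),
           ∃ μ C : ℝ,
           (∀ (u v : ℝ), 0 < u → 0 < v → u ≤ 1 → v ≤ 1 →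
              ∀ (f₁ : SchwartzMap (Fin 1 → E4) ℂ) (g hh : ℝ × ℝ → ℂ) (Mg Mh Mh' : ℝ),
                (∀ x : Fin 1 → E4, f₁ x = g (x 0 0, x 0 1) * hh (x 0 2, x 0 3)) →
                (∀ p : ℝ × ℝ, g p ≠ 0 → u ≤ p.1 ∧ p.1 ≤ 2 * u) →
                MeasureTheory.Integrable g → (∫ p, ‖g p‖) ≤ Mg →
                MeasureTheory.Integrable hh → (∫ p, ‖hh p‖) ≤ Mh → (∀ p, ‖hh p‖ ≤ Mh') →
              ∀ (n : ℕ) (W : SchwartzMap (Fin n → E4) ℂ) (hW : IsTimeOrdered W)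
                (hFW : IsTimeOrdered
                  (SchwartzMap.appendTensor f₁ (translateMulti ((2 * u + v) • EuclideanSpace.single 0 1) W))),
                ‖h'.fieldVec (1 + n) (fun _ => ())
                    (SchwartzMap.appendTensor f₁ (translateMulti ((2 * u + v) • EuclideanSpace.single 0 1) W)) hFW‖
                  ≤ C * Mg * (Mh + Mh') * (u ^ (-μ) + v ^ (-μ)) * ‖h'.fieldVec n (fun _ => ()) W hW‖))) := by
  intro G _ _ _ _ _ _ hG r sch S₁ hW h8 hC hK
  obtain ⟨h0, h45⟩ := sandwichBound_planeRot_of_curvatureSandwichBound hSig G hG r sch S₁ hW h8 hC hK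
  exact ⟨h0, fun h' => let ⟨μ, C, _, hC'⟩ := h45 h'; ⟨μ, C, hC'⟩⟩

/-- The coordinates of `planeRot (0 : Fin 3) (π/4)` are the ones by which the item `CurvatureSandwichBound` names its `45°`
frame (landing as `planeRot_coords_quarter_pi` in `Theorems/IsotropyFromPowerCountingEngineFromPowerCounting.lean`, p138806). -/
theorem planeRot_coords_quarter_pi' (x : E4) :
    planeRot (0 : Fin 3) (Real.pi / 4) x 0 = Real.cos (Real.pi / 4) * x 0 + Real.sin (Real.pi / 4) * x 1 ∧
    planeRot (0 : Fin 3) (Real.pi / 4) x 1 = -Real.sin (Real.pi / 4) * x 0 + Real.cos (Real.pi / 4) * x 1 ∧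
    planeRot (0 : Fin 3) (Real.pi / 4) x 2 = x 2 ∧ planeRot (0 : Fin 3) (Real.pi / 4) x 3 = x 3 := by
  refine ⟨?_, ?_, ?_, ?_⟩ <;> simp [planeRot_apply]

/-! ## The model-blind operator chain (v3): cone family (landed), radial-bump chains, lower block, approximation -/

/-- **Stub (N) — THE OPERATOR CONE FAMILY (model-blind; LANDED p100538).**  For a one-species family with E0', E3,
translations on `⁰𝒮` and reflection positivity in the eight planar frames, and any `e₀`-reconstruction `h`, there is an operator
family `N : ℂ × ℂ → B(ℋ)` on the planar tube `{|Im b| < Re t}` with `‖N p‖ ≤ 1`, weakly holomorphic matrix elements, and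
`N(t, b) = e^{-tH} U(b e₁)` at real `t > 0`, `b` (operator cone of item 9664 + `Contraction.contractionFamily` + Riesz). -/
theorem stub_coneFamily :
    open Literature.MathematicalPhysics.QuantumLattice Literature.MathematicalPhysics.AQFT
      Literature.MathematicalPhysics.QuantumFieldTheory
      Summit.QuantumFields.YangMills.Theorems.CurvatureBoostCovariance.Negative
      Summit.QuantumFields.YangMills.Theorems.NPointIsotropy.Negative in
    ∀ (S₁ : SchwingerFamily E4) (h : OSReconstructionNoE1 S₁.toLabelled),
      S₁.toLabelled.HasLinearGrowth → S₁.toLabelled.IsSymmetric → Translations S₁ → EightFrameRP S₁ →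
        ∃ N : ℂ × ℂ → (h.Hilbert →L[ℂ] h.Hilbert),
          (∀ p : ℂ × ℂ, |p.2.im| < p.1.re → ‖N p‖ ≤ 1) ∧
          (∀ ψ ψ' : h.Hilbert, DifferentiableOn ℂ (fun p : ℂ × ℂ => ⟪ψ, N p ψ'⟫_ℂ) {p : ℂ × ℂ | |p.2.im| < p.1.re}) ∧
          (∀ (t b : ℝ), 0 < t → ∀ ψ : h.Hilbert,
            N ((t : ℂ), (b : ℂ)) ψ = h.transfer t (h.translate (b • EuclideanSpace.single 1 1) ψ)) :=
  Summit.QuantumFields.YangMills.Theorems.SoftKernelBoostCovariance.Sketch.stub_coneFamily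

/-- **Stub (T1) — INSERTION OPERATORS FROM A SANDWICH-TYPE ESTIMATE (model-blind OS bookkeeping; LANDED p107219).**
If prepending `f₁` to the `c`-translate of every admissible degree-`n` time-ordered `W` multiplies the OS norm by at most `K`,
there is a bounded operator `B` on `ℋ` with `‖B‖ ≤ max K 0` doing exactly this on the field vectors. -/
-- LANDED p107219 (tree: Theorems/MirrorModularBoostsSoftKernelBoostCovarianceInsertionOps.lean); referenced by name (v3.5)
theorem stub_insertionOps :
    open Literature.MathematicalPhysics.QuantumLattice Literature.MathematicalPhysics.AQFT
      Literature.MathematicalPhysics.QuantumFieldTheory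
      Summit.QuantumFields.YangMills.Theorems.CurvatureBoostCovariance.Negative
      Summit.QuantumFields.YangMills.Theorems.NPointIsotropy.Negative in
    ∀ (S₁ : SchwingerFamily E4) (h : OSReconstructionNoE1 S₁.toLabelled) (n : ℕ)
        (f₁ : SchwartzMap (Fin 1 → E4) ℂ) (c : E4) (K : ℝ),
        (∀ (W : SchwartzMap (Fin n → E4) ℂ) (hW : IsTimeOrdered W)
          (hFW : IsTimeOrdered (SchwartzMap.appendTensor f₁ (translateMulti c W))),
          ‖h.fieldVec (1 + n) (fun _ => ()) (SchwartzMap.appendTensor f₁ (translateMulti c W)) hFW‖ ≤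
            K * ‖h.fieldVec n (fun _ => ()) W hW‖) →
        ∃ B : h.Hilbert →L[ℂ] h.Hilbert, ‖B‖ ≤ max K 0 ∧
          ∀ (W : SchwartzMap (Fin n → E4) ℂ) (hW : IsTimeOrdered W)
            (hFW : IsTimeOrdered (SchwartzMap.appendTensor f₁ (translateMulti c W))),
            B (h.fieldVec n (fun _ => ()) W hW) =
              h.fieldVec (1 + n) (fun _ => ()) (SchwartzMap.appendTensor f₁ (translateMulti c W)) hFW :=
  Summit.QuantumFields.YangMills.Theorems.SoftKernelBoostCovariance.Sketch.stub_insertionOps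

/-- **Stub (T6) — VITALI FOR HILBERT-VALUED HOLOMORPHIC FAMILIES ON GROWING RECTANGLES (pure functional analysis; LANDED
p107687).**  Uniformly exponentially bounded holomorphic `V_k` on `{|Re θ| < ε, |Im θ| < k}` converging in norm at the real points
have a holomorphic "limit" on the strip with the same bound and the same real values. -/
-- LANDED p107687 (tree: Theorems/MirrorModularBoostsSoftKernelBoostCovarianceHilbertVitali.lean); referenced by name (v3.5)
theorem stub_hilbertVitali :
    ∀ (H : Type) [NormedAddCommGroup H] [InnerProductSpace ℂ H] [CompleteSpace H] (ε M N : ℝ), 0 < ε →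
        ∀ (V : ℕ → ℂ → H) (g : ℝ → H),
          (∀ k : ℕ, DifferentiableOn ℂ (V k) {θ : ℂ | |θ.re| < ε ∧ |θ.im| < (k : ℝ)}) →
          (∀ (k : ℕ) (θ : ℂ), |θ.re| < ε → |θ.im| < (k : ℝ) → ‖V k θ‖ ≤ M * Real.exp (N * |θ.im|)) →
          (∀ θ : ℝ, |θ| < ε → Filter.Tendsto (fun k => V k θ) Filter.atTop (nhds (g θ))) →
          ∃ W : ℂ → H, DifferentiableOn ℂ W {θ : ℂ | |θ.re| < ε} ∧
            (∀ θ : ℂ, |θ.re| < ε → ‖W θ‖ ≤ M * Real.exp (N * |θ.im|)) ∧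
            ∀ θ : ℝ, |θ| < ε → W θ = g θ :=
  Summit.QuantumFields.YangMills.Theorems.SoftKernelBoostCovariance.Sketch.stub_hilbertVitali


/-- **Stub (T3a) — ONE LINK OF THE OPERATOR CHAIN (model-blind OS bookkeeping; difficulty M; PROVED by the wave-4 worker, landing).**  Part (A) of (T3) below, stated alone (v3.2: with `0 < R`, without which the real-value clause speaks about `N` off the tube). -/
theorem stub_bumpChainLink :
    open Literature.MathematicalPhysics.QuantumLattice Literature.MathematicalPhysics.AQFT
      Literature.MathematicalPhysics.QuantumFieldTheory
      Summit.QuantumFields.YangMills.Theorems.CurvatureBoostCovariance.Negative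
      Summit.QuantumFields.YangMills.Theorems.NPointIsotropy.Negative in
    (∀ (S₁ : SchwingerFamily E4) (h : OSReconstructionNoE1 S₁.toLabelled)
      (N : ℂ × ℂ → (h.Hilbert →L[ℂ] h.Hilbert)),
      (∀ p : ℂ × ℂ, |p.2.im| < p.1.re → ‖N p‖ ≤ 1) →
      (∀ ψ ψ' : h.Hilbert, DifferentiableOn ℂ (fun p : ℂ × ℂ => ⟪ψ, N p ψ'⟫_ℂ) {p : ℂ × ℂ | |p.2.im| < p.1.re}) →
      (∀ (t b : ℝ), 0 < t → ∀ ψ : h.Hilbert,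
        N ((t : ℂ), (b : ℂ)) ψ = h.transfer t (h.translate (b • EuclideanSpace.single 1 1) ψ)) →
      ∀ (m : ℕ) (u v ρ w ε R M : ℝ) (φ : ℝ → ℂ) (hh : ℝ × ℝ → ℂ) (f : SchwartzMap (Fin 1 → E4) ℂ)
        (B : h.Hilbert →L[ℂ] h.Hilbert) (Y : SchwartzMap (Fin m → E4) ℂ) (c q : ℝ × ℝ) (V' : ℂ → h.Hilbert),
        0 < u → 0 < v → 0 < ρ → 2 * ρ ≤ u → 0 ≤ w → 0 < R →
        (∀ r : ℝ, ρ ^ 2 < r → φ r = 0) →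
        (∀ x : Fin 1 → E4, f x = φ ((x 0 0 - (u + ρ)) ^ 2 + (x 0 1) ^ 2) * hh (x 0 2, x 0 3)) →
        (∀ (W : SchwartzMap (Fin m → E4) ℂ) (hW : IsTimeOrdered W)
          (hFW : IsTimeOrdered (SchwartzMap.appendTensor f
            (translateMulti ((2 * u + v) • EuclideanSpace.single 0 1) W))),
          B (h.fieldVec m (fun _ => ()) W hW) =
            h.fieldVec (1 + m) (fun _ => ()) (SchwartzMap.appendTensor f
              (translateMulti ((2 * u + v) • EuclideanSpace.single 0 1) W)) hFW) →
        DifferentiableOn ℂ V' {ζ : ℂ | |ζ.re| < ε ∧ |ζ.im| < R} →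
        (∀ ζ : ℂ, |ζ.re| < ε → |ζ.im| < R → ‖V' ζ‖ ≤ M) →
        (∀ θ : ℝ, |θ| < ε →
          ∃ hθ : IsTimeOrdered (translateMulti
                (-((Real.cos θ * c.1 + Real.sin θ * c.2 + (u + v - ρ)) • EuclideanSpace.single 0 1 +
                  (-Real.sin θ * c.1 + Real.cos θ * c.2) • EuclideanSpace.single 1 1))
                (linActMulti (planeRot (0 : Fin 3) θ) Y)),
            V' θ = h.fieldVec m (fun _ => ()) (translateMulti
                  (-((Real.cos θ * c.1 + Real.sin θ * c.2 + (u + v - ρ)) • EuclideanSpace.single 0 1 +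
                    (-Real.sin θ * c.1 + Real.cos θ * c.2) • EuclideanSpace.single 1 1))
                  (linActMulti (planeRot (0 : Fin 3) θ) Y)) hθ) →
        (∀ ζ : ℂ, |ζ.re| < ε → |ζ.im| < R →
          |(-Complex.sin ζ * (c.1 - q.1) + Complex.cos ζ * (c.2 - q.2)).im| <
            (Complex.cos ζ * (c.1 - q.1) + Complex.sin ζ * (c.2 - q.2)).re - (w + u + ρ)) →
        DifferentiableOn ℂ (fun ζ : ℂ =>
            N (Complex.cos ζ * (c.1 - q.1) + Complex.sin ζ * (c.2 - q.2) - ((w + u + ρ : ℝ) : ℂ),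
               -Complex.sin ζ * (c.1 - q.1) + Complex.cos ζ * (c.2 - q.2)) (B (V' ζ)))
          {ζ : ℂ | |ζ.re| < ε ∧ |ζ.im| < R} ∧
        (∀ ζ : ℂ, |ζ.re| < ε → |ζ.im| < R →
          ‖N (Complex.cos ζ * (c.1 - q.1) + Complex.sin ζ * (c.2 - q.2) - ((w + u + ρ : ℝ) : ℂ),
               -Complex.sin ζ * (c.1 - q.1) + Complex.cos ζ * (c.2 - q.2)) (B (V' ζ))‖ ≤ ‖B‖ * M) ∧
        (∀ θ : ℝ, |θ| < ε → ∀ (G : SchwartzMap (Fin (m + 1) → E4) ℂ),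
          (∀ x : Fin (m + 1) → E4, G x =
            (φ ((x 0 0 + (Real.cos θ * q.1 + Real.sin θ * q.2 + w) - (Real.cos θ * c.1 + Real.sin θ * c.2)) ^ 2 +
                 (x 0 1 + (-Real.sin θ * q.1 + Real.cos θ * q.2) - (-Real.sin θ * c.1 + Real.cos θ * c.2)) ^ 2) *
               hh (x 0 2, x 0 3)) *
            (translateMulti
                (-((Real.cos θ * q.1 + Real.sin θ * q.2 + w) • EuclideanSpace.single 0 1 +
                  (-Real.sin θ * q.1 + Real.cos θ * q.2) • EuclideanSpace.single 1 1))
                (linActMulti (planeRot (0 : Fin 3) θ) Y)) (Fin.tail x)) →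
          ∀ hG : IsTimeOrdered G,
            N (Complex.cos θ * (c.1 - q.1) + Complex.sin θ * (c.2 - q.2) - ((w + u + ρ : ℝ) : ℂ),
               -Complex.sin θ * (c.1 - q.1) + Complex.cos θ * (c.2 - q.2)) (B (V' θ)) =
              h.fieldVec (m + 1) (fun _ => ()) G hG)) :=
  Summit.QuantumFields.YangMills.Theorems.SoftKernelBoostCovariance.Sketch.stub_bumpChainLink

/-- **Stub (T3b) — THE CHAIN OF A RADIAL-BUMP TENSOR (v3.3: part (B) ALONE — registered signatures are capped at 3900 characters, so `(A) → (B)` cannot be registered; its proof file imports the landed (T3a)); historical description of (A)+(B): (model-blind OS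
bookkeeping over the `e₀`-reconstruction; difficulty L; PROVABLE NOW).**  (A) For a cone family `N` (`‖N‖ ≤ 1` on the planar
tube `{|Im b| < Re t}`, weakly holomorphic, `N(t,b) = e^{-tH}U(be₁)` at real points), a one-point ITEM `f = g ⊗ hh` whose planar
profile is RADIAL about the planar point `(u+ρ, 0)` and supported in the disc of radius `ρ` (`f x = φ((x₀-(u+ρ))² + x₁²)·hh(x₂,x₃)`,
`φ = 0` beyond `ρ²`, `2ρ ≤ u`), an insertion operator `B : Ψ_W ↦ Ψ_{f ⊗ W_{(2u+v)e₀}}` on degree-`m` field vectors, and a TAIL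
FAMILY `V'` holomorphic and bounded by `M` on the rectangle `{|Re ζ| < ε, |Im ζ| < R}` whose real values are the field vectors of
the tail `Y` seen from the rotating centre `R_θ c` pulled back by `u+v-ρ` along `e₀` (`τ_{-(R_θ c + (u+v-ρ)e₀)} R_θ Y`): the
family `V ζ = N(R_ζ(c-q) - (w+u+ρ)e₀) B (V' ζ)` (complexified rotation `R_ζ(a,b) = (cos ζ·a + sin ζ·b, -sin ζ·a + cos ζ·b)`, the
convention of `planeRot 0`) is holomorphic on the rectangle when the first gap stays in the tube there, is bounded by `‖B‖·M`,
and at real angles equals the field vector of the whole configuration `item_c ⊗ Y` rotated by `θ`, seen from `R_θ q` and pulled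
back by `w e₀` (RADIALITY: `R_θ` moves the item's centre and nothing else, so translation-only chains reproduce rotated tensors).
(B) Iterating (A) along a radial-bump tensor `T` of degree `n` (common profile `φ`, centres `c j`, transverse profiles `hh j`,
insertion operators `B j` on the degree-`(n-1-j)` field vectors; previous point `p j` = `q` for the first item and `c (j-1)`
after it; reserve `r j` = `w+u+ρ` for the first and `2u+v` after) gives, when every consecutive gap stays in the tube on the
rectangle, that the rotated pulled-back configuration `τ_{-(R_θ q + w e₀)} R_θ T` is time-ordered for `|θ| < ε` and a family
`V` holomorphic on the rectangle, bounded by `(∏ ‖B j‖)·‖Ψ_1‖`, with those real values.  Proof on offer: (A) norm-holomorphy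
of `ζ ↦ N(γ ζ)` along a holomorphic curve into the tube from weak holomorphy + `‖N‖ ≤ 1`
(`Literature.Analysis.OperatorTheory.differentiableOn_of_forall_differentiableOn_inner`, file WeaklyHolomorphicFamily; cf.
`KernelVectors.differentiableOn_coneFamily_comp`), then `DifferentiableOn.clm_apply`; real values by `transfer_fieldVec`,
`translate_fieldVec`, the pointwise identity of test functions (`(R_θ⁻¹y - c)² = (y - R_θ c)²`, `cos² + sin² = 1`) and the degree
cast `1 + m = m + 1` (`OSReconstructionNoE1.Gen.eq_of_heq` after `subst`); (B) induction on `n` with (A), the tail tensor built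
by `SchwartzMap.tensorFin` from the items.  Twin: `Literature/…/OSBoostChains` (`chainOp`, `differentiableOn_chainOp`,
`norm_chainOp_apply_le`, `chainOp_apply_gen`). -/
theorem stub_bumpChain :
    open Literature.MathematicalPhysics.QuantumLattice Literature.MathematicalPhysics.AQFT
      Literature.MathematicalPhysics.QuantumFieldTheory
      Summit.QuantumFields.YangMills.Theorems.CurvatureBoostCovariance.Negative
      Summit.QuantumFields.YangMills.Theorems.NPointIsotropy.Negative in
    (∀ (S₁ : SchwingerFamily E4) (h : OSReconstructionNoE1 S₁.toLabelled)
      (N : ℂ × ℂ → (h.Hilbert →L[ℂ] h.Hilbert)),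
      (∀ p : ℂ × ℂ, |p.2.im| < p.1.re → ‖N p‖ ≤ 1) →
      (∀ ψ ψ' : h.Hilbert, DifferentiableOn ℂ (fun p : ℂ × ℂ => ⟪ψ, N p ψ'⟫_ℂ) {p : ℂ × ℂ | |p.2.im| < p.1.re}) →
      (∀ (t b : ℝ), 0 < t → ∀ ψ : h.Hilbert,
        N ((t : ℂ), (b : ℂ)) ψ = h.transfer t (h.translate (b • EuclideanSpace.single 1 1) ψ)) →
      ∀ (n : ℕ) (u v ρ w ε R : ℝ) (φ : ℝ → ℂ) (hh : Fin n → ℝ × ℝ → ℂ) (f : Fin n → SchwartzMap (Fin 1 → E4) ℂ)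
        (B : Fin n → (h.Hilbert →L[ℂ] h.Hilbert)) (c p : Fin n → ℝ × ℝ) (r : Fin n → ℝ) (q : ℝ × ℝ)
        (T : SchwartzMap (Fin n → E4) ℂ),
        0 < u → 0 < v → 0 < ρ → 2 * ρ ≤ u → 0 ≤ w → 0 < ε → 0 < R →
        (∀ s : ℝ, ρ ^ 2 < s → φ s = 0) →
        (∀ (j : Fin n) (x : Fin 1 → E4), f j x = φ ((x 0 0 - (u + ρ)) ^ 2 + (x 0 1) ^ 2) * hh j (x 0 2, x 0 3)) →
        (∀ x : Fin n → E4, T x = ∏ j, φ ((x j 0 - (c j).1) ^ 2 + (x j 1 - (c j).2) ^ 2) * hh j (x j 2, x j 3)) →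
        (∀ (j : Fin n) (W : SchwartzMap (Fin (n - 1 - j) → E4) ℂ) (hW : IsTimeOrdered W)
          (hFW : IsTimeOrdered (SchwartzMap.appendTensor (f j)
            (translateMulti ((2 * u + v) • EuclideanSpace.single 0 1) W))),
          B j (h.fieldVec (n - 1 - j) (fun _ => ()) W hW) =
            h.fieldVec (1 + (n - 1 - j)) (fun _ => ()) (SchwartzMap.appendTensor (f j)
              (translateMulti ((2 * u + v) • EuclideanSpace.single 0 1) W)) hFW) →
        (∀ j : Fin n, (j : ℕ) = 0 → p j = q ∧ r j = w + u + ρ) →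
        (∀ i j : Fin n, (j : ℕ) = i + 1 → p j = c i ∧ r j = 2 * u + v) →
        (∀ (j : Fin n) (ζ : ℂ), |ζ.re| < ε → |ζ.im| < R →
          |(-Complex.sin ζ * ((c j).1 - (p j).1) + Complex.cos ζ * ((c j).2 - (p j).2)).im| <
            (Complex.cos ζ * ((c j).1 - (p j).1) + Complex.sin ζ * ((c j).2 - (p j).2)).re - r j) →
        (∀ θ : ℝ, |θ| < ε → IsTimeOrdered (translateMulti
              (-((Real.cos θ * q.1 + Real.sin θ * q.2 + w) • EuclideanSpace.single 0 1 +
                (-Real.sin θ * q.1 + Real.cos θ * q.2) • EuclideanSpace.single 1 1))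
              (linActMulti (planeRot (0 : Fin 3) θ) T))) ∧
        ∃ V : ℂ → h.Hilbert,
          DifferentiableOn ℂ V {ζ : ℂ | |ζ.re| < ε ∧ |ζ.im| < R} ∧
          (∀ ζ : ℂ, |ζ.re| < ε → |ζ.im| < R →
            ‖V ζ‖ ≤ (∏ j, ‖B j‖) * ‖h.fieldVec 0 (fun _ => ()) (SchwartzMap.constOfSubsingleton 1)
              OSReconstructionNoE1.isTimeOrdered_constOfSubsingleton‖) ∧
          (∀ θ : ℝ, |θ| < ε → ∀ hθ : IsTimeOrdered (translateMulti
                  (-((Real.cos θ * q.1 + Real.sin θ * q.2 + w) • EuclideanSpace.single 0 1 +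
                    (-Real.sin θ * q.1 + Real.cos θ * q.2) • EuclideanSpace.single 1 1))
                  (linActMulti (planeRot (0 : Fin 3) θ) T)),
            V θ = h.fieldVec n (fun _ => ()) (translateMulti
                  (-((Real.cos θ * q.1 + Real.sin θ * q.2 + w) • EuclideanSpace.single 0 1 +
                    (-Real.sin θ * q.1 + Real.cos θ * q.2) • EuclideanSpace.single 1 1))
                  (linActMulti (planeRot (0 : Fin 3) θ) T)) hθ)) :=
  Summit.QuantumFields.YangMills.Theorems.SoftKernelBoostCovariance.Sketch.stub_bumpChain

/-- **Stub (T5) — THE RESERVE-AWARE LOWER BLOCK DOES NOT GROW WHEN THE DOUBLED DEGREE IS PLANAR-INVARIANT (model-blind;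
difficulty L; PROVABLE NOW).**  For the `e₀`-reconstruction `h` of a translation-invariant `S₁` with a cone family `N`, a degree
`m` in which `𝔖_{m+m}` is invariant on `⁰𝒮` under the rotations of the `(x₀,x₁)`-plane, and a family `V'` holomorphic on the
rectangle `{|Re ζ| < ε, |Im ζ| < R}` whose real values are the field vectors of `W_θ = τ_{-(R_θ c + w e₀)} R_θ Y` (the tail `Y`
seen from the rotating centre `R_θ c`, pulled toward the mirror by the reserve `w > 0`): if `w·e^R ≤ g` and the advanced blocks
`τ_{-(R_θ c + 2g e₀)} R_θ Y` are still time-ordered, then `‖V' ζ‖ ≤ ‖Ψ_{τ_{-(R_θ c + g e₀)} R_θ Y}‖` at `θ = Re ζ` — NO growth in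
`Im ζ` (only the ONE squeezed insertion above the block is paid for).  Proof on offer (the pencil identity of the landed
`RayPositivity.pencil_eq_inner`, with a matrix element of the cone family in place of a trigonometric polynomial): fix
`θ = Re ζ`; `Λ(s) = ⟪V'(θ - s̄), V'(θ + s)⟫` is holomorphic on `{|Re s| < ε - |θ|, |Im s| < R}` (`RayPositivity.hasDerivAt_innerSL_neg_conj`
pattern); for real `s`, `⟪Ψ_{W_{θ-s}}, Ψ_{W_{θ+s}}⟫ = 𝔖(ΘW_{θ-s}* ⊗ W_{θ+s})` (`inner_fieldVec_fieldVec`) `= 𝔖(ΘZ* ⊗ τ_{-2w R_{-s}e₀} Z)`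
with `Z = τ_{-R_θ c}R_θ Y` (`osAdjoint_translateMulti` and translation invariance by `w e₀`; `W_{θ±s} = τ_{-we₀}R_{±s}Z`;
`Θ(R_{-s}Z)* = R_s ΘZ*` as in `RayPositivity.isAppendTensorOf_linActMulti_planeRot`; `τ_a R_s = R_s τ_{R_s⁻¹a}`; planar invariance
of `𝔖_{m+m}` on the off-diagonal doubled function; `R_{-s}e₀ = (cos s, sin s)`) `= ⟪Ψ_Ỹ, N(2g - 2w cos s, -2w sin s) Ψ_Ỹ⟫` with
`Ỹ = τ_{-(R_θ c + g e₀)}R_θ Y` (translation by `g e₀`; `transfer_fieldVec`, `translate_fieldVec`); the right side is holomorphic in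
`s` on the rectangle because `(2g - 2w cos s, -2w sin s)` stays in the tube iff `w e^{|Im s|} < g`; identity theorem
(`AnalyticOnNhd.eqOn_of_preconnected_of_frequently_eq`); at `s = i·Im ζ` the left side is `‖V' ζ‖²`, the right side is bounded
by `‖N‖‖Ψ_Ỹ‖² ≤ ‖Ψ_Ỹ‖²`. -/
theorem stub_lowerBlock :
    open Literature.MathematicalPhysics.QuantumLattice Literature.MathematicalPhysics.AQFT
      Literature.MathematicalPhysics.QuantumFieldTheory
      Summit.QuantumFields.YangMills.Theorems.CurvatureBoostCovariance.Negative
      Summit.QuantumFields.YangMills.Theorems.NPointIsotropy.Negative in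
    ∀ (S₁ : SchwingerFamily E4) (h : OSReconstructionNoE1 S₁.toLabelled)
      (N : ℂ × ℂ → (h.Hilbert →L[ℂ] h.Hilbert)),
      (∀ p : ℂ × ℂ, |p.2.im| < p.1.re → ‖N p‖ ≤ 1) →
      (∀ ψ ψ' : h.Hilbert, DifferentiableOn ℂ (fun p : ℂ × ℂ => ⟪ψ, N p ψ'⟫_ℂ) {p : ℂ × ℂ | |p.2.im| < p.1.re}) →
      (∀ (t b : ℝ), 0 < t → ∀ ψ : h.Hilbert,
        N ((t : ℂ), (b : ℂ)) ψ = h.transfer t (h.translate (b • EuclideanSpace.single 1 1) ψ)) →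
      Translations S₁ →
      ∀ (m : ℕ) (Y : SchwartzMap (Fin m → E4) ℂ) (c : ℝ × ℝ) (w g ε R : ℝ) (V' : ℂ → h.Hilbert),
        0 < w → 0 < ε → 0 < R → w * Real.exp R ≤ g →
        (∀ (θ : ℝ) (F : SchwartzMap (Fin (m + m) → E4) ℂ), IsOffDiagonal F →
          S₁ (m + m) (linActMulti (planeRot (0 : Fin 3) θ) F) = S₁ (m + m) F) →
        DifferentiableOn ℂ V' {ζ : ℂ | |ζ.re| < ε ∧ |ζ.im| < R} →
        (∀ θ : ℝ, |θ| < ε →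
          ∃ hθ : IsTimeOrdered (translateMulti
                (-((Real.cos θ * c.1 + Real.sin θ * c.2 + w) • EuclideanSpace.single 0 1 +
                  (-Real.sin θ * c.1 + Real.cos θ * c.2) • EuclideanSpace.single 1 1))
                (linActMulti (planeRot (0 : Fin 3) θ) Y)),
            V' θ = h.fieldVec m (fun _ => ()) (translateMulti
                  (-((Real.cos θ * c.1 + Real.sin θ * c.2 + w) • EuclideanSpace.single 0 1 +
                    (-Real.sin θ * c.1 + Real.cos θ * c.2) • EuclideanSpace.single 1 1))
                  (linActMulti (planeRot (0 : Fin 3) θ) Y)) hθ) →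
        (∀ θ : ℝ, |θ| < ε → IsTimeOrdered (translateMulti
              (-((Real.cos θ * c.1 + Real.sin θ * c.2 + 2 * g) • EuclideanSpace.single 0 1 +
                (-Real.sin θ * c.1 + Real.cos θ * c.2) • EuclideanSpace.single 1 1))
              (linActMulti (planeRot (0 : Fin 3) θ) Y))) →
        ∀ ζ : ℂ, |ζ.re| < ε → |ζ.im| < R →
          ∀ hY : IsTimeOrdered (translateMulti
                (-((Real.cos ζ.re * c.1 + Real.sin ζ.re * c.2 + g) • EuclideanSpace.single 0 1 +
                  (-Real.sin ζ.re * c.1 + Real.cos ζ.re * c.2) • EuclideanSpace.single 1 1))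
                (linActMulti (planeRot (0 : Fin 3) ζ.re) Y)),
          ‖V' ζ‖ ≤ ‖h.fieldVec m (fun _ => ()) (translateMulti
                (-((Real.cos ζ.re * c.1 + Real.sin ζ.re * c.2 + g) • EuclideanSpace.single 0 1 +
                  (-Real.sin ζ.re * c.1 + Real.cos ζ.re * c.2) • EuclideanSpace.single 1 1))
                (linActMulti (planeRot (0 : Fin 3) ζ.re) Y)) hY‖ :=
  Summit.QuantumFields.YangMills.Theorems.SoftKernelBoostCovariance.Sketch.stub_lowerBlock

/-- **Stub (T4b) — RADIAL RIEMANN APPROXIMATION OF A PLANAR PROFILE (pure analysis on `ℝ²`; difficulty M–L; PROVABLE NOW).**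
A compactly supported Schwartz function `a` on `ℝ × ℝ` is, for every finite family of Schwartz seminorms and every `η > 0`,
and for all sufficiently small radii `ρ`, within `η` of a finite combination `Σ κᵢ g_ρ(· - yᵢ)` of translates of ANY GIVEN radial
profile `g_ρ = φ(|·|²)` of radius `ρ` (a Schwartz map `G`, real, nonnegative, `∫ G = 1`, `φ = 0` beyond `ρ²` — CHOSEN BY THE CALLER,
v3.1, so that (T4a) can use one common profile for all slots), with centres in the support of `a` and total coefficient mass
`≤ ‖a‖₁ + 1`; the threshold `ρ₀` depends on `a`, the seminorms and `η` only (NOT on the profile).  Proof on offer: `a * g_ρ → a` in every Schwartz seminorm as `ρ → 0` (supports in a fixed compact so the polynomial weights are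
bounded; derivatives fall on `a`; uniform continuity of `∂^β a`); for fixed `ρ` the Riemann sums `Σ_{y ∈ Δℤ², a(y) ≠ 0} a(y) Δ² g_ρ(· - y)`
converge to `a * g_ρ` in every seminorm as `Δ → 0` (derivatives fall on `g_ρ`; uniform continuity), and `Σ |a(y)| Δ² → ‖a‖₁`.
Mathlib: `HasCompactSupport.contDiff_convolution_right`, `MeasureTheory.convolution_tendsto_right`, `SchwartzMap.seminorm_le_bound`;
tree: `Literature/Analysis/Distribution/SchwartzApproximateIdentity.lean`, `SchwartzParameterIntegral.lean` (1-D twins). -/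
theorem stub_radialRiemann :
    ∀ (a : SchwartzMap (ℝ × ℝ) ℂ), HasCompactSupport (a : ℝ × ℝ → ℂ) →
      ∀ (s : Finset (ℕ × ℕ)) (η : ℝ), 0 < η →
        ∃ ρ₀ : ℝ, 0 < ρ₀ ∧ ∀ ρ : ℝ, 0 < ρ → ρ ≤ ρ₀ →
          ∀ (φ : ℝ → ℂ) (G : SchwartzMap (ℝ × ℝ) ℂ),
            (∀ r : ℝ, ρ ^ 2 < r → φ r = 0) →
            (∀ p : ℝ × ℝ, G p = φ (p.1 ^ 2 + p.2 ^ 2)) →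
            (∀ p : ℝ × ℝ, 0 ≤ (G p).re ∧ (G p).im = 0) →
            (∫ p : ℝ × ℝ, G p) = 1 →
            ∃ (I : ℕ) (y : Fin I → ℝ × ℝ) (κ : Fin I → ℂ) (g : Fin I → SchwartzMap (ℝ × ℝ) ℂ),
              (∀ (i : Fin I) (p : ℝ × ℝ), g i p = φ ((p.1 - (y i).1) ^ 2 + (p.2 - (y i).2) ^ 2)) ∧
              (∀ i : Fin I, y i ∈ tsupport (a : ℝ × ℝ → ℂ)) ∧
              (∑ i, ‖κ i‖ ≤ (∫ p : ℝ × ℝ, ‖a p‖) + 1) ∧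
              (∀ kl ∈ s, SchwartzMap.seminorm ℝ kl.1 kl.2 (a - ∑ i, κ i • g i) < η) :=
  Summit.QuantumFields.YangMills.Theorems.SoftKernelBoostCovariance.Sketch.stub_radialRiemann

/-- **Stub (T4a) — BUMP-TENSOR APPROXIMATION OF A COMPACTLY SUPPORTED TEST FUNCTION (pure analysis; difficulty L; PROVABLE
NOW — its first hypothesis is (T4b), registered separately).**  Every compactly supported `F ∈ 𝓢((ℝ⁴)ⁿ)` is, for every finite
family of Schwartz seminorms, every `η > 0` and all sufficiently small radii `ρ`, within `η` of a finite combination `Σ λᵢ Tᵢ`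
of SLOT PRODUCTS `Tᵢ(x) = ∏ⱼ g_ρ(planar xⱼ - cᵢⱼ)·hhᵢⱼ(transverse xⱼ)` (ONE common radial planar profile of radius `ρ` and unit
mass; the one-point items are also returned as Schwartz functions `f0 i j` centred at the planar origin), with planar centres
`cᵢⱼ` within `δ` (coordinatewise) of the planar projection of slot `j` of the support of `F`, transverse profiles controlled in `L¹`
and `L^∞` by a constant `A`, and total coefficient mass `Σ|λᵢ| ≤ M`, where `A, M` depend on `F, δ` ONLY — not on the seminorms,
`η` or `ρ` (this uniformity is what the Vitali limit of the chains needs).  Proof on offer: the tree's nuclear expansion of the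
identity of `𝓢(E, ℂ)` (`Literature.MathematicalPhysics.QuantumLattice.NuclearExpansion`: `tendsto_sum_eta`, `hasSum_coeff_smul_e`,
`exists_summable_bound`; files `SchwartzNuclearExpansion(Bounds)`, built on `SchwartzPartition` / `SchwartzFourierDensity`) with
`E = (Fin n → ℝ⁴)` and lattice coordinates `Λ` scaled so that three lattice units are `≤ δ`: the elementary functions
`e_{β,k}` = (product window `∏_c pouWindow`) × (box character) are products over all `4n` coordinates, hence slot products of a
planar factor `aⱼ ∈ 𝓢(ℝ²)` (compactly supported within three units of the slot-`j` planar support, since `coeff_{β,k}(F) ≠ 0`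
forces `supp η_β ∩ supp F ≠ ∅`) and a transverse factor `bⱼ` (window × character: `‖bⱼ‖_∞ ≤ 1`, `‖bⱼ‖₁ ≤ A`); the coefficients are
absolutely summable (`exists_summable_bound` with `|e_{β,k}|_s ≥ |e_{β,k}|_0 ≥ 1`), which fixes `M = (Σ|coeff|)·(sup‖aⱼ‖₁ + 1)ⁿ`;
truncate the expansion (error `η/2`), then replace each planar factor by its radial Riemann approximation (T4b, error small by
continuity of the slot product `(a₁,…,aₙ) ↦ ∏ⱼ aⱼ ⊗ bⱼ` in the planar factors — `SchwartzMap.mulComp`, cf. the tree's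
`continuous_appendTensor`) and multiply out (`Finset.prod_univ_sum`). -/
theorem stub_slotProductExpansion :
    open Literature.MathematicalPhysics.QuantumLattice Literature.MathematicalPhysics.AQFT
      Literature.MathematicalPhysics.QuantumFieldTheory
      Summit.QuantumFields.YangMills.Theorems.CurvatureBoostCovariance.Negative
      Summit.QuantumFields.YangMills.Theorems.NPointIsotropy.Negative in
    (∀ (a : SchwartzMap (ℝ × ℝ) ℂ), HasCompactSupport (a : ℝ × ℝ → ℂ) →
      ∀ (s : Finset (ℕ × ℕ)) (η : ℝ), 0 < η →
        ∃ ρ₀ : ℝ, 0 < ρ₀ ∧ ∀ ρ : ℝ, 0 < ρ → ρ ≤ ρ₀ →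
          ∀ (φ : ℝ → ℂ) (G : SchwartzMap (ℝ × ℝ) ℂ),
            (∀ r : ℝ, ρ ^ 2 < r → φ r = 0) →
            (∀ p : ℝ × ℝ, G p = φ (p.1 ^ 2 + p.2 ^ 2)) →
            (∀ p : ℝ × ℝ, 0 ≤ (G p).re ∧ (G p).im = 0) →
            (∫ p : ℝ × ℝ, G p) = 1 →
            ∃ (I : ℕ) (y : Fin I → ℝ × ℝ) (κ : Fin I → ℂ) (g : Fin I → SchwartzMap (ℝ × ℝ) ℂ),
              (∀ (i : Fin I) (p : ℝ × ℝ), g i p = φ ((p.1 - (y i).1) ^ 2 + (p.2 - (y i).2) ^ 2)) ∧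
              (∀ i : Fin I, y i ∈ tsupport (a : ℝ × ℝ → ℂ)) ∧
              (∑ i, ‖κ i‖ ≤ (∫ p : ℝ × ℝ, ‖a p‖) + 1) ∧
              (∀ kl ∈ s, SchwartzMap.seminorm ℝ kl.1 kl.2 (a - ∑ i, κ i • g i) < η)) →
    ∀ (n : ℕ) (F : SchwartzMap (Fin n → E4) ℂ), HasCompactSupport (F : (Fin n → E4) → ℂ) →
      ∀ δ : ℝ, 0 < δ →
        ∃ (A M : ℝ), ∀ (s : Finset (ℕ × ℕ)) (η : ℝ), 0 < η →
          ∃ ρ₀ : ℝ, 0 < ρ₀ ∧ ∀ ρ : ℝ, 0 < ρ → ρ ≤ ρ₀ →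
            ∃ (φ : ℝ → ℂ) (I : ℕ) (c : Fin I → Fin n → ℝ × ℝ) (hh : Fin I → Fin n → ℝ × ℝ → ℂ)
              (f0 : Fin I → Fin n → SchwartzMap (Fin 1 → E4) ℂ)
              (lam : Fin I → ℂ) (T : Fin I → SchwartzMap (Fin n → E4) ℂ),
              (∀ r : ℝ, ρ ^ 2 < r → φ r = 0) ∧
              MeasureTheory.Integrable (fun p : ℝ × ℝ => φ (p.1 ^ 2 + p.2 ^ 2)) ∧
              (∫ p : ℝ × ℝ, ‖φ (p.1 ^ 2 + p.2 ^ 2)‖) ≤ 1 ∧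
              (∀ (i : Fin I) (j : Fin n) (x : Fin 1 → E4),
                f0 i j x = φ ((x 0 0) ^ 2 + (x 0 1) ^ 2) * hh i j (x 0 2, x 0 3)) ∧
              (∀ (i : Fin I) (x : Fin n → E4),
                T i x = ∏ j, φ ((x j 0 - (c i j).1) ^ 2 + (x j 1 - (c i j).2) ^ 2) * hh i j (x j 2, x j 3)) ∧
              (∀ (i : Fin I) (j : Fin n), ∃ x ∈ tsupport (F : (Fin n → E4) → ℂ),
                |(c i j).1 - x j 0| ≤ δ ∧ |(c i j).2 - x j 1| ≤ δ) ∧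
              (∀ (i : Fin I) (j : Fin n), MeasureTheory.Integrable (hh i j) ∧
                (∫ p : ℝ × ℝ, ‖hh i j p‖) ≤ A ∧ ∀ p : ℝ × ℝ, ‖hh i j p‖ ≤ A) ∧
              (∑ i, ‖lam i‖ ≤ M) ∧
              (∀ kl ∈ s, SchwartzMap.seminorm ℝ kl.1 kl.2 (F - ∑ i, lam i • T i) < η) :=
  Summit.QuantumFields.YangMills.Theorems.SoftKernelBoostCovariance.Sketch.stub_slotProductExpansion

/-- **Stub (T4a-joint) — BUMP-TENSOR APPROXIMATION WITH ONE SUPPORT POINT PER TERM (pure analysis; difficulty L; LANDED p134442 by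
the c2 wave-1 worker — registered v3.4 by lead c1, whose own proof bounced only on `dedup.landed` and was lost with that seat's folder).**
Verbatim `stub_slotProductExpansion` (landed p117686) except for the localisation clause: for every term `i` there is ONE point
`x ∈ tsupport F` with `|(c i j).1 - x j 0| ≤ δ ∧ |(c i j).2 - x j 1| ≤ δ` for ALL slots `j` simultaneously (the nuclear-expansion
elementary functions `e_{β,k}` are supported in ONE small box of `(ℝ⁴)ⁿ`, so a point of `supp F ∩ supp e_{β,k}` serves every slot).
The assembly needs the joint form: the centres of a term must be time-ordered like a support point of `F` (gaps `≥ 4δ - 2δ`).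
Proof on offer: the landed file `MirrorModularBoostsSoftKernelBoostCovarianceSlotProductExpansion.lean` (reuse its helpers
`exists_planeFactor`, `exists_slotFactors`, `exists_seminorm_control`, `exists_finset_eq_sum_eta`, … by `import`, do not copy them),
with the localisation witness taken jointly. -/
theorem stub_slotProductExpansionJoint :
    open Literature.MathematicalPhysics.QuantumLattice Literature.MathematicalPhysics.AQFT
      Literature.MathematicalPhysics.QuantumFieldTheory
      Summit.QuantumFields.YangMills.Theorems.CurvatureBoostCovariance.Negative
      Summit.QuantumFields.YangMills.Theorems.NPointIsotropy.Negative in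
    (∀ (a : SchwartzMap (ℝ × ℝ) ℂ), HasCompactSupport (a : ℝ × ℝ → ℂ) →
      ∀ (s : Finset (ℕ × ℕ)) (η : ℝ), 0 < η →
        ∃ ρ₀ : ℝ, 0 < ρ₀ ∧ ∀ ρ : ℝ, 0 < ρ → ρ ≤ ρ₀ →
          ∀ (φ : ℝ → ℂ) (G : SchwartzMap (ℝ × ℝ) ℂ),
            (∀ r : ℝ, ρ ^ 2 < r → φ r = 0) →
            (∀ p : ℝ × ℝ, G p = φ (p.1 ^ 2 + p.2 ^ 2)) →
            (∀ p : ℝ × ℝ, 0 ≤ (G p).re ∧ (G p).im = 0) →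
            (∫ p : ℝ × ℝ, G p) = 1 →
            ∃ (I : ℕ) (y : Fin I → ℝ × ℝ) (κ : Fin I → ℂ) (g : Fin I → SchwartzMap (ℝ × ℝ) ℂ),
              (∀ (i : Fin I) (p : ℝ × ℝ), g i p = φ ((p.1 - (y i).1) ^ 2 + (p.2 - (y i).2) ^ 2)) ∧
              (∀ i : Fin I, y i ∈ tsupport (a : ℝ × ℝ → ℂ)) ∧
              (∑ i, ‖κ i‖ ≤ (∫ p : ℝ × ℝ, ‖a p‖) + 1) ∧
              (∀ kl ∈ s, SchwartzMap.seminorm ℝ kl.1 kl.2 (a - ∑ i, κ i • g i) < η)) →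
    ∀ (n : ℕ) (F : SchwartzMap (Fin n → E4) ℂ), HasCompactSupport (F : (Fin n → E4) → ℂ) →
      ∀ δ : ℝ, 0 < δ →
        ∃ (A M : ℝ), ∀ (s : Finset (ℕ × ℕ)) (η : ℝ), 0 < η →
          ∃ ρ₀ : ℝ, 0 < ρ₀ ∧ ∀ ρ : ℝ, 0 < ρ → ρ ≤ ρ₀ →
            ∃ (φ : ℝ → ℂ) (I : ℕ) (c : Fin I → Fin n → ℝ × ℝ) (hh : Fin I → Fin n → ℝ × ℝ → ℂ)
              (f0 : Fin I → Fin n → SchwartzMap (Fin 1 → E4) ℂ)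
              (lam : Fin I → ℂ) (T : Fin I → SchwartzMap (Fin n → E4) ℂ),
              (∀ r : ℝ, ρ ^ 2 < r → φ r = 0) ∧
              MeasureTheory.Integrable (fun p : ℝ × ℝ => φ (p.1 ^ 2 + p.2 ^ 2)) ∧
              (∫ p : ℝ × ℝ, ‖φ (p.1 ^ 2 + p.2 ^ 2)‖) ≤ 1 ∧
              (∀ (i : Fin I) (j : Fin n) (x : Fin 1 → E4),
                f0 i j x = φ ((x 0 0) ^ 2 + (x 0 1) ^ 2) * hh i j (x 0 2, x 0 3)) ∧
              (∀ (i : Fin I) (x : Fin n → E4),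
                T i x = ∏ j, φ ((x j 0 - (c i j).1) ^ 2 + (x j 1 - (c i j).2) ^ 2) * hh i j (x j 2, x j 3)) ∧
              (∀ i : Fin I, ∃ x ∈ tsupport (F : (Fin n → E4) → ℂ), ∀ j : Fin n,
                |(c i j).1 - x j 0| ≤ δ ∧ |(c i j).2 - x j 1| ≤ δ) ∧
              (∀ (i : Fin I) (j : Fin n), MeasureTheory.Integrable (hh i j) ∧
                (∫ p : ℝ × ℝ, ‖hh i j p‖) ≤ A ∧ ∀ p : ℝ × ℝ, ‖hh i j p‖ ≤ A) ∧
              (∑ i, ‖lam i‖ ≤ M) ∧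
              (∀ kl ∈ s, SchwartzMap.seminorm ℝ kl.1 kl.2 (F - ∑ i, lam i • T i) < η) :=
  Summit.QuantumFields.YangMills.Theorems.SoftKernelBoostCovariance.Sketch.stub_slotProductExpansionJoint

/-! ## The assembly (T7), v3.5: reshaped into registered pieces (G), (A1), (A3), (Ui), (Uii); (T*) = ⟨Ui, Uii⟩ -/

/-- **Stub (G) — BUMP CHAINS WITH THEIR INSERTION OPERATORS BUILT IN (model-blind; difficulty M–L; PROVABLE once (T3b) lands).**
(T3b) `stub_bumpChain` composed with (T1) `stub_insertionOps` and the sandwich bound: for a radial-bump tensor `T` of degree `n`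
(ONE profile `φ` of radius `ρ` with `∫|φ(|·|²)| ≤ 1`, items `f0 j` centred at the planar origin, transverse profiles `hh j` with
`‖hh j‖₁, ‖hh j‖_∞ ≤ A`, centres `c j`), a reference point `q`, a pull-back `w ≥ 0`, ONE reserve `u` (`= v`; `2ρ ≤ u ≤ 1`) and a
height `R`: if for real `|θ| < ε` the rotated first gap `R_θ(c₀ - q)` has time `≥ g₁` and the consecutive rotated gaps have times
`≥ g₂`, with `w + u + ρ ≤ g₁ e^{-R}` and `3u ≤ g₂ e^{-R}`, then the configuration `τ_{-(R_θ q + w e₀)} R_θ T` is time-ordered and its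
field vectors are the real values of a family holomorphic on the rectangle `{|Re ζ| < ε, |Im ζ| < R}` bounded by
`(max (C·1·(A+A)·(u^{-μ}+u^{-μ})) 0)ⁿ · ‖Ψ_1‖`.  Proof on offer: the items at reserve `u` are `f j := τ_{(u+ρ)e₀} f0 j`
(`exists_item_asm` pattern, as maps on `Fin 1 → E4` via `ContinuousLinearEquiv.funUnique`); their planar profile `g` has `g ≠ 0 ⇒
x₀ ∈ [u, u + 2ρ] ⊆ [u, 2u]` and `∫‖g‖ = ∫‖φ(|·|²)‖ ≤ 1` (translation invariance of the Lebesgue integral on `ℝ × ℝ`), so the sandwich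
bound gives the hypothesis of (T1) with `K = C·1·(A+A)·(u^{-μ}+u^{-μ})`; (T1) gives `B j` with `‖B j‖ ≤ max K 0`; the tube hypotheses
of (T3b) follow from the gap hypotheses by the landed `tube_of_gap` (…AsmGeometryMargins); (T3b) with `p 0 = q`, `p (i+1) = c i`,
`r 0 = w+u+ρ`, `r (i+1) = 3u`; `∏ ‖B j‖ ≤ (max K 0)ⁿ` (`Finset.prod_le_prod`, norms nonnegative). -/
theorem stub_asmBumpChainOps :
    open Literature.MathematicalPhysics.QuantumLattice Literature.MathematicalPhysics.AQFT
      Literature.MathematicalPhysics.QuantumFieldTheory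
      Summit.QuantumFields.YangMills.Theorems.CurvatureBoostCovariance.Negative
      Summit.QuantumFields.YangMills.Theorems.NPointIsotropy.Negative in
    ∀ (S₁ : SchwingerFamily E4) (h : OSReconstructionNoE1 S₁.toLabelled)
      (N : ℂ × ℂ → (h.Hilbert →L[ℂ] h.Hilbert)),
      (∀ p : ℂ × ℂ, |p.2.im| < p.1.re → ‖N p‖ ≤ 1) →
      (∀ ψ ψ' : h.Hilbert, DifferentiableOn ℂ (fun p : ℂ × ℂ => ⟪ψ, N p ψ'⟫_ℂ) {p : ℂ × ℂ | |p.2.im| < p.1.re}) →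
      (∀ (t b : ℝ), 0 < t → ∀ ψ : h.Hilbert,
        N ((t : ℂ), (b : ℂ)) ψ = h.transfer t (h.translate (b • EuclideanSpace.single 1 1) ψ)) →
      ∀ (μ C : ℝ),
        (∀ (u v : ℝ), 0 < u → 0 < v → u ≤ 1 → v ≤ 1 →
           ∀ (f₁ : SchwartzMap (Fin 1 → E4) ℂ) (g hh : ℝ × ℝ → ℂ) (Mg Mh Mh' : ℝ),
             (∀ x : Fin 1 → E4, f₁ x = g (x 0 0, x 0 1) * hh (x 0 2, x 0 3)) →
             (∀ p : ℝ × ℝ, g p ≠ 0 → u ≤ p.1 ∧ p.1 ≤ 2 * u) →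
             MeasureTheory.Integrable g → (∫ p, ‖g p‖) ≤ Mg →
             MeasureTheory.Integrable hh → (∫ p, ‖hh p‖) ≤ Mh → (∀ p, ‖hh p‖ ≤ Mh') →
           ∀ (n : ℕ) (W : SchwartzMap (Fin n → E4) ℂ) (hW : IsTimeOrdered W)
             (hFW : IsTimeOrdered
               (SchwartzMap.appendTensor f₁ (translateMulti ((2 * u + v) • EuclideanSpace.single 0 1) W))),
             ‖h.fieldVec (1 + n) (fun _ => ())
                 (SchwartzMap.appendTensor f₁ (translateMulti ((2 * u + v) • EuclideanSpace.single 0 1) W)) hFW‖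
               ≤ C * Mg * (Mh + Mh') * (u ^ (-μ) + v ^ (-μ)) * ‖h.fieldVec n (fun _ => ()) W hW‖) →
      ∀ (n : ℕ) (u ρ w ε R g₁ g₂ A : ℝ) (φ : ℝ → ℂ) (hh : Fin n → ℝ × ℝ → ℂ)
        (f0 : Fin n → SchwartzMap (Fin 1 → E4) ℂ) (c : Fin n → ℝ × ℝ) (q : ℝ × ℝ) (T : SchwartzMap (Fin n → E4) ℂ),
        0 < ρ → 2 * ρ ≤ u → u ≤ 1 → 0 ≤ w → 0 < ε → 0 < R → 0 < g₁ → 0 < g₂ →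
        w + u + ρ ≤ g₁ * Real.exp (-R) → 3 * u ≤ g₂ * Real.exp (-R) →
        (∀ s : ℝ, ρ ^ 2 < s → φ s = 0) →
        MeasureTheory.Integrable (fun p : ℝ × ℝ => φ (p.1 ^ 2 + p.2 ^ 2)) →
        (∫ p : ℝ × ℝ, ‖φ (p.1 ^ 2 + p.2 ^ 2)‖) ≤ 1 →
        (∀ (j : Fin n) (x : Fin 1 → E4), f0 j x = φ ((x 0 0) ^ 2 + (x 0 1) ^ 2) * hh j (x 0 2, x 0 3)) →
        (∀ x : Fin n → E4, T x = ∏ j, φ ((x j 0 - (c j).1) ^ 2 + (x j 1 - (c j).2) ^ 2) * hh j (x j 2, x j 3)) →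
        (∀ j : Fin n, MeasureTheory.Integrable (hh j) ∧ (∫ p : ℝ × ℝ, ‖hh j p‖) ≤ A ∧ ∀ p : ℝ × ℝ, ‖hh j p‖ ≤ A) →
        (∀ θ : ℝ, |θ| < ε →
          (∀ j : Fin n, (j : ℕ) = 0 →
            g₁ ≤ Real.cos θ * ((c j).1 - q.1) + Real.sin θ * ((c j).2 - q.2)) ∧
          (∀ i j : Fin n, (j : ℕ) = i + 1 →
            g₂ ≤ Real.cos θ * ((c j).1 - (c i).1) + Real.sin θ * ((c j).2 - (c i).2))) →
        (∀ θ : ℝ, |θ| < ε → IsTimeOrdered (translateMulti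
              (-((Real.cos θ * q.1 + Real.sin θ * q.2 + w) • EuclideanSpace.single 0 1 +
                (-Real.sin θ * q.1 + Real.cos θ * q.2) • EuclideanSpace.single 1 1))
              (linActMulti (planeRot (0 : Fin 3) θ) T))) ∧
        ∃ V : ℂ → h.Hilbert,
          DifferentiableOn ℂ V {ζ : ℂ | |ζ.re| < ε ∧ |ζ.im| < R} ∧
          (∀ ζ : ℂ, |ζ.re| < ε → |ζ.im| < R →
            ‖V ζ‖ ≤ (max (C * 1 * (A + A) * (u ^ (-μ) + u ^ (-μ))) 0) ^ n *
              ‖h.fieldVec 0 (fun _ => ()) (SchwartzMap.constOfSubsingleton 1)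
                OSReconstructionNoE1.isTimeOrdered_constOfSubsingleton‖) ∧
          (∀ θ : ℝ, |θ| < ε → ∀ hθ : IsTimeOrdered (translateMulti
                  (-((Real.cos θ * q.1 + Real.sin θ * q.2 + w) • EuclideanSpace.single 0 1 +
                    (-Real.sin θ * q.1 + Real.cos θ * q.2) • EuclideanSpace.single 1 1))
                  (linActMulti (planeRot (0 : Fin 3) θ) T)),
            V θ = h.fieldVec n (fun _ => ()) (translateMulti
                  (-((Real.cos θ * q.1 + Real.sin θ * q.2 + w) • EuclideanSpace.single 0 1 +
                    (-Real.sin θ * q.1 + Real.cos θ * q.2) • EuclideanSpace.single 1 1))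
                  (linActMulti (planeRot (0 : Fin 3) θ) T)) hθ) :=
  Summit.QuantumFields.YangMills.Theorems.SoftKernelBoostCovariance.Sketch.stub_asmBumpChainOps

/-- **Stub (A1) — HEIGHTS + VITALI (pure functional analysis; difficulty S–M; the lead's).**  Families `V k m` holomorphic on the
rectangles of heights `m ≤ k`, all with the real values `g k` and bounded by `K e^{N m}` on their rectangle, whose real values
converge pointwise to `g'`: there is `W` holomorphic on the strip, of type `N` (`‖W ζ‖ ≤ K e^{N} e^{N |Im ζ|}`), with real values `g'`.
Proof: on the rectangle of height `k`, `V k k = V k m` for `m = ⌊|Im ζ|⌋ + 1 ≤ k` (identity theorem `eqOn_rect_of_eq_real`, landed),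
so `‖V k k ζ‖ ≤ K e^{N(|Im ζ| + 1)}`; then (T6) `stub_hilbertVitali` (landed). -/
theorem stub_asmHeightsVitali :
    ∀ (H : Type) [NormedAddCommGroup H] [InnerProductSpace ℂ H] [CompleteSpace H] (ε K N : ℝ), 0 < ε → 0 ≤ K → 0 ≤ N →
      ∀ (V : ℕ → ℕ → ℂ → H) (g : ℕ → ℝ → H) (g' : ℝ → H),
        (∀ k m : ℕ, m ≤ k → DifferentiableOn ℂ (V k m) {ζ : ℂ | |ζ.re| < ε ∧ |ζ.im| < (m : ℝ)}) →
        (∀ k m : ℕ, m ≤ k → ∀ ζ : ℂ, |ζ.re| < ε → |ζ.im| < (m : ℝ) → ‖V k m ζ‖ ≤ K * Real.exp (N * m)) →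
        (∀ k m : ℕ, m ≤ k → ∀ θ : ℝ, |θ| < ε → V k m θ = g k θ) →
        (∀ θ : ℝ, |θ| < ε → Filter.Tendsto (fun k => g k θ) Filter.atTop (nhds (g' θ))) →
        ∃ W : ℂ → H, DifferentiableOn ℂ W {ζ : ℂ | |ζ.re| < ε} ∧
          (∀ ζ : ℂ, |ζ.re| < ε → ‖W ζ‖ ≤ K * Real.exp N * Real.exp (N * |ζ.im|)) ∧
          ∀ θ : ℝ, |θ| < ε → W θ = g' θ :=
  Summit.QuantumFields.YangMills.Theorems.SoftKernelBoostCovariance.Sketch.stub_asmHeightsVitali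

/-- **Stub (A3) — THE CHAIN OF A TERM WITH A FREE LOWER BLOCK (model-blind; difficulty L; PROVABLE once (G) lands; uses the landed
(T3a) `stub_bumpChainLink` and (T5) `stub_lowerBlock`).**  For a radial-bump tensor `T` of degree `m + 1` whose rotated centres have
times `≥ δ` and consecutive gaps `≥ δ/2` for `|θ| < ε`, radius `ρ ≤ δ/32`, reserve `u` with `2ρ ≤ u`, `u e^{R} ≤ δ/16`, and a family
`S₁` that is translation invariant and PLANAR INVARIANT IN THE DOUBLED TAIL DEGREE `m + m` on `⁰𝒮`: the field vectors `Ψ_{R_θ T}` are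
the real values of a family holomorphic on the rectangle of height `R` bounded by ONE height-dependent sandwich constant times the
FIXED-reserve chain constant of the tail: `max(C·1·(A+A)·(u^{-μ}+u^{-μ})) 0 · (max(C·1·(A+A)·((δ/16)^{-μ}+(δ/16)^{-μ})) 0)^m · ‖Ψ_1‖`.
Proof on offer: tail `Y` = the bump tensor of the items `1, …, m` (`exists_bumpTensor_asm` with centres `c ∘ Fin.succ`); (G) for `Y`
three times — (a) height `R`, `q = c 0`, `w = u + u - ρ`, reserve `u` (a family `V'`, some bound `M`); (b) height `1/4`, `q = c 0`,
`w = δ/8`, reserve `δ/16`, read at the real points: `‖Ψ_{τ_{-(R_θ c₀ + (δ/8)e₀)} R_θ Y}‖ ≤ (fixed constant)^m ‖Ψ_1‖`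
(`three_quarters_le_exp_neg_quarter`: `7δ/32, 6δ/32 ≤ (δ/2)e^{-1/4}`); (c) height `1/4`, `w = 2·(δ/8)`, reserve `δ/16`, first
conclusion only (time-ordering of the advanced tail, `11δ/32 ≤ (δ/2)e^{-1/4}`); then (T5) with `g = δ/8` (`(u+u-ρ)e^{R} ≤ δ/8`) bounds
`‖V' ζ‖` by (b) at `θ = Re ζ`; the item at reserve `u` and its insertion operator `B₀` as in (G)'s proof (T1 + sandwich,
`‖B₀‖ ≤ max K_u 0`); (T3a) with `q = 0`, `w = 0`, `M :=` the bound from (T5), first gap `≥ δ` with `u + ρ ≤ δ e^{-R}`; real values: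
the `G` of (T3a) is `R_θ T` (`rot_bump_apply`, `Fin.prod_univ_succ`, `cfg_zero_eq`). -/
theorem stub_asmTermChainFree :
    open Literature.MathematicalPhysics.QuantumLattice Literature.MathematicalPhysics.AQFT
      Literature.MathematicalPhysics.QuantumFieldTheory
      Summit.QuantumFields.YangMills.Theorems.CurvatureBoostCovariance.Negative
      Summit.QuantumFields.YangMills.Theorems.NPointIsotropy.Negative in
    ∀ (S₁ : SchwingerFamily E4) (h : OSReconstructionNoE1 S₁.toLabelled)
      (N : ℂ × ℂ → (h.Hilbert →L[ℂ] h.Hilbert)),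
      (∀ p : ℂ × ℂ, |p.2.im| < p.1.re → ‖N p‖ ≤ 1) →
      (∀ ψ ψ' : h.Hilbert, DifferentiableOn ℂ (fun p : ℂ × ℂ => ⟪ψ, N p ψ'⟫_ℂ) {p : ℂ × ℂ | |p.2.im| < p.1.re}) →
      (∀ (t b : ℝ), 0 < t → ∀ ψ : h.Hilbert,
        N ((t : ℂ), (b : ℂ)) ψ = h.transfer t (h.translate (b • EuclideanSpace.single 1 1) ψ)) →
      Translations S₁ →
      ∀ (μ C : ℝ),
        (∀ (u v : ℝ), 0 < u → 0 < v → u ≤ 1 → v ≤ 1 →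
           ∀ (f₁ : SchwartzMap (Fin 1 → E4) ℂ) (g hh : ℝ × ℝ → ℂ) (Mg Mh Mh' : ℝ),
             (∀ x : Fin 1 → E4, f₁ x = g (x 0 0, x 0 1) * hh (x 0 2, x 0 3)) →
             (∀ p : ℝ × ℝ, g p ≠ 0 → u ≤ p.1 ∧ p.1 ≤ 2 * u) →
             MeasureTheory.Integrable g → (∫ p, ‖g p‖) ≤ Mg →
             MeasureTheory.Integrable hh → (∫ p, ‖hh p‖) ≤ Mh → (∀ p, ‖hh p‖ ≤ Mh') →
           ∀ (n : ℕ) (W : SchwartzMap (Fin n → E4) ℂ) (hW : IsTimeOrdered W)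
             (hFW : IsTimeOrdered
               (SchwartzMap.appendTensor f₁ (translateMulti ((2 * u + v) • EuclideanSpace.single 0 1) W))),
             ‖h.fieldVec (1 + n) (fun _ => ())
                 (SchwartzMap.appendTensor f₁ (translateMulti ((2 * u + v) • EuclideanSpace.single 0 1) W)) hFW‖
               ≤ C * Mg * (Mh + Mh') * (u ^ (-μ) + v ^ (-μ)) * ‖h.fieldVec n (fun _ => ()) W hW‖) →
      ∀ (m : ℕ) (δ ε ρ u R A : ℝ) (φ : ℝ → ℂ) (hh : Fin (m + 1) → ℝ × ℝ → ℂ)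
        (f0 : Fin (m + 1) → SchwartzMap (Fin 1 → E4) ℂ) (c : Fin (m + 1) → ℝ × ℝ) (T : SchwartzMap (Fin (m + 1) → E4) ℂ),
        0 < δ → δ ≤ 1 → 0 < ε → 0 < ρ → ρ ≤ δ / 32 → 0 < R → 2 * ρ ≤ u → u * Real.exp R ≤ δ / 16 →
        (∀ (θ : ℝ) (F : SchwartzMap (Fin (m + m) → E4) ℂ), IsOffDiagonal F →
          S₁ (m + m) (linActMulti (planeRot (0 : Fin 3) θ) F) = S₁ (m + m) F) →
        (∀ s : ℝ, ρ ^ 2 < s → φ s = 0) →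
        MeasureTheory.Integrable (fun p : ℝ × ℝ => φ (p.1 ^ 2 + p.2 ^ 2)) →
        (∫ p : ℝ × ℝ, ‖φ (p.1 ^ 2 + p.2 ^ 2)‖) ≤ 1 →
        (∀ (j : Fin (m + 1)) (x : Fin 1 → E4), f0 j x = φ ((x 0 0) ^ 2 + (x 0 1) ^ 2) * hh j (x 0 2, x 0 3)) →
        (∀ x : Fin (m + 1) → E4, T x = ∏ j, φ ((x j 0 - (c j).1) ^ 2 + (x j 1 - (c j).2) ^ 2) * hh j (x j 2, x j 3)) →
        (∀ j : Fin (m + 1), MeasureTheory.Integrable (hh j) ∧ (∫ p : ℝ × ℝ, ‖hh j p‖) ≤ A ∧ ∀ p : ℝ × ℝ, ‖hh j p‖ ≤ A) →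
        (∀ θ : ℝ, |θ| < ε →
          (∀ j : Fin (m + 1), δ ≤ Real.cos θ * (c j).1 + Real.sin θ * (c j).2) ∧
          (∀ i j : Fin (m + 1), i < j → δ / 2 ≤ (Real.cos θ * (c j).1 + Real.sin θ * (c j).2) -
            (Real.cos θ * (c i).1 + Real.sin θ * (c i).2))) →
        (∀ θ : ℝ, |θ| < ε → IsTimeOrdered (linActMulti (planeRot (0 : Fin 3) θ) T)) ∧
        ∃ V : ℂ → h.Hilbert,
          DifferentiableOn ℂ V {ζ : ℂ | |ζ.re| < ε ∧ |ζ.im| < R} ∧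
          (∀ ζ : ℂ, |ζ.re| < ε → |ζ.im| < R →
            ‖V ζ‖ ≤ max (C * 1 * (A + A) * (u ^ (-μ) + u ^ (-μ))) 0 *
              (max (C * 1 * (A + A) * ((δ / 16) ^ (-μ) + (δ / 16) ^ (-μ))) 0) ^ m *
              ‖h.fieldVec 0 (fun _ => ()) (SchwartzMap.constOfSubsingleton 1)
                OSReconstructionNoE1.isTimeOrdered_constOfSubsingleton‖) ∧
          (∀ θ : ℝ, |θ| < ε → ∀ hθ : IsTimeOrdered (linActMulti (planeRot (0 : Fin 3) θ) T),
            V θ = h.fieldVec (m + 1) (fun _ => ()) (linActMulti (planeRot (0 : Fin 3) θ) T) hθ) :=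
  Summit.QuantumFields.YangMills.Theorems.SoftKernelBoostCovariance.Sketch.stub_asmTermChainFree

/-- **Stub (Ui) — UNIFORM PLANAR BOOST VECTORS IN EVERY DEGREE (the lead's assembly, part (i); difficulty L).**  Conclusion (i) of
(T*) under (T*)'s hypotheses.  Proof: margins `δ, L` of `F` (`geom_margins`), `ε = δ/(4L)` (`isTimeOrdered_rot_of_margins`);
(T4a-joint) with this `δ` gives `A, M` and approximants `F_k = Σᵢ λ_{k,i} T_{k,i}` (`ρ_k ≤ e^{-k}δ/32`, seminorm errors `< 1/(k+1)`,
`tendsto_schwartz_of_seminorm`, `tendsto_fieldVec`); each term's rotated centres obey `centres_rot`; (G) with `q = 0`, `w = 0`,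
`u = e^{-m}δ/16`, `g₁ = δ`, `g₂ = δ/2` at every height `m ≤ k` (`cfg_zero_eq`); superposition (`fieldVec_finset_sum`,
`isTimeOrdered_finset_sum`; bound `M·(max K_{u_m} 0)ⁿ‖Ψ_1‖ ≤ M·(4|C||A|(δ/16)^{-μ}e^{|μ|})ⁿ‖Ψ_1‖·e^{n|μ|m}`, `sandwichConst_pow_le`);
(A1) with `N = n|μ|`. -/
theorem stub_asmUniformBoost :
    open Literature.MathematicalPhysics.QuantumLattice Literature.MathematicalPhysics.AQFT
      Literature.MathematicalPhysics.QuantumFieldTheory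
      Summit.QuantumFields.YangMills.Theorems.CurvatureBoostCovariance.Negative
      Summit.QuantumFields.YangMills.Theorems.NPointIsotropy.Negative in
    ∀ (S₁ : SchwingerFamily E4) (h : OSReconstructionNoE1 S₁.toLabelled),
      S₁.toLabelled.HasLinearGrowth → S₁.toLabelled.IsSymmetric → Translations S₁ → EightFrameRP S₁ → PlanarCone S₁ →
      (∃ N : ℂ × ℂ → (h.Hilbert →L[ℂ] h.Hilbert),
          (∀ p : ℂ × ℂ, |p.2.im| < p.1.re → ‖N p‖ ≤ 1) ∧
          (∀ ψ ψ' : h.Hilbert, DifferentiableOn ℂ (fun p : ℂ × ℂ => ⟪ψ, N p ψ'⟫_ℂ) {p : ℂ × ℂ | |p.2.im| < p.1.re}) ∧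
          (∀ (t b : ℝ), 0 < t → ∀ ψ : h.Hilbert,
            N ((t : ℂ), (b : ℂ)) ψ = h.transfer t (h.translate (b • EuclideanSpace.single 1 1) ψ))) →
      ∀ (μ C : ℝ),
        (∀ (u v : ℝ), 0 < u → 0 < v → u ≤ 1 → v ≤ 1 →
           ∀ (f₁ : SchwartzMap (Fin 1 → E4) ℂ) (g hh : ℝ × ℝ → ℂ) (Mg Mh Mh' : ℝ),
             (∀ x : Fin 1 → E4, f₁ x = g (x 0 0, x 0 1) * hh (x 0 2, x 0 3)) →
             (∀ p : ℝ × ℝ, g p ≠ 0 → u ≤ p.1 ∧ p.1 ≤ 2 * u) →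
             MeasureTheory.Integrable g → (∫ p, ‖g p‖) ≤ Mg →
             MeasureTheory.Integrable hh → (∫ p, ‖hh p‖) ≤ Mh → (∀ p, ‖hh p‖ ≤ Mh') →
           ∀ (n : ℕ) (W : SchwartzMap (Fin n → E4) ℂ) (hW : IsTimeOrdered W)
             (hFW : IsTimeOrdered
               (SchwartzMap.appendTensor f₁ (translateMulti ((2 * u + v) • EuclideanSpace.single 0 1) W))),
             ‖h.fieldVec (1 + n) (fun _ => ())
                 (SchwartzMap.appendTensor f₁ (translateMulti ((2 * u + v) • EuclideanSpace.single 0 1) W)) hFW‖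
               ≤ C * Mg * (Mh + Mh') * (u ^ (-μ) + v ^ (-μ)) * ‖h.fieldVec n (fun _ => ()) W hW‖) →
        (∀ (n : ℕ), ∃ N : ℝ, ∀ (F : SchwartzMap (Fin n → E4) ℂ), IsTimeOrdered F →
          HasCompactSupport (F : (Fin n → E4) → ℂ) →
          ∃ ε : ℝ, 0 < ε ∧ ∃ (V : ℂ → h.Hilbert) (C : ℝ),
            DifferentiableOn ℂ V {θ : ℂ | |θ.re| < ε} ∧
            (∀ θ : ℂ, |θ.re| < ε → ‖V θ‖ ≤ C * Real.exp (N * |θ.im|)) ∧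
            ∀ θ : ℝ, |θ| < ε → ∀ hθ : IsTimeOrdered (linActMulti (planeRot (0 : Fin 3) θ) F),
              V θ = h.fieldVec n (fun _ => ()) (linActMulti (planeRot (0 : Fin 3) θ) F) hθ) :=
  Summit.QuantumFields.YangMills.Theorems.SoftKernelBoostCovariance.Sketch.stub_asmUniformBoost

/-- **Stub (Uii) — SUB-THRESHOLD TYPE FROM LOWER-LEVEL PLANAR INVARIANCE (the lead's assembly, part (ii); difficulty L).**
Conclusion (ii) of (T*) under (T*)'s hypotheses AND `0 ≤ μ` (v3.5 reshape: the chain construction pays ONE insertion `≍ u_m^{-μ}`,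
which is of type `μ` only for `μ ≥ 0`; for `μ < 0` it is of type `0`, and the composition runs (T*) with `max μ 0 < 4`, the sandwich
bound being monotone in the exponent for reserves `≤ 1` — `sandwich_mono_exponent`).  Proof: as (Ui) at level `a = m + 1 ≥ 1`, with
(A3) in place of (G) for every term (planar invariance in degree `m + m ≤ 2a - 2` is the level hypothesis, `planeRot 0 θ` having
determinant one and fixing `e₂, e₃`: landed `RayPositivity`/`LowerBlock` patterns); per-height bound
`M · max K_{u_m} 0 · K_{δ/16}^m ‖Ψ_1‖ ≤ const · e^{μ m}` (`sandwichConst_le_type`); (A1) with `N = μ`. -/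
theorem stub_asmTypedBoost :
    open Literature.MathematicalPhysics.QuantumLattice Literature.MathematicalPhysics.AQFT
      Literature.MathematicalPhysics.QuantumFieldTheory
      Summit.QuantumFields.YangMills.Theorems.CurvatureBoostCovariance.Negative
      Summit.QuantumFields.YangMills.Theorems.NPointIsotropy.Negative in
    ∀ (S₁ : SchwingerFamily E4) (h : OSReconstructionNoE1 S₁.toLabelled),
      S₁.toLabelled.HasLinearGrowth → S₁.toLabelled.IsSymmetric → Translations S₁ → EightFrameRP S₁ → PlanarCone S₁ →
      (∃ N : ℂ × ℂ → (h.Hilbert →L[ℂ] h.Hilbert),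
          (∀ p : ℂ × ℂ, |p.2.im| < p.1.re → ‖N p‖ ≤ 1) ∧
          (∀ ψ ψ' : h.Hilbert, DifferentiableOn ℂ (fun p : ℂ × ℂ => ⟪ψ, N p ψ'⟫_ℂ) {p : ℂ × ℂ | |p.2.im| < p.1.re}) ∧
          (∀ (t b : ℝ), 0 < t → ∀ ψ : h.Hilbert,
            N ((t : ℂ), (b : ℂ)) ψ = h.transfer t (h.translate (b • EuclideanSpace.single 1 1) ψ))) →
      ∀ (μ C : ℝ),
        (∀ (u v : ℝ), 0 < u → 0 < v → u ≤ 1 → v ≤ 1 →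
           ∀ (f₁ : SchwartzMap (Fin 1 → E4) ℂ) (g hh : ℝ × ℝ → ℂ) (Mg Mh Mh' : ℝ),
             (∀ x : Fin 1 → E4, f₁ x = g (x 0 0, x 0 1) * hh (x 0 2, x 0 3)) →
             (∀ p : ℝ × ℝ, g p ≠ 0 → u ≤ p.1 ∧ p.1 ≤ 2 * u) →
             MeasureTheory.Integrable g → (∫ p, ‖g p‖) ≤ Mg →
             MeasureTheory.Integrable hh → (∫ p, ‖hh p‖) ≤ Mh → (∀ p, ‖hh p‖ ≤ Mh') →
           ∀ (n : ℕ) (W : SchwartzMap (Fin n → E4) ℂ) (hW : IsTimeOrdered W)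
             (hFW : IsTimeOrdered
               (SchwartzMap.appendTensor f₁ (translateMulti ((2 * u + v) • EuclideanSpace.single 0 1) W))),
             ‖h.fieldVec (1 + n) (fun _ => ())
                 (SchwartzMap.appendTensor f₁ (translateMulti ((2 * u + v) • EuclideanSpace.single 0 1) W)) hFW‖
               ≤ C * Mg * (Mh + Mh') * (u ^ (-μ) + v ^ (-μ)) * ‖h.fieldVec n (fun _ => ()) W hW‖) →
        0 ≤ μ →
        (∀ a : ℕ, 1 ≤ a →
          (∀ N : ℕ, N + 2 ≤ 2 * a → ∀ R : E4 ≃ₗᵢ[ℝ] E4,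
            LinearMap.det (R.toLinearEquiv : E4 →ₗ[ℝ] E4) = 1 →
            R (EuclideanSpace.single 2 1) = EuclideanSpace.single 2 1 →
            R (EuclideanSpace.single 3 1) = EuclideanSpace.single 3 1 →
            ∀ F : SchwartzMap (Fin N → E4) ℂ, IsOffDiagonal F → S₁ N (linActMulti R F) = S₁ N F) →
          ∀ (F : SchwartzMap (Fin a → E4) ℂ), IsTimeOrdered F → HasCompactSupport (F : (Fin a → E4) → ℂ) →
            ∃ ε : ℝ, 0 < ε ∧ ∃ (V : ℂ → h.Hilbert) (C' : ℝ),
              DifferentiableOn ℂ V {θ : ℂ | |θ.re| < ε} ∧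
              (∀ θ : ℂ, |θ.re| < ε → ‖V θ‖ ≤ C' * Real.exp (μ * |θ.im|)) ∧
              ∀ θ : ℝ, |θ| < ε → ∀ hθ : IsTimeOrdered (linActMulti (planeRot (0 : Fin 3) θ) F),
                V θ = h.fieldVec a (fun _ => ()) (linActMulti (planeRot (0 : Fin 3) θ) F) hθ) :=
  Summit.QuantumFields.YangMills.Theorems.SoftKernelBoostCovariance.Sketch.stub_asmTypedBoost

/-- **Stub (T*) — BOOST VECTORS FROM THE CHAIN (model-blind analysis; the LEAD's assembly — v3: every analytic
ingredient is now a registered stub taken as a hypothesis, in this order: (T3) link + chain, (T5) lower block, (T4a) bump-tensor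
approximation, (T4b) radial Riemann approximation, (T1) insertion operators [LANDED p107219], (T6) Hilbert Vitali [LANDED p107687];
Osterwalder–Schrader / Glimm–Jaffe §19.5–19.7 technology; twin of the Ising programme's `stub_boostEntireOfType`).**  For a
one-species family with E0', E3, translations, the eight frames and the planar cone, an `e₀`-reconstruction `h` with an operator
cone family `N` (Stub (N), landed), and a sandwich bound with exponent `μ` and constant `C` (inlined `PlanarSandwichBound`):
(i) UNIFORM PLANAR BOOST VECTORS in every degree `n`: a type `N = N(n)` and, for every compactly supported `e₀`-time-ordered `F`
of degree `n`, `ε > 0`, `C'`, `V : ℂ → ℋ` holomorphic on `{|Re θ| < ε}` with `‖V θ‖ ≤ C' e^{N|Im θ|}` and `V θ = Ψ_{R_θ F}` for real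
`|θ| < ε`; (ii) SUB-THRESHOLD TYPE FROM LOWER-LEVEL PLANAR INVARIANCE: at a level `a ≥ 1` at which `S₁` is planar-invariant on
`⁰𝒮` in all degrees `≤ 2a - 2`, the same with type `μ` for every degree-`a` `F`.
ASSEMBLY (the lead's proof plan).  Geometry: `tsupport F` is compact in the open chamber, so times and consecutive time gaps are
`≥ 4δ` and planar coordinates `≤ L` on it; with `ε ≤ δ/(4(L+δ))` every planar point within `δ` of the support keeps rotated times
`≥ 2δ` and rotated gaps `≥ δ` for `|θ| < ε`.  Approximants: (T4a) with this `δ` gives `A, M` and, for `k = 1, 2, …`, bump-tensor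
sums `F_k = Σᵢ λ_{k,i} T_{k,i}` of radius `ρ_k ≤ e^{-k}δ/16` with `Σ_{(p,q) ≤ k} ‖F - F_k‖_{p,q} < 1/k`, so `F_k → F` in `𝓢` and
`Ψ_{R_θ F_k} → Ψ_{R_θ F}` (`Density.tendsto_fieldVec`, `fieldVec_add/smul`).  Chains: at height `|Im ζ| < R` use reserves
`u = v = e^{-R}δ/8` (so `2ρ_k ≤ u`, `2u + v < e^{-R}δ`, `u + ρ < e^{-R}·2δ`), insertion operators from (T1) with
`K = |C|·1·2A·2u^{-μ}` (the sandwich bound on the item `f = τ_{(u+ρ)e₀} f0`: `g ≠ 0 ⇒ x₀ ∈ [u, u+2ρ] ⊆ [u, 2u]`), and (T3)(B) with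
`q = 0, w = 0`: `V^{(R)}_{k,i}` holomorphic on the rectangle, `‖V‖ ≤ (|C|·4A·u^{-μ})ⁿ‖Ψ_1‖`, real values `Ψ_{R_θ T_{k,i}}`.  Define
`V_k := Σᵢ λ_{k,i} V^{(k)}_{k,i}` on `{|Im ζ| < k}`; at a point of height `χ` compare with `V^{(|χ|+1)}` (identity theorem on the smaller
rectangle, both equal `Ψ_{R_θ F_k}` on the real segment): `‖V_k ζ‖ ≤ M (|C|·4A·(8e/δ)^{μ⁺})ⁿ ‖Ψ_1‖ · e^{nμ⁺(|Im ζ|)}` — uniform in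
`k`.  Vitali (T6) gives (i) with `N = n·μ⁺`.  For (ii): by (T3)(A) `V^{(R)}_{k,i}(ζ) = N(gap₀(ζ)) B_{i,0} V'_{k,i}(ζ)` with `V'` the
(T3)(B)-chain of the tail seen from `(c_{i,0}, u+v-ρ)`; planar invariance in degree `2a - 2` (rotations have determinant one and
fix `e₂, e₃`) and (T5) with `g = δ/4` (`w e^R = (2u - ρ)e^R ≤ δ/4`) give `‖V'_{k,i}(ζ)‖ ≤ ‖Ψ_{Ỹ}‖ ≤` (real chain bound of (T3)(B) with
FIXED reserves `δ/16`) — so only the first insertion is paid: `‖V_k ζ‖ ≤ M'·u(ζ)^{-μ} ≍ e^{μ|Im ζ|}` (also for `μ < 0`), and (T6)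
gives type `μ`.  Consistent with every certified inhabitant (`V` constant) and with junk (`V ≡ 0` in positive degree). -/
theorem stub_chainBoostVectors :
    open Literature.MathematicalPhysics.QuantumLattice Literature.MathematicalPhysics.AQFT
      Literature.MathematicalPhysics.QuantumFieldTheory
      Summit.QuantumFields.YangMills.Theorems.CurvatureBoostCovariance.Negative
      Summit.QuantumFields.YangMills.Theorems.NPointIsotropy.Negative in
    ∀ (S₁ : SchwingerFamily E4) (h : OSReconstructionNoE1 S₁.toLabelled),
      S₁.toLabelled.HasLinearGrowth → S₁.toLabelled.IsSymmetric → Translations S₁ → EightFrameRP S₁ → PlanarCone S₁ →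
      (∃ N : ℂ × ℂ → (h.Hilbert →L[ℂ] h.Hilbert),
          (∀ p : ℂ × ℂ, |p.2.im| < p.1.re → ‖N p‖ ≤ 1) ∧
          (∀ ψ ψ' : h.Hilbert, DifferentiableOn ℂ (fun p : ℂ × ℂ => ⟪ψ, N p ψ'⟫_ℂ) {p : ℂ × ℂ | |p.2.im| < p.1.re}) ∧
          (∀ (t b : ℝ), 0 < t → ∀ ψ : h.Hilbert,
            N ((t : ℂ), (b : ℂ)) ψ = h.transfer t (h.translate (b • EuclideanSpace.single 1 1) ψ))) →
      ∀ (μ C : ℝ),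
        (∀ (u v : ℝ), 0 < u → 0 < v → u ≤ 1 → v ≤ 1 →
           ∀ (f₁ : SchwartzMap (Fin 1 → E4) ℂ) (g hh : ℝ × ℝ → ℂ) (Mg Mh Mh' : ℝ),
             (∀ x : Fin 1 → E4, f₁ x = g (x 0 0, x 0 1) * hh (x 0 2, x 0 3)) →
             (∀ p : ℝ × ℝ, g p ≠ 0 → u ≤ p.1 ∧ p.1 ≤ 2 * u) →
             MeasureTheory.Integrable g → (∫ p, ‖g p‖) ≤ Mg →
             MeasureTheory.Integrable hh → (∫ p, ‖hh p‖) ≤ Mh → (∀ p, ‖hh p‖ ≤ Mh') →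
           ∀ (n : ℕ) (W : SchwartzMap (Fin n → E4) ℂ) (hW : IsTimeOrdered W)
             (hFW : IsTimeOrdered
               (SchwartzMap.appendTensor f₁ (translateMulti ((2 * u + v) • EuclideanSpace.single 0 1) W))),
             ‖h.fieldVec (1 + n) (fun _ => ())
                 (SchwartzMap.appendTensor f₁ (translateMulti ((2 * u + v) • EuclideanSpace.single 0 1) W)) hFW‖
               ≤ C * Mg * (Mh + Mh') * (u ^ (-μ) + v ^ (-μ)) * ‖h.fieldVec n (fun _ => ()) W hW‖) →
        0 ≤ μ →
        (∀ (n : ℕ), ∃ N : ℝ, ∀ (F : SchwartzMap (Fin n → E4) ℂ), IsTimeOrdered F →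
          HasCompactSupport (F : (Fin n → E4) → ℂ) →
          ∃ ε : ℝ, 0 < ε ∧ ∃ (V : ℂ → h.Hilbert) (C : ℝ),
            DifferentiableOn ℂ V {θ : ℂ | |θ.re| < ε} ∧
            (∀ θ : ℂ, |θ.re| < ε → ‖V θ‖ ≤ C * Real.exp (N * |θ.im|)) ∧
            ∀ θ : ℝ, |θ| < ε → ∀ hθ : IsTimeOrdered (linActMulti (planeRot (0 : Fin 3) θ) F),
              V θ = h.fieldVec n (fun _ => ()) (linActMulti (planeRot (0 : Fin 3) θ) F) hθ) ∧
        (∀ a : ℕ, 1 ≤ a →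
          (∀ N : ℕ, N + 2 ≤ 2 * a → ∀ R : E4 ≃ₗᵢ[ℝ] E4,
            LinearMap.det (R.toLinearEquiv : E4 →ₗ[ℝ] E4) = 1 →
            R (EuclideanSpace.single 2 1) = EuclideanSpace.single 2 1 →
            R (EuclideanSpace.single 3 1) = EuclideanSpace.single 3 1 →
            ∀ F : SchwartzMap (Fin N → E4) ℂ, IsOffDiagonal F → S₁ N (linActMulti R F) = S₁ N F) →
          ∀ (F : SchwartzMap (Fin a → E4) ℂ), IsTimeOrdered F → HasCompactSupport (F : (Fin a → E4) → ℂ) →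
            ∃ ε : ℝ, 0 < ε ∧ ∃ (V : ℂ → h.Hilbert) (C' : ℝ),
              DifferentiableOn ℂ V {θ : ℂ | |θ.re| < ε} ∧
              (∀ θ : ℂ, |θ.re| < ε → ‖V θ‖ ≤ C' * Real.exp (μ * |θ.im|)) ∧
              ∀ θ : ℝ, |θ| < ε → ∀ hθ : IsTimeOrdered (linActMulti (planeRot (0 : Fin 3) θ) F),
                V θ = h.fieldVec a (fun _ => ()) (linActMulti (planeRot (0 : Fin 3) θ) F) hθ) :=
  fun S₁ h hlg hsym htr h8 hC hN μ C hS hμ =>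
    ⟨stub_asmUniformBoost S₁ h hlg hsym htr h8 hC hN μ C hS, stub_asmTypedBoost S₁ h hlg hsym htr h8 hC hN μ C hS hμ⟩


/-! ## The landed Stubs 3 and 4 of the parent, re-assembled over LOCAL boost vectors (provable now) -/

/-- **Stub (3ℓ) — DOUBLED ORBIT FUNCTIONS ARE TRIGONOMETRIC POLYNOMIALS, from boost vectors of `S₁` ITSELF (difficulty S;
LANDED p102333 by the wave-2 worker).**  Verbatim the landed `stub_orbitBandlimit` (Theorems/MirrorModularBoostsCurvatureBoostCovarianceOrbitBandlimit)
with its universal first hypothesis (Stub 4a for ALL families) replaced by uniform planar boost vectors for the `e₀`-reconstructions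
of the given `S₁` only — which is all `OrbitBandlimitFinal.trigPoly_offDiagonal` uses (`h₁ S₁ h hlg hsym h8 hC`, line 193; the
`e₁`-frame enters through `Hypercubic`).  Proof: that theorem's 12-line body with `hloc h` in place of `h₁ S₁ h …`. -/
theorem stub_orbitBandlimitLocal :
    open Literature.MathematicalPhysics.QuantumLattice Literature.MathematicalPhysics.AQFT
      Literature.MathematicalPhysics.QuantumFieldTheory
      Summit.QuantumFields.YangMills.Theorems.CurvatureBoostCovariance.Negative
      Summit.QuantumFields.YangMills.Theorems.NPointIsotropy.Negative in
    ∀ (S₁ : SchwingerFamily E4), OSPackage S₁ → Translations S₁ → Hypercubic S₁ → EightFrameRP S₁ →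
      PlanarCone S₁ → NPointRegular S₁ →
      (∀ (h : OSReconstructionNoE1 S₁.toLabelled), ∀ (n : ℕ), ∃ N : ℝ, ∀ (F : SchwartzMap (Fin n → E4) ℂ), IsTimeOrdered F →
          HasCompactSupport (F : (Fin n → E4) → ℂ) →
          ∃ ε : ℝ, 0 < ε ∧ ∃ (V : ℂ → h.Hilbert) (C : ℝ),
            DifferentiableOn ℂ V {θ : ℂ | |θ.re| < ε} ∧
            (∀ θ : ℂ, |θ.re| < ε → ‖V θ‖ ≤ C * Real.exp (N * |θ.im|)) ∧
            ∀ θ : ℝ, |θ| < ε → ∀ hθ : IsTimeOrdered (linActMulti (planeRot (0 : Fin 3) θ) F),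
              V θ = h.fieldVec n (fun _ => ()) (linActMulti (planeRot (0 : Fin 3) θ) F) hθ) →
      ∀ (n m : ℕ) (F : SchwartzMap (Fin n → E4) ℂ) (G : SchwartzMap (Fin m → E4) ℂ),
        IsTimeOrdered F → IsTimeOrdered G →
        HasCompactSupport (F : (Fin n → E4) → ℂ) → HasCompactSupport (G : (Fin m → E4) → ℂ) →
        ∀ H : SchwartzMap (Fin (n + m) → E4) ℂ, IsAppendTensorOf H (osAdjoint F) G →
          ∃ (K : ℕ) (c : ℤ → ℂ), ∀ θ : ℝ,
            S₁ (n + m) (linActMulti (planeRot (0 : Fin 3) θ) H) =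
              ∑ k ∈ Finset.Icc (-(K : ℤ)) K, c k * Complex.exp (4 * (k : ℂ) * (θ : ℂ) * Complex.I) :=
  Summit.QuantumFields.YangMills.Theorems.SoftKernelBoostCovariance.Sketch.stub_orbitBandlimitLocal

/-- **Stub (4ℓ) — BOOSTS INHERIT THE MIRRORS: ray positivity of the doubled pencils, from boost vectors of `S₁` and of its
`45°` pull-back (difficulty M; LANDED p102747 by the wave-2 worker).**  Verbatim the landed `stub_rayPositivity`
(Theorems/MirrorModularBoostsCurvatureBoostCovarianceRayPositivity) with its universal first hypothesis replaced by (non-uniform)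
planar boost vectors for the `e₀`-reconstructions of `S₁` and of `T = 𝔖 ∘ (R_{π/4} ·)`, and without the cone hypotheses (they
only fed Stub 4a).  Proof: `RayPositivity.axis_half` made local (its 80-line body uses the universal hypothesis only as
`hPBV S' h' hlg hsym h8 hC n F hF hFc`), once for `S₁` (`s > 0`) and once for `T` at `-s > 0` with `orbit_pullBack` and
`twist_cancel`, exactly as in the landed proof (lines 360–378). -/
theorem stub_rayPositivityLocal :
    open Literature.MathematicalPhysics.QuantumLattice Literature.MathematicalPhysics.AQFT
      Literature.MathematicalPhysics.QuantumFieldTheory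
      Summit.QuantumFields.YangMills.Theorems.CurvatureBoostCovariance.Negative
      Summit.QuantumFields.YangMills.Theorems.NPointIsotropy.Negative in
    ∀ (S₁ : SchwingerFamily E4), OSPackage S₁ → Translations S₁ → EightFrameRP S₁ →
      (∀ (h : OSReconstructionNoE1 S₁.toLabelled), ∀ (n : ℕ) (F : SchwartzMap (Fin n → E4) ℂ), IsTimeOrdered F →
          HasCompactSupport (F : (Fin n → E4) → ℂ) →
          ∃ ε : ℝ, 0 < ε ∧ ∃ (V : ℂ → h.Hilbert) (C N : ℝ),
            DifferentiableOn ℂ V {θ : ℂ | |θ.re| < ε} ∧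
            (∀ θ : ℂ, |θ.re| < ε → ‖V θ‖ ≤ C * Real.exp (N * |θ.im|)) ∧
            ∀ θ : ℝ, |θ| < ε → ∀ hθ : IsTimeOrdered (linActMulti (planeRot (0 : Fin 3) θ) F),
              V θ = h.fieldVec n (fun _ => ()) (linActMulti (planeRot (0 : Fin 3) θ) F) hθ) →
      (∀ (h' : OSReconstructionNoE1 (SchwingerFamily.toLabelled (fun n => (S₁ n).comp (linActMulti (planeRot (0 : Fin 3) (Real.pi / 4)))))),
        ∀ (n : ℕ) (F : SchwartzMap (Fin n → E4) ℂ), IsTimeOrdered F →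
          HasCompactSupport (F : (Fin n → E4) → ℂ) →
          ∃ ε : ℝ, 0 < ε ∧ ∃ (V : ℂ → h'.Hilbert) (C N : ℝ),
            DifferentiableOn ℂ V {θ : ℂ | |θ.re| < ε} ∧
            (∀ θ : ℂ, |θ.re| < ε → ‖V θ‖ ≤ C * Real.exp (N * |θ.im|)) ∧
            ∀ θ : ℝ, |θ| < ε → ∀ hθ : IsTimeOrdered (linActMulti (planeRot (0 : Fin 3) θ) F),
              V θ = h'.fieldVec n (fun _ => ()) (linActMulti (planeRot (0 : Fin 3) θ) F) hθ) →
      ∀ (n m : ℕ) (F : SchwartzMap (Fin n → E4) ℂ) (G : SchwartzMap (Fin m → E4) ℂ),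
        IsTimeOrdered F → IsTimeOrdered G →
        HasCompactSupport (F : (Fin n → E4) → ℂ) → HasCompactSupport (G : (Fin m → E4) → ℂ) →
        ∀ (HFF : SchwartzMap (Fin (n + n) → E4) ℂ) (HFG : SchwartzMap (Fin (n + m) → E4) ℂ)
          (HGF : SchwartzMap (Fin (m + n) → E4) ℂ) (HGG : SchwartzMap (Fin (m + m) → E4) ℂ),
          IsAppendTensorOf HFF (osAdjoint F) F → IsAppendTensorOf HFG (osAdjoint F) G →
          IsAppendTensorOf HGF (osAdjoint G) F → IsAppendTensorOf HGG (osAdjoint G) G →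
        ∀ (Kp Kq Kq' Kr : ℕ) (p q q' r : ℤ → ℂ),
          (∀ θ : ℝ, S₁ (n + n) (linActMulti (planeRot (0 : Fin 3) θ) HFF) =
            ∑ k ∈ Finset.Icc (-(Kp : ℤ)) Kp, p k * Complex.exp (4 * (k : ℂ) * (θ : ℂ) * Complex.I)) →
          (∀ θ : ℝ, S₁ (n + m) (linActMulti (planeRot (0 : Fin 3) θ) HFG) =
            ∑ k ∈ Finset.Icc (-(Kq : ℤ)) Kq, q k * Complex.exp (4 * (k : ℂ) * (θ : ℂ) * Complex.I)) →
          (∀ θ : ℝ, S₁ (m + n) (linActMulti (planeRot (0 : Fin 3) θ) HGF) =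
            ∑ k ∈ Finset.Icc (-(Kq' : ℤ)) Kq', q' k * Complex.exp (4 * (k : ℂ) * (θ : ℂ) * Complex.I)) →
          (∀ θ : ℝ, S₁ (m + m) (linActMulti (planeRot (0 : Fin 3) θ) HGG) =
            ∑ k ∈ Finset.Icc (-(Kr : ℤ)) Kr, r k * Complex.exp (4 * (k : ℂ) * (θ : ℂ) * Complex.I)) →
        ∀ s : ℝ, s ≠ 0 → ∀ v w : ℂ,
          (fun z : ℂ => 0 ≤ z.re ∧ z.im = 0)
            ((∑ k ∈ Finset.Icc (-(Kp : ℤ)) Kp, starRingEnd ℂ v * v * (p k * (s : ℂ) ^ k)) +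
            (∑ k ∈ Finset.Icc (-(Kq : ℤ)) Kq, starRingEnd ℂ v * w * (q k * (s : ℂ) ^ k)) +
            (∑ k ∈ Finset.Icc (-(Kq' : ℤ)) Kq', starRingEnd ℂ w * v * (q' k * (s : ℂ) ^ k)) +
            (∑ k ∈ Finset.Icc (-(Kr : ℤ)) Kr, starRingEnd ℂ w * w * (r k * (s : ℂ) ^ k))) :=
  Summit.QuantumFields.YangMills.Theorems.SoftKernelBoostCovariance.Sketch.stub_rayPositivityLocal

/-! ## Layers from growth (landed, wave 1) -/

/-- **Stub (L3) — SUB-THRESHOLD RAY GROWTH KILLS THE NEGATIVE LAYERS OF A FINITE LAURENT SUM (pure analysis; difficulty M;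
LANDED p96941 by the wave-1 worker).**  If the Laurent sum `χ ↦ Σ_{|k| ≤ K} p_k s^k` at `s = e^{-4χ}` is `O(e^{cχ})` along `χ → +∞` with `c < 8`,
then `p_k = 0` for every `k ≤ -2` (the most negative non-zero layer `k₀ ≤ -2` would dominate like `e^{-4k₀χ} ≥ e^{8χ}`).
The pencil is written exactly as in the landed `RayPositivity.pencil_eq_inner` (`((Real.exp (-4χ) : ℝ) : ℂ) ^ k`, `k : ℤ`). -/
theorem stub_laurentLayers :
    ∀ (K : ℕ) (p : ℤ → ℂ) (C c : ℝ), c < 8 →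
      (∀ χ : ℝ, 0 ≤ χ →
        ‖∑ k ∈ Finset.Icc (-(K : ℤ)) K, p k * ((Real.exp (-4 * χ) : ℝ) : ℂ) ^ k‖ ≤ C * Real.exp (c * χ)) →
      ∀ k ∈ Finset.Icc (-(K : ℤ)) K, k ≤ -2 → p k = 0 :=
  Summit.QuantumFields.YangMills.Theorems.SoftKernelBoostCovariance.Sketch.stub_laurentLayers

/-- **Stub (5b') — BOOSTED VECTORS OF TYPE `< 4` KILL THE LAYERS `|k| ≥ 2` (model-blind OS bookkeeping + (L3); difficulty M;
LANDED p97905 by the wave-1 worker).**  For a one-species family with an `e₀`-reconstruction `h`, a compactly supported `e₀`-time-ordered `F` of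
degree `a` whose boosted OS vectors `V` exist on a strip with exponential type `N' < 4`, and a witness `H` of `ΘF* ⊗ F` whose
orbit function is the trigonometric polynomial with coefficients `p`: `p_k = 0` for `|k| ≥ 2`.  Proof: shrink `ε` below the
rotation margin of the support (`RayPositivity.exists_isTimeOrdered_planeRot`); `𝔖(R_θ H) = ⟪V(-θ), V(θ)⟫` on the real segment
(`RayPositivity.orbit_eq_inner`, `R_θ(ΘF* ⊗ F) = Θ(R_{-θ}F)* ⊗ R_θ F`); the identity theorem on the strip
(`RayPositivity.pencil_eq_inner`) gives `Σ p_k e^{-4kχ} = ‖V(iχ)‖² ≤ C'² e^{2N'|χ|}` for ALL real `χ`; (L3) (first hypothesis)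
at `χ → +∞` kills `k ≤ -2`, and applied to `k ↦ p(-k)` with `χ ↦ -χ` kills `k ≥ 2`. -/
theorem stub_levelGrowthHigh_of_boostType :
    open Literature.MathematicalPhysics.QuantumLattice Literature.MathematicalPhysics.AQFT
      Literature.MathematicalPhysics.QuantumFieldTheory
      Summit.QuantumFields.YangMills.Theorems.CurvatureBoostCovariance.Negative
      Summit.QuantumFields.YangMills.Theorems.NPointIsotropy.Negative in
    (∀ (K : ℕ) (p : ℤ → ℂ) (C c : ℝ), c < 8 →
      (∀ χ : ℝ, 0 ≤ χ →
        ‖∑ k ∈ Finset.Icc (-(K : ℤ)) K, p k * ((Real.exp (-4 * χ) : ℝ) : ℂ) ^ k‖ ≤ C * Real.exp (c * χ)) →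
      ∀ k ∈ Finset.Icc (-(K : ℤ)) K, k ≤ -2 → p k = 0) →
    ∀ (S₁ : SchwingerFamily E4) (h : OSReconstructionNoE1 S₁.toLabelled)
      (a : ℕ) (F : SchwartzMap (Fin a → E4) ℂ), IsTimeOrdered F → HasCompactSupport (F : (Fin a → E4) → ℂ) →
      (∃ ε : ℝ, 0 < ε ∧ ∃ (V : ℂ → h.Hilbert) (C' N' : ℝ), N' < 4 ∧
        DifferentiableOn ℂ V {θ : ℂ | |θ.re| < ε} ∧
        (∀ θ : ℂ, |θ.re| < ε → ‖V θ‖ ≤ C' * Real.exp (N' * |θ.im|)) ∧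
        ∀ θ : ℝ, |θ| < ε → ∀ hθ : IsTimeOrdered (linActMulti (planeRot (0 : Fin 3) θ) F),
          V θ = h.fieldVec a (fun _ => ()) (linActMulti (planeRot (0 : Fin 3) θ) F) hθ) →
      ∀ H : SchwartzMap (Fin (a + a) → E4) ℂ, IsAppendTensorOf H (osAdjoint F) F →
      ∀ (K : ℕ) (p : ℤ → ℂ),
        (∀ θ : ℝ, S₁ (a + a) (linActMulti (planeRot (0 : Fin 3) θ) H) =
          ∑ k ∈ Finset.Icc (-(K : ℤ)) K, p k * Complex.exp (4 * (k : ℂ) * (θ : ℂ) * Complex.I)) →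
        ∀ k ∈ Finset.Icc (-(K : ℤ)) K, 2 ≤ |k| → p k = 0 :=
  Summit.QuantumFields.YangMills.Theorems.SoftKernelBoostCovariance.Sketch.stub_levelGrowthHigh_of_boostType

/-! ## Composition (pure logic) -/

/-- **The engine-below-dimension-five crux, unbundled** (definitional; verbatim from the parent skeleton). -/
theorem softKernelBoostCovariance_iff :
    Summit.QuantumFields.YangMills.Theses.MirrorModularBoosts.SoftKernelBoostCovariance ↔
      ∀ (G : Type) [Group G] [TopologicalSpace G] [IsTopologicalGroup G] [CompactSpace G],
        IsCompactSimpleLieGroup G →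
        letI : MeasurableSpace G := borel G
        haveI : BorelSpace G := ⟨rfl⟩
        ∀ (r : LatticeRep G) (sch : SpeciesScheme (YMSpecies G)) (S₁ : SchwingerFamily E4),
          W1 r sch S₁ → EightFrameRP S₁ → PlanarCone S₁ →
          (∃ (K : E4 → ℝ) (C η : ℝ), 0 < η ∧ ContinuousOn K {x : E4 | x ≠ 0} ∧
            (∀ x : E4, x ≠ 0 → |K x| ≤ C * (1 + ‖x‖ ^ (η - 10))) ∧
            ∀ F : 𝓢((Fin 2 → E4), ℂ), IsOffDiagonal F →
              MeasureTheory.Integrable (fun x : Fin 2 → E4 => (K (x 0 - x 1) : ℂ) * F x) ∧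
                S₁ 2 F = ∫ x : Fin 2 → E4, (K (x 0 - x 1) : ℂ) * F x) →
          PlanarInvariant S₁ :=
  Iff.rfl

/-- The rotation by the angle `0` acts trivially on test functions. -/
theorem linActMulti_planeRot_zero {n : ℕ} (H : 𝓢((Fin n → E4), ℂ)) :
    linActMulti (planeRot (0 : Fin 3) 0) H = H := by
  ext x
  rw [linActMulti_apply]
  congr 1
  funext i
  exact (planeRot (0 : Fin 3) 0).injective (by rw [LinearIsometryEquiv.apply_symm_apply, planeRot_zero_apply])

/-- Uniform boost vectors imply the non-uniform form (pure logic). -/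
theorem boostVectors_of_uniform {S₁ : SchwingerFamily E4} (h : OSReconstructionNoE1 S₁.toLabelled)
    (hu : ∀ (n : ℕ), ∃ N : ℝ, ∀ (F : SchwartzMap (Fin n → E4) ℂ), IsTimeOrdered F →
          HasCompactSupport (F : (Fin n → E4) → ℂ) →
          ∃ ε : ℝ, 0 < ε ∧ ∃ (V : ℂ → h.Hilbert) (C : ℝ),
            DifferentiableOn ℂ V {θ : ℂ | |θ.re| < ε} ∧
            (∀ θ : ℂ, |θ.re| < ε → ‖V θ‖ ≤ C * Real.exp (N * |θ.im|)) ∧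
            ∀ θ : ℝ, |θ| < ε → ∀ hθ : IsTimeOrdered (linActMulti (planeRot (0 : Fin 3) θ) F),
              V θ = h.fieldVec n (fun _ => ()) (linActMulti (planeRot (0 : Fin 3) θ) F) hθ) :
    ∀ (n : ℕ) (F : SchwartzMap (Fin n → E4) ℂ), IsTimeOrdered F →
          HasCompactSupport (F : (Fin n → E4) → ℂ) →
          ∃ ε : ℝ, 0 < ε ∧ ∃ (V : ℂ → h.Hilbert) (C N : ℝ),
            DifferentiableOn ℂ V {θ : ℂ | |θ.re| < ε} ∧
            (∀ θ : ℂ, |θ.re| < ε → ‖V θ‖ ≤ C * Real.exp (N * |θ.im|)) ∧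
            ∀ θ : ℝ, |θ| < ε → ∀ hθ : IsTimeOrdered (linActMulti (planeRot (0 : Fin 3) θ) F),
              V θ = h.fieldVec n (fun _ => ()) (linActMulti (planeRot (0 : Fin 3) θ) F) hθ := by
  intro n F hF hFc
  obtain ⟨N, hN⟩ := hu n
  obtain ⟨ε, hε, V, C, hd, hg, hv⟩ := hN F hF hFc
  exact ⟨ε, hε, V, C, N, hd, hg, hv⟩

/-- **The model-blind sieve, LOCAL form**: for a one-species family with the OS package, translations, proper hypercubic invariance,
the eight frames and the planar cone, IF every `𝔖ₙ|⁰𝒮` is a function, the doubled orbit functions are trigonometric polynomials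
(Stub 3ℓ instantiated), the pencils are PSD on `ℝ∖0` (Stub 4ℓ instantiated) and the level growth holds at every level, then `S₁` is
planar-invariant on `⁰𝒮` (landed Stubs 6, 6a and the parity sieve; induction on the OS level — verbatim the parent's argument). -/
theorem sieve_of_stubs (S₁ : SchwingerFamily E4) (hOS : OSPackage S₁) (htr : Translations S₁) (hreg : NPointRegular S₁)
    (hband : ∀ (n m : ℕ) (F : 𝓢((Fin n → E4), ℂ)) (G : 𝓢((Fin m → E4), ℂ)),
        IsTimeOrdered F → IsTimeOrdered G →
        HasCompactSupport (F : (Fin n → E4) → ℂ) → HasCompactSupport (G : (Fin m → E4) → ℂ) →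
        ∀ H : 𝓢((Fin (n + m) → E4), ℂ), IsAppendTensorOf H (osAdjoint F) G →
          ∃ (K : ℕ) (c : ℤ → ℂ), ∀ θ : ℝ,
            S₁ (n + m) (linActMulti (planeRot (0 : Fin 3) θ) H) =
              ∑ k ∈ Finset.Icc (-(K : ℤ)) K, c k * Complex.exp (4 * (k : ℂ) * (θ : ℂ) * Complex.I))
    (hpos : ∀ (n m : ℕ) (F : 𝓢((Fin n → E4), ℂ)) (G : 𝓢((Fin m → E4), ℂ)),
        IsTimeOrdered F → IsTimeOrdered G →
        HasCompactSupport (F : (Fin n → E4) → ℂ) → HasCompactSupport (G : (Fin m → E4) → ℂ) →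
        ∀ (HFF : 𝓢((Fin (n + n) → E4), ℂ)) (HFG : 𝓢((Fin (n + m) → E4), ℂ))
          (HGF : 𝓢((Fin (m + n) → E4), ℂ)) (HGG : 𝓢((Fin (m + m) → E4), ℂ)),
          IsAppendTensorOf HFF (osAdjoint F) F → IsAppendTensorOf HFG (osAdjoint F) G →
          IsAppendTensorOf HGF (osAdjoint G) F → IsAppendTensorOf HGG (osAdjoint G) G →
        ∀ (Kp Kq Kq' Kr : ℕ) (p q q' r : ℤ → ℂ),
          (∀ θ : ℝ, S₁ (n + n) (linActMulti (planeRot (0 : Fin 3) θ) HFF) =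
            ∑ k ∈ Finset.Icc (-(Kp : ℤ)) Kp, p k * Complex.exp (4 * (k : ℂ) * (θ : ℂ) * Complex.I)) →
          (∀ θ : ℝ, S₁ (n + m) (linActMulti (planeRot (0 : Fin 3) θ) HFG) =
            ∑ k ∈ Finset.Icc (-(Kq : ℤ)) Kq, q k * Complex.exp (4 * (k : ℂ) * (θ : ℂ) * Complex.I)) →
          (∀ θ : ℝ, S₁ (m + n) (linActMulti (planeRot (0 : Fin 3) θ) HGF) =
            ∑ k ∈ Finset.Icc (-(Kq' : ℤ)) Kq', q' k * Complex.exp (4 * (k : ℂ) * (θ : ℂ) * Complex.I)) →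
          (∀ θ : ℝ, S₁ (m + m) (linActMulti (planeRot (0 : Fin 3) θ) HGG) =
            ∑ k ∈ Finset.Icc (-(Kr : ℤ)) Kr, r k * Complex.exp (4 * (k : ℂ) * (θ : ℂ) * Complex.I)) →
        ∀ s : ℝ, s ≠ 0 → ∀ v w : ℂ,
          (fun z : ℂ => 0 ≤ z.re ∧ z.im = 0)
            ((∑ k ∈ Finset.Icc (-(Kp : ℤ)) Kp, starRingEnd ℂ v * v * (p k * (s : ℂ) ^ k)) +
            (∑ k ∈ Finset.Icc (-(Kq : ℤ)) Kq, starRingEnd ℂ v * w * (q k * (s : ℂ) ^ k)) +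
            (∑ k ∈ Finset.Icc (-(Kq' : ℤ)) Kq', starRingEnd ℂ w * v * (q' k * (s : ℂ) ^ k)) +
            (∑ k ∈ Finset.Icc (-(Kr : ℤ)) Kr, starRingEnd ℂ w * w * (r k * (s : ℂ) ^ k))))
    (hgrow : ∀ a : ℕ,
      (∀ N : ℕ, N + 2 ≤ 2 * a → ∀ R : E4 ≃ₗᵢ[ℝ] E4,
            LinearMap.det (R.toLinearEquiv : E4 →ₗ[ℝ] E4) = 1 →
            R (EuclideanSpace.single 2 1) = EuclideanSpace.single 2 1 →
            R (EuclideanSpace.single 3 1) = EuclideanSpace.single 3 1 →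
            ∀ F : SchwartzMap (Fin N → E4) ℂ, IsOffDiagonal F → S₁ N (linActMulti R F) = S₁ N F) →
      ∀ (F : 𝓢((Fin a → E4), ℂ)), IsTimeOrdered F → HasCompactSupport (F : (Fin a → E4) → ℂ) →
      ∀ H : 𝓢((Fin (a + a) → E4), ℂ), IsAppendTensorOf H (osAdjoint F) F →
      ∀ (K : ℕ) (p : ℤ → ℂ),
        (∀ θ : ℝ, S₁ (a + a) (linActMulti (planeRot (0 : Fin 3) θ) H) =
          ∑ k ∈ Finset.Icc (-(K : ℤ)) K, p k * Complex.exp (4 * (k : ℂ) * (θ : ℂ) * Complex.I)) →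
        ∀ k ∈ Finset.Icc (-(K : ℤ)) K, 2 ≤ |k| → p k = 0) :
    PlanarInvariant S₁ := by
  have hd2i := stub_doubledToInvariant stub_tensorDensity S₁ hOS htr hreg
  -- one level of the induction: invariance below `2a - 1` ⇒ doubled-orbit constancy up to level `a`
  have level_step : ∀ a : ℕ,
      (∀ N : ℕ, N + 2 ≤ 2 * a → ∀ R : E4 ≃ₗᵢ[ℝ] E4,
            LinearMap.det (R.toLinearEquiv : E4 →ₗ[ℝ] E4) = 1 →
            R (EuclideanSpace.single 2 1) = EuclideanSpace.single 2 1 →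
            R (EuclideanSpace.single 3 1) = EuclideanSpace.single 3 1 →
            ∀ F : SchwartzMap (Fin N → E4) ℂ, IsOffDiagonal F → S₁ N (linActMulti R F) = S₁ N F) →
      ∀ n m : ℕ, n ≤ a → m ≤ a →
        ∀ (F : 𝓢((Fin n → E4), ℂ)) (G : 𝓢((Fin m → E4), ℂ)),
          IsTimeOrdered F → IsTimeOrdered G →
          HasCompactSupport (F : (Fin n → E4) → ℂ) → HasCompactSupport (G : (Fin m → E4) → ℂ) →
          ∀ H : 𝓢((Fin (n + m) → E4), ℂ), IsAppendTensorOf H (osAdjoint F) G →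
            ∀ θ : ℝ, S₁ (n + m) (linActMulti (planeRot (0 : Fin 3) θ) H) = S₁ (n + m) H := by
    intro a hInv n m hn hm F G hF hG hFc hGc H hH θ
    obtain ⟨HFF, hHFF⟩ := exists_isAppendTensorOf (osAdjoint F) F
    obtain ⟨HGF, hHGF⟩ := exists_isAppendTensorOf (osAdjoint G) F
    obtain ⟨HGG, hHGG⟩ := exists_isAppendTensorOf (osAdjoint G) G
    obtain ⟨Kp, p, hp⟩ := hband n n F F hF hF hFc hFc HFF hHFF
    obtain ⟨Kq, q, hq⟩ := hband n m F G hF hG hFc hGc H hH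
    obtain ⟨Kq', q', hq'⟩ := hband m n G F hG hF hGc hFc HGF hHGF
    obtain ⟨Kr, r, hr⟩ := hband m m G G hG hG hGc hGc HGG hHGG
    have hpsd := hpos n m F G hF hG hFc hGc HFF H HGF HGG hHFF hH hHGF hHGG Kp Kq Kq' Kr p q q' r hp hq hq' hr
    have hp2 : ∀ k ∈ Finset.Icc (-(Kp : ℤ)) Kp, 2 ≤ |k| → p k = 0 :=
      hgrow n (fun N hN => hInv N (by omega)) F hF hFc HFF hHFF Kp p hp
    have hr2 : ∀ k ∈ Finset.Icc (-(Kr : ℤ)) Kr, 2 ≤ |k| → r k = 0 :=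
      hgrow m (fun N hN => hInv N (by omega)) G hG hGc HGG hHGG Kr r hr
    have hq0 : ∀ k ∈ Finset.Icc (-(Kq : ℤ)) Kq, k ≠ 0 → q k = 0 :=
      stub_paritySieve Kp Kq Kq' Kr p q q' r hpsd hp2 hr2
    calc S₁ (n + m) (linActMulti (planeRot (0 : Fin 3) θ) H)
        = ∑ k ∈ Finset.Icc (-(Kq : ℤ)) Kq, q k * Complex.exp (4 * (k : ℂ) * (θ : ℂ) * Complex.I) := hq θ
      _ = ∑ k ∈ Finset.Icc (-(Kq : ℤ)) Kq,
            q k * Complex.exp (4 * (k : ℂ) * ((0 : ℝ) : ℂ) * Complex.I) := by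
          refine Finset.sum_congr rfl fun k hk => ?_
          by_cases hk0 : k = 0
          · subst hk0; simp
          · rw [hq0 k hk hk0]; simp
      _ = S₁ (n + m) (linActMulti (planeRot (0 : Fin 3) 0) H) := (hq 0).symm
      _ = S₁ (n + m) H := by rw [linActMulti_planeRot_zero]
  have hQ : ∀ a n m : ℕ, n ≤ a → m ≤ a →
      ∀ (F : 𝓢((Fin n → E4), ℂ)) (G : 𝓢((Fin m → E4), ℂ)),
        IsTimeOrdered F → IsTimeOrdered G →
        HasCompactSupport (F : (Fin n → E4) → ℂ) → HasCompactSupport (G : (Fin m → E4) → ℂ) →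
        ∀ H : 𝓢((Fin (n + m) → E4), ℂ), IsAppendTensorOf H (osAdjoint F) G →
          ∀ θ : ℝ, S₁ (n + m) (linActMulti (planeRot (0 : Fin 3) θ) H) = S₁ (n + m) H := by
    intro a
    induction a with
    | zero => exact level_step 0 fun N hN => absurd hN (by omega)
    | succ a ih => exact level_step (a + 1) fun N hN => hd2i a ih N (by omega)
  intro R hdet h2 h3 N F hF
  exact hd2i N (hQ N) N (by omega) R hdet h2 h3 F hF

/-- **Level growth at levels `a ≤ 1` from the KERNEL TRIPLE of `S₁` itself** (sorry-free: the triple + the landed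
`KernelTransfer` + the LANDED `ShellRigidity_proof` make the two-point kernel radial, so the degree-`2` doubled orbit is
constant and its non-zero layers vanish; `a = 0` is trivial). -/
theorem levelGrowthLow_of_kernel
    {G : Type} [Group G] [TopologicalSpace G] [IsTopologicalGroup G] [CompactSpace G] [MeasurableSpace G] [BorelSpace G]
    {r : LatticeRep G} {sch : SpeciesScheme (YMSpecies G)} {S₁ : SchwingerFamily E4}
    (hW : W1 r sch S₁) (h8 : EightFrameRP S₁)
    (hK : ∃ (K : E4 → ℝ) (C η : ℝ), 0 < η ∧ ContinuousOn K {x : E4 | x ≠ 0} ∧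
      (∀ x : E4, x ≠ 0 → |K x| ≤ C * (1 + ‖x‖ ^ (η - 10))) ∧
      ∀ F : 𝓢((Fin 2 → E4), ℂ), IsOffDiagonal F →
        MeasureTheory.Integrable (fun x : Fin 2 → E4 => (K (x 0 - x 1) : ℂ) * F x) ∧
          S₁ 2 F = ∫ x : Fin 2 → E4, (K (x 0 - x 1) : ℂ) * F x) :
    ∀ a : ℕ, a ≤ 1 →
      ∀ (F : 𝓢((Fin a → E4), ℂ)), IsTimeOrdered F →
      ∀ H : 𝓢((Fin (a + a) → E4), ℂ), IsAppendTensorOf H (osAdjoint F) F →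
      ∀ (K : ℕ) (p : ℤ → ℂ),
        (∀ θ : ℝ, S₁ (a + a) (linActMulti (planeRot (0 : Fin 3) θ) H) =
          ∑ k ∈ Finset.Icc (-(K : ℤ)) K, p k * Complex.exp (4 * (k : ℂ) * (θ : ℂ) * Complex.I)) →
        ∀ k ∈ Finset.Icc (-(K : ℤ)) K, 2 ≤ |k| → p k = 0 := by
  intro a ha F hF H hH K p hp
  have hconst : ∀ θ : ℝ, S₁ (a + a) (linActMulti (planeRot (0 : Fin 3) θ) H) = S₁ (a + a) H := by
    obtain rfl | rfl : a = 0 ∨ a = 1 := by omega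
    · intro θ
      congr 1
      ext x
      rw [linActMulti_apply]
      congr 1
      funext i
      exact Fin.elim0 i
    · obtain ⟨Kf, C, η, hη, hKc, hKb, hKrep⟩ := hK
      obtain ⟨-, hOS, -, hhyp, -⟩ := hW
      obtain ⟨hWB4, hax, hdiag⟩ :=
        Summit.QuantumFields.YangMills.Theorems.KernelTransfer.kernelTransfer_proof S₁ Kf hKc hKrep hOS.2.2.2.2.1 hhyp h8
      have hrad : Summit.QuantumFields.YangMills.Theorems.NPointIsotropy.Negative.RadialKernel S₁ :=
        ⟨Kf, hKc, fun R x hx =>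
          Summit.QuantumFields.YangMills.Cruxes.ShellRigidity.TransverseSmearingPlanarThreshold.ShellRigidity_proof
            Kf hKc ⟨C, η, hη, hKb⟩ hWB4 hax hdiag R x hx, hKrep⟩
      have hHoff : IsOffDiagonal H := hH.isOffDiagonal_of_isTimeOrdered hF hF
      intro θ
      exact Summit.QuantumFields.YangMills.Theorems.NPointIsotropy.Negative.radialKernel_invariant_two hrad
        (planeRot (0 : Fin 3) θ) H hHoff
  intro k hk hk2
  have hk0 : k ≠ 0 := by
    rintro rfl
    rw [abs_zero] at hk2
    exact absurd hk2 (by norm_num)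
  exact trigPoly_coeff_eq_zero_of_const K p (S₁ (a + a) H) (fun θ => (hp θ).symm.trans (hconst θ)) k hk hk0

/-- **THE CRUX FROM THE LINE, BY NAME** — `MirrorModularBoosts.SoftKernelBoostCovariance` (stmt-QuantumFields-14999)
modulo the registered stubs.  Step 0 (`stub_tieRegularity`); the `e₀`-reconstructions of `S₁` and of its `45°` pull-back `T`;
their cone families (Stub (N), the pull-back's hypotheses transported by the landed `RayPositivity.*_pullBack` lemmas and the
landed cone theorem `PlanarSpectralCone_of`); the sandwich bounds (Stub (Σ)); the chain (Stub (T*)) for `S₁` (uniform boost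
vectors + type `μ < 4` under the induction hypothesis) and for `T` (boost vectors); band limit (Stub 3ℓ) and ray positivity
(Stub 4ℓ); level growth: `a ≤ 1` from the kernel triple (sorry-free), `a ≥ 2` from type `μ < 4` (landed 5b' + L3); the sieve. -/
theorem SoftKernelBoostCovariance_of :
    Summit.QuantumFields.YangMills.Theses.MirrorModularBoosts.SoftKernelBoostCovariance := by
  rw [softKernelBoostCovariance_iff]
  intro G _ _ _ _ hG
  letI : MeasurableSpace G := borel G
  haveI : BorelSpace G := ⟨rfl⟩
  intro r sch S₁ hW h8 hC hK
  have hreg : NPointRegular S₁ := stub_tieRegularity G hG r sch S₁ hW h8 hC hK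
  have hlow := levelGrowthLow_of_kernel hW h8 hK
  obtain ⟨_, hOS, htr, hhyp, -⟩ := id hW
  have hlg := hOS.2.2.1
  have hRP := hOS.2.2.2.1
  have hsym := hOS.2.2.2.2.1
  -- the two reconstructions
  have h : OSReconstructionNoE1 S₁.toLabelled := osReconstruction_of hRP htr
  have hT : OSReconstructionNoE1 (SchwingerFamily.toLabelled (fun n => (S₁ n).comp (linActMulti (planeRot (0 : Fin 3) (Real.pi / 4))))) :=
    osReconstruction_of (isReflectionPositive_pullBack h8) (translations_pullBack htr _)
  have hPSC : Summit.QuantumFields.YangMills.Theses.MirrorModularBoosts.PlanarSpectralCone :=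
    Summit.QuantumFields.YangMills.Cruxes.PlanarSpectralCone.PositivityDiscToOperatorCone.PlanarSpectralCone_of
  -- cone families
  have hN := stub_coneFamily S₁ h hlg hsym htr h8
  have hNT := stub_coneFamily (fun n => (S₁ n).comp (linActMulti (planeRot (0 : Fin 3) (Real.pi / 4)))) hT (hasLinearGrowth_pullBack hlg _) (isSymmetric_pullBack hsym _)
    (translations_pullBack htr _) (eightFrameRP_pullBack h8)
  -- the sandwich bounds (the YM input), exponents made nonnegative (`sandwich_mono_exponent`)
  obtain ⟨hSig, hSigT⟩ := stub_sandwichPair G hG r sch S₁ hW h8 hC hK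
  obtain ⟨μ₀, Cμ, hμ₀, hS₀⟩ := hSig h
  obtain ⟨μT₀, CμT, hST₀⟩ := hSigT hT
  have hS := sandwich_mono_exponent h hS₀
  have hST := sandwich_mono_exponent hT hST₀
  have hμ : max μ₀ 0 < 4 := max_lt hμ₀ (by norm_num)
  -- the chain, for `S₁` and for `T`
  obtain ⟨huni, hsub⟩ := stub_chainBoostVectors S₁ h hlg hsym htr h8 hC hN (max μ₀ 0) Cμ hS (le_max_right _ _)
  obtain ⟨huniT, -⟩ := stub_chainBoostVectors (fun n => (S₁ n).comp (linActMulti (planeRot (0 : Fin 3) (Real.pi / 4)))) hT (hasLinearGrowth_pullBack hlg _) (isSymmetric_pullBack hsym _)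
    (translations_pullBack htr _) (eightFrameRP_pullBack h8) (planarCone_pullBack hPSC hlg hsym htr h8) hNT (max μT₀ 0) CμT hST
    (le_max_right _ _)
  -- band limit and ray positivity from the local stubs
  have hband := stub_orbitBandlimitLocal S₁ hOS htr hhyp h8 hC hreg (fun _ => huni)
  have hpos := stub_rayPositivityLocal S₁ hOS htr h8 (fun _ => boostVectors_of_uniform h huni)
    (fun _ => boostVectors_of_uniform hT huniT)
  -- level growth at every level
  have hgrow : ∀ a : ℕ,
      (∀ N : ℕ, N + 2 ≤ 2 * a → ∀ R : E4 ≃ₗᵢ[ℝ] E4,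
            LinearMap.det (R.toLinearEquiv : E4 →ₗ[ℝ] E4) = 1 →
            R (EuclideanSpace.single 2 1) = EuclideanSpace.single 2 1 →
            R (EuclideanSpace.single 3 1) = EuclideanSpace.single 3 1 →
            ∀ F : SchwartzMap (Fin N → E4) ℂ, IsOffDiagonal F → S₁ N (linActMulti R F) = S₁ N F) →
      ∀ (F : 𝓢((Fin a → E4), ℂ)), IsTimeOrdered F → HasCompactSupport (F : (Fin a → E4) → ℂ) →
      ∀ H : 𝓢((Fin (a + a) → E4), ℂ), IsAppendTensorOf H (osAdjoint F) F →
      ∀ (K : ℕ) (p : ℤ → ℂ),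
        (∀ θ : ℝ, S₁ (a + a) (linActMulti (planeRot (0 : Fin 3) θ) H) =
          ∑ k ∈ Finset.Icc (-(K : ℤ)) K, p k * Complex.exp (4 * (k : ℂ) * (θ : ℂ) * Complex.I)) →
        ∀ k ∈ Finset.Icc (-(K : ℤ)) K, 2 ≤ |k| → p k = 0 := by
    intro a hInv F hF hFc H hH K p hp
    by_cases ha : a ≤ 1
    · exact hlow a ha F hF H hH K p hp
    · obtain ⟨ε, hε, V, C', hVd, hVg, hVeq⟩ := hsub a (by omega) hInv F hF hFc
      exact stub_levelGrowthHigh_of_boostType stub_laurentLayers S₁ h a F hF hFc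
        ⟨ε, hε, V, C', max μ₀ 0, hμ, hVd, hVg, hVeq⟩ H hH K p hp
  exact sieve_of_stubs S₁ hOS htr hreg hband hpos hgrow

/-- **THE CRUX FROM THE TWO ITEMS, BY NAME (v3.8/v3.9: the by-name closure recipe)** — `SoftKernelBoostCovariance` is
`EngineFromPowerCounting T Σ` with the engine item stmt-QuantumFields-17722 PROVED from this line's landed pieces
(`engineFromPowerCounting_proof`, p138806); when `…TemperedCurvatureMoments_holds` (stmt-17721) and `…CurvatureSandwichBound_holds`
(stmt-18372) exist, `SoftKernelBoostCovariance_of_items TemperedCurvatureMoments_holds CurvatureSandwichBound_holds` is the 40-line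
closing file (with `NPointIsotropyBelowThreshold_of`). -/
theorem SoftKernelBoostCovariance_of_items :
    Summit.QuantumFields.YangMills.Theses.IsotropyFromPowerCounting.EngineFromPowerCounting :=
  engineFromPowerCounting_proof

/-! ## v3.7: the sibling route's crux BY NAME from the same skeleton -/

-- Stub (B↔N′) `stub_belowThresholdOfSoftKernel` (+ the sibling certificates 14999 ↔ 16180 ← 11686 ← 9663): LANDED p138346
-- (`Theorems/MirrorModularBoostsSoftKernelBoostCovarianceBelowThresholdOfSoftKernel.lean`, imported; wave 1 of lead c4).

/-- **THE SIBLING CRUX FROM THE LINE, BY NAME** — `CertificationLength.NPointIsotropyBelowThreshold` (stmt-QuantumFields-16180)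
modulo the same registered stubs (v3.7). -/
theorem NPointIsotropyBelowThreshold_of :
    Summit.QuantumFields.YangMills.Theses.CertificationLength.NPointIsotropyBelowThreshold :=
  stub_belowThresholdOfSoftKernel SoftKernelBoostCovariance_of

/-! ## v3.13 (lead c14): the closing composition is LANDED (`stub_cruxOfAxisRow`, p164803) -/

/-- **THE CRUX FROM EXACTLY THE TWO REGISTERED YANG–MILLS STUBS, THROUGH THE LANDED COMPOSITION** (`stub_cruxOfAxisRow`, p164803,
`Theorems/MirrorModularBoostsSoftKernelBoostCovarianceOfAxisRow.lean`).  When the inputs exist the closing file is five lines: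
`softKernelBoostCovariance_of_items' TemperedCurvatureMoments_holds CurvatureSandwichBound_holds`, or `stub_cruxOfAxisRow` /
`softKernelBoostCovariance_of_regularHigh_of_chainGrowthAxis` fed with the residual texts (regularity from `regularHigh_of_temperedCurvatureMoments` /
`regularHigh_of_curvatureDensities`, the axis row from the item or from the Σ-lead's leaf `stub_chainGrowthAxis`). -/
theorem SoftKernelBoostCovariance_of'' :
    Summit.QuantumFields.YangMills.Theses.MirrorModularBoosts.SoftKernelBoostCovariance :=
  Summit.QuantumFields.YangMills.Theorems.SoftKernelBoostCovariance.Sketch.stub_cruxOfAxisRow stub_regularHigh stub_sandwichAxis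

/-- **The sibling crux stmt-QuantumFields-16180 from the same two stubs, through the landed composition**
(`nPointIsotropyBelowThreshold_of_axisRow`, p164803). -/
theorem NPointIsotropyBelowThreshold_of'' :
    Summit.QuantumFields.YangMills.Theses.CertificationLength.NPointIsotropyBelowThreshold :=
  Summit.QuantumFields.YangMills.Theorems.SoftKernelBoostCovariance.Sketch.nPointIsotropyBelowThreshold_of_axisRow
    stub_regularHigh stub_sandwichAxis

end Summit.QuantumFields.YangMills.Cruxes.SoftKernelBoostCovariance.Sketch

end
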